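import Literature.MathematicalPhysics.QuantumFieldTheory.Balaban1983to89.B3Ineq31RegularRegion

/-!
# Bałaban, *(Higgs)₂,₃ quantum fields in a finite volume III. Renormalization* [B3] — (3.1) p. 432 with print's SMOOTH
localization functions: `‖hG_k(Ω,B̃)h′‖_{1,α} ≤ O(1)e^{−δ₀dist(□(v),□(v′))}` for `h, h′` smooth bumps supported in boxes of unit cubes
(p. 420), at a regular non-constant background on big-block-union regions, and for the vector-field propagator

statement-level skeleton of published theorems with citation tags; proofs where landed; nothing here is a claim about the Yang–Mills mass gap

T. Bałaban, Commun. Math. Phys. **88** (1983) 411–445 [cite: Balaban1983Higgs3]; part I, Commun. Math. Phys. **85** (1982) 603–636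
[cite: Balaban1982Higgs1].  PDF held: `paper:balaban1983-higgs-2-3-quantum-fields-finite-volume` (journal page = PDF page + 410), p. 420
[PDF 10] (`p0010.txt`), p. 432 [PDF 22] (`p0022.txt`).

CITATION HEADER (lean-in-tree rule).  Cell `lit-balaban` (HOME `run/shared/lean/pub/lit-balaban/`), Phase-2 proof seat **p40** gen 69 (unit
`lit-balaban-p40`), file 2 of the generation; SKELETON row **B3.Eq3.1** (fold owner r15; decl of record `B3Sect3Statements.Sect3Data.Ineq31`),
taken ON THE OWNER'S WORD (r15 g13, 2026-08-22T23:19Z, HEAD QUESTION Q6: every landed (3.1) member — p03's `B3Ineq31ZeroBox`/`ZeroTorus`/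
`ConstBox`/`ZeroLattice`, this seat's `B3Ineq31RegularTorus`/`B3Ineq31RegularRegion` — reads the localization functions `h, h′` as SHARP unit
cubes).  USED BY NAME, never restated: this seat's `B3Ineq31RegularRegion` (p343859: the blocks `blockKR`/`blockDKR`, the field `kerFR`/`derivFR`,
the read-backs `bounds_of_ineq210R`/`bound_of_ineq211AtR`, the column move `norm_blockDKR_comp_star_sub_le`) and `B3Ineq31RegularTorus`
(p342325: cube geometry, the coordinatewise contours `cpath`, `mem_stepsFwd`/`mem_stepsBwd`, the product-lattice data `PSite`/`PBd`/`hb`/`dirOf`/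
`baseOf`/`pdist`/`unitV`/`unitD`/`transp`, the scale sum `sum_pieces_sep_le'`/`phiSum`, the weights); r14's `B3Ineq210RegularRegion` (`pieceR`,
`Interior`, `ineq210_regularRegion_explicit_small`), p35's `B3Ineq211RegularRegion` (`holderTermR`, `ineq211At_regularRegion_small_explicit`),
p33's `B3Ineq210MixedRegularRegion` (`mixedTermR`, `ineq210_mixed_regularRegion`, `inner_propagatorK_single_comm_R`,
`inner_covDeriv_propagatorK_single_R`), p26's contours `leg`/`legs`/`IsAdm`, p35's chain transport `hol`/`norm_hol_apply_sub_le`, the printed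
SUM form (1.32) `B3Sect1Statements.norm132`.

## What is printed (verbatim)

p. 432 [PDF 22]: *"… ‖hG_k(Ω, B̃)h′‖_{1,α} ≤ O(1)e^{−δ₀dist(□(v),□(v′))}, (3.1) and similarly for the vector field propagator, h, h′ are
localization functions."*  p. 420 [PDF 10]: *"This definition extends in a natural way to functions of many variables. For external vector
fields we have the same definition, but with B̃ = 0. The next thing we need is a further localization in the vertices. For the vertices (1.6)
and (1.7) we localize simply by representing Ω₁ as a sum of unit cubes of the η-lattice. For the remaining vertices we localize, taking for
each leg of the vector field a smooth partition of unity satisfying the condition that a support of each function is contained in a cube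
with sides of length 2."*; after (1.33): *"the functions h, h′ describe localizations of external fields. More exactly if in a vertex v
there is a leg of external field, then we multiply it by a smooth function h such that h = 1 on □(v) and h = 0 outside some neighborhood of
□(v)"*.

WHICH VERTICES GET WHICH KIND (the reading, stated once for page-checking; fold owner's wish 2026-08-22T23:26Z).  Print's p. 420 has TWO kinds
of localization functions: (i) SHARP unit cubes — for the vertices (1.6)/(1.7), `Ω₁` is written as a sum of unit cubes of the `η`-lattice (the
reading of every earlier (3.1) member: p03's `B3Ineq31ZeroBox`/`B3Ineq31ZeroTorus`/`B3Ineq31ConstBox`/`B3Ineq31ZeroLattice`, this seat's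
`B3Ineq31RegularTorus`/`B3Ineq31RegularRegion`, where `h, h′` are indicator functions of `□(v), □(v′)`); (ii) SMOOTH functions — for the
remaining vertices, each leg of the vector field carries a member of a smooth partition of unity supported in a cube of side `2`, and each leg
of an external field at a vertex `v` carries a smooth `h` with `h = 1` on `□(v)`, `h = 0` outside a neighbourhood of `□(v)` (after (1.33)).  THIS
FILE is kind (ii): `h, h′` arbitrary lattice functions obeying the three discrete smoothness bounds below and supported (with their lattice
`1`-collar) in boxes of `m` unit cubes a side (`m = 2` for the side-2 cubes; `m = 3` accommodates «`h = 1` on `□(v)`, `0` outside a neighbourhood»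
with the neighbourhood inside the ring of adjacent cubes); kind (i) is the case `h = 𝟙_{□(v)}` of the sharp-cube files (an indicator has
`|∂^ηh| = L^k` across the cube boundary, so it is NOT an instance of (ii) with `k`-independent constants — the two kinds are formalized separately).

## What this file proves, and how

THE LOCALIZATION FUNCTIONS.  `h, h′ : T_η → ℝ` are "smooth" in the only sense the lattice sees — in the print's units for the step `k`
(`η = L^{−k}`): `|h| ≤ 1`, `|∂^ηh| ≤ c₁` on every bond (`∂^ηh(b) = L^k(h(b₊) − h(b₋))`, `dEta`), and `|∂^ηh(b′) − ∂^ηh(b)| ≤ c₂(|b₋ − b′₋|/L^k)^α`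
for same-direction bonds (`IsSmoothLoc`); the support of `h` together with its lattice neighbours lies in a BOX `S` of unit cubes
(`InBox k lo m`: `⌊x_μ/L^k⌋ ∈ [lo_μ, lo_μ + m)`; the side-2 cubes of p. 420 are `m = 2`), that of `h′` in a box `S′`, the two boxes made of
INTERIOR unit cubes of `Ω` (r14's `Interior`) and at cube distance `≥ D ≥ 1` (every unit cube of `S` from every unit cube of `S′`).

THE FIELD.  `G = (h ⊗ h′)·F`, `F(x,x′) = G_k(Ω,A;x,x′)` the two-variable field of `B3Ineq31RegularRegion` (`kerG z = h(x)h′(x′)·kerFR z`), with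
its covariant `η`-derivatives along the `2d` directions of the product lattice given by THE PRODUCT RULE
`D^η(hF)(b) = h(b₊)·(D^η_AF)(b) + (∂^ηh)(b)·F(b₋)` (`derivG`; PROVED equal to the covariant difference quotient of `G` — `derivG_inl`, and
for column bonds of the transposed slice `x′ ↦ G(x,x′)^*`, `derivG_inr` with `star_kerG`/`star_blockKR` (`G^ε_k(Ω,A;x,y)^* = G^ε_k(Ω,A;y,x)`), the
convention of the torus twin), and the transports `U(A(Γ))∘·∘U(A(Γ′))^*` of (1.32) (`transp`).  THE NORM is the FULL-LATTICE printed SUM form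
(1.32): `normHGHS = norm132` over ALL sites of `T_η × T_η`, ALL product bonds, same-direction pairs at positive sup-distance `pdist` — `G` being
globally defined (and vanishing off `S × S′`).

THE THEOREMS.  §I boxes of unit cubes on the torus (diameter, THE COORDINATEWISE CONTOUR BETWEEN TWO POINTS OF A BOX STAYS IN THE BOX,
separation of two boxes from the cube distances); §II the (1.32) data of `F` on a PAIR OF ADMISSIBLE DOMAINS (`DomPair`: separated, interior,
path-closed, bounded diameter — pairs of boxes of interior cubes qualify, `domPair_of_boxes`): sup, derivative and Hölder parts (the cube
estimates of `B3Ineq31RegularRegion` §4 verbatim with cubes replaced by domains) AND the value-Lipschitz clause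
`‖U(A(Γ))F(z′)U(A(Γ′))^* − F(z)‖ ≤ d(|x−x′| + |y−y′|)/L^k·B` (row move = p35's path lemma on `G_k(Ω,A)δ_yv`, column move = p33's symmetry + the
path lemma); §III THE MULTIPLIER: the four-term expansion `τDG(c′) − DG(c) = a′(τX′ − X) + (a′ − a)X + b′(τY′ − Y) + (b′ − b)Y`
(`a = h′(y)h(b₊)`, `b = h′(y)∂^ηh(b)`, `X = D^η_AF`, `Y = F`) with the inside/outside case split (the coefficients at a bond outside `S × S′`
vanish by the collar hypothesis, `coef_eq_zero`), the moduli of `a, b` from the `h`-data (a path lemma for scalar lattice functions,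
`abs_sub_le_of_isTChain`; two regimes `p ≤ 1`/`p ≥ 1`, `le_add_mul_rpow`) ⇒ `holder_core_mul` (one same-direction pair, WHETHER OR NOT the two
bonds lie in the domains) ⇒ **`normHGHS_le`**: `‖hFh′‖_{1,α} ≤ (K(c₁,c₂,d,m)C_V + C_H + dmC_M)Φe^{−(δL/2)D}`, `K = smoothConst` explicit; §IV
**`ineq31_smooth_regularRegion`** — [B3] (3.1) with smooth localization functions at a regular non-constant background on big-block-union
regions (every `L ≥ 2`), hypothesis-free under r14's `ineq210_regularRegion_small` hypotheses, for every admissible domain pair;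
**`ineq31_smooth_boxes`** — the same for two boxes of `m^d` interior unit cubes at cube distance `≥ D`; and **`ineq31_smooth_vectorTorus`** — the
clause «and similarly for the vector field propagator» with the side-`m` smooth bumps of p. 420 (`C = zeroCharge d`, `Ω = T_ε`, `A = 0`: all
transports are identities — `transp_zeroCharge_eq` —, every box qualifies).

## Honest scope

Boxes of INTERIOR unit cubes only (margin `2r_S + 2L^kK₀(d+1) + 1` to `T_ε ∖ Ω`; none for `Ω = T_ε`), at most `m` cubes a side with
`2mL^k ≤ |T_ε|_μ` (no wrap-around; implied by `m ≤ K₀` and the three-big-blocks hypothesis); "smooth" = the three discrete bounds above with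
constants `c₁, c₂ ≥ 0` (print fixes no partition of unity; any with these bounds is admitted) and the support of `h` strictly inside its box
(its lattice `1`-collar in the box); `m² > 0`; constants depend on `α`, `K₀`, `c₁`, `c₂`, `m` (GAPS G-B3-11: the print's `O(1), δ₀` are uniform);
`|·|` of a block = operator norm; contours = the fixed coordinatewise shortest paths `cpath`; the (3.2)–(3.5) data are not touched; the exponent
is `δ₀·D` with `D` any common lower bound `≥ 1` of the cube distances between the two boxes (`m = 1` admits only bumps vanishing near the
cube boundary; the sharp indicator `𝟙_{□(v)}` is the separate statement of `B3Ineq31RegularRegion`).  No `def … : Prop` fact is introduced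
(`InBox`, `IsSmoothLoc`, `DomPair` are definitions with bodies — predicates on data —, `boxSet`, `sitesS`, `bondsS`, `domB`, `domY`, `dEta`,
`fd`, `fo`, `kerG`, `coefA`, `coefB`, `valY`, `derivG`, `normHGHS`, `smoothConst` concrete data); axioms standard.  Value = kernel certificate of
the localization-function reading of one located estimate of B3 §3, NOT summit progress.
-/

noncomputable section

open scoped BigOperators InnerProductSpace Matrix

namespace Literature.MathematicalPhysics.QuantumFieldTheory.Balaban1983to89.B3Ineq31SmoothLocalization

open HiggsLattice (ChargeData ScalarField siteInner covDeriv)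
open HiggsCovariance (propagatorK E)
open HiggsAveraging (blockIter)
open B1Eq230FluctCov (Ix cb)
open B1Eq221Coordinates (fieldCoord)
open B1Ineq234Concrete (val_blockIter_all tdist_self)
open B1Ineq234LevelZero (tdist_comm tdist_shift_le_one)
open B1TorusChainTransport (IsTChain TNbr hol norm_hol_apply norm_hol_apply_sub_le hol_nil)
open B1TorusCubeCover (half)
open B1TorusRegionHSizes (IsBigBlockUnion isBigBlockUnion_univ)
open B4GaugeCovariance (pathEnd)
open B3Sect3Statements (Sect3Data)
open B3Sect1Statements (norm132)
open LatticeNorms (supNorm_le holderSeminorm_le)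
open B3Ineq210RegularTorus (mesh_eq_pow_mul)
open B3Ineq210RegularRegion (pieceR sum_pieceR Interior interior_univ ineq210_regularRegion_explicit_small)
open B3Ineq211RegularTorus (IsAdm leg legs stepsFwd stepsBwd isTChain_legs pathEnd_legs length_legs_le one_le_tdist_of_ne')
open B3Ineq211RegularRegion (holderTermR ineq211At_regularRegion_small_explicit)
open B3Ineq210MixedRegularTorus (onb dip norm_covDeriv_dip_le_sum norm_apply_single_le norm_covDeriv_apply_single_le
  abs_fieldCoord_single_le fieldCoord_single_of_ne)
open B3Ineq210MixedRegularRegion (mixedTermR inner_propagatorK_single_comm_R inner_covDeriv_propagatorK_single_R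
  ineq210_mixed_regularRegion)
open B3MultiscaleFields (zeroCharge zeroCharge_U)
open B3Ineq31RegularTorus (cubeDist cubeDist_nonneg cubeDist_comm sep_of_cubes mem_stepsFwd mem_stepsBwd two_lt_sitesPerDir cpath
  isAdm_cpath pathEnd_cpath cpath_self PSite PBd hb dirOf baseOf pdist unitV unitD transp phiSum sum_pieces_sep_le' weightV_le weightD_le
  weightM_le weightH_le norm_hol_comp_le norm_hol_le_one)
open B3Ineq31RegularRegion (blockKR blockDKR blockKR_apply blockDKR_apply norm_blockKR_le norm_blockDKR_le norm_hol_comp_blockDKR_sub_le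
  norm_blockDKR_comp_star_sub_le kerFR derivFR bounds_of_ineq210R bound_of_ineq211AtR)

variable {P : HiggsLattice.Params} {N : ℕ}

/-! ## §0 Arithmetic of the units -/

section Units

variable {k : ℕ}

/-- `unitV > 0`. [folklore] -/
private theorem unitV_pos (P : HiggsLattice.Params) (k : ℕ) : 0 < unitV P k := by
  unfold unitV; have := P.mesh_pos k; have := P.mesh_pos 0; positivity

/-- `unitD > 0`. [folklore] -/
private theorem unitD_pos (P : HiggsLattice.Params) (k : ℕ) : 0 < unitD P k := by
  unfold unitD; have := P.mesh_pos k; have := P.mesh_pos 0; positivity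

/-- `Φ_p(δ, L) > 0` for `δ > 0`. [folklore] -/
private theorem phiSum_pos {L : ℕ} (p : ℕ) {δ : ℝ} (hδ : 0 < δ) : 0 < phiSum L p δ := by
  unfold phiSum
  have h1 : 0 < (p.factorial : ℝ) / (δ * 1 / 2) ^ p := by positivity
  have h2 : 0 < 1 - Real.exp (-(δ * 1 / 2 * (((L - 1 : ℕ) : ℝ) + 1))) := by
    rw [sub_pos, Real.exp_lt_one_iff]
    have : (0 : ℝ) < ((L - 1 : ℕ) : ℝ) + 1 := by positivity
    nlinarith
  exact mul_pos h1 (inv_pos.mpr h2)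

/-- `|x−x′|/L^j = (|x−x′|/L^k)·L^{k−j}` for `j ≤ k`. [folklore] -/
private theorem div_pow_eq_div_mul_sc {j : ℕ} (hjk : j ≤ k) (t : ℝ) :
    t / (P.L : ℝ) ^ j = t / (P.L : ℝ) ^ k * (P.L : ℝ) ^ (k - j) := by
  have hL : (P.L : ℝ) ≠ 0 := by have := P.hL; positivity
  obtain ⟨m, rfl⟩ := Nat.exists_eq_add_of_le hjk
  rw [Nat.add_sub_cancel_left, pow_add]
  field_simp

/-- `unitV·ε = unitD/L^k` — one `η`-step of the kernel is `L^{−k}` derivatives: `(L^kε)^{d−2}ε^{−d}·ε = (L^kε)^{d−1}ε^{−d}/L^k`. [folklore] -/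
private theorem unitV_mul_mesh (P : HiggsLattice.Params) (k : ℕ) : unitV P k * P.mesh 0 = unitD P k * ((P.L : ℝ) ^ k)⁻¹ := by
  unfold unitV unitD
  rw [mesh_eq_pow_mul P k]
  have hε : P.mesh 0 ≠ 0 := (P.mesh_pos 0).ne'
  have hL : (P.L : ℝ) ^ k ≠ 0 := pow_ne_zero _ (by have := P.hL; positivity)
  field_simp

/-- `unitD·ε^{−1} = L^k·unitV`. [folklore] -/
private theorem unitD_mul_inv_mesh (P : HiggsLattice.Params) (k : ℕ) : unitD P k * (P.mesh 0)⁻¹ = (P.L : ℝ) ^ k * unitV P k := by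
  unfold unitV unitD
  rw [mesh_eq_pow_mul P k]
  have hε : P.mesh 0 ≠ 0 := (P.mesh_pos 0).ne'
  have hL : (P.L : ℝ) ^ k ≠ 0 := pow_ne_zero _ (by have := P.hL; positivity)
  field_simp

end Units

/-! ## §I Boxes of unit cubes on the torus: diameter, contours staying inside, separation -/

section Boxes

variable {k : ℕ}

/-- **A box of unit cubes of `T_1^{(k)}`**: the fine sites `x` whose cube label `⌊x_μ/L^k⌋` lies in `[lo_μ, lo_μ + m)` in every direction —
`m = 1` a unit cube `□(v)`, `m = 2` the cubes «with sides of length 2» of p. 420. [cite: Balaban1983Higgs3, p.420] -/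
def InBox (k : ℕ) (lo : Fin P.d → ℕ) (m : ℕ) (x : HiggsLattice.Site P 0) : Prop :=
  ∀ μ : Fin P.d, lo μ ≤ (x μ).val / P.L ^ k ∧ (x μ).val / P.L ^ k < lo μ + m

/-- membership in a box is decidable (finitely many coordinate comparisons). [cite: Balaban1983Higgs3, p.420] -/
instance (k : ℕ) (lo : Fin P.d → ℕ) (m : ℕ) : DecidablePred (InBox (P := P) k lo m) := fun x => by
  unfold InBox; infer_instance

/-- The box as a finite set of fine sites. [cite: Balaban1983Higgs3, p.420] -/
def boxSet (k : ℕ) (lo : Fin P.d → ℕ) (m : ℕ) : Finset (HiggsLattice.Site P 0) := Finset.univ.filter (InBox k lo m)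

/-- membership in `boxSet`. [cite: Balaban1983Higgs3, p.420] -/
theorem mem_boxSet {lo : Fin P.d → ℕ} {m : ℕ} {x : HiggsLattice.Site P 0} : x ∈ boxSet k lo m ↔ InBox k lo m x := by
  simp [boxSet]

/-- A box is the union of the unit cubes whose labels lie in it: `x ∈ box ↔ ⌊x/L^k⌋ ∈ ∏[lo_μ, lo_μ+m)`.
[cite: Balaban1982Higgs1, (1.20) p.607] -/
theorem inBox_iff_label {lo : Fin P.d → ℕ} {m : ℕ} (x : HiggsLattice.Site P 0) :
    InBox k lo m x ↔ ∀ μ : Fin P.d, lo μ ≤ ((blockIter k x) μ).val ∧ ((blockIter k x) μ).val < lo μ + m := by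
  simp only [InBox, val_blockIter_all]

/-- Coordinates of a box point: `lo_μL^k ≤ x_μ < (lo_μ + m)L^k`. [cite: Balaban1982Higgs1, (1.20) p.607] -/
theorem val_bounds_of_inBox {lo : Fin P.d → ℕ} {m : ℕ} {x : HiggsLattice.Site P 0} (hx : InBox k lo m x) (μ : Fin P.d) :
    lo μ * P.L ^ k ≤ (x μ).val ∧ (x μ).val < (lo μ + m) * P.L ^ k := by
  have hT : 0 < P.L ^ k := pow_pos P.hL k
  obtain ⟨h1, h2⟩ := hx μ
  constructor
  · exact (Nat.mul_le_mul_right _ h1).trans (Nat.div_mul_le_self _ _)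
  · have h3 : (x μ).val < ((x μ).val / P.L ^ k + 1) * P.L ^ k := by
      rw [add_mul, one_mul]; exact Nat.lt_div_mul_add hT
    exact h3.trans_le (Nat.mul_le_mul_right _ h2)

/-- **Diameter of a box**: two points of a box of `m ≥ 1` cubes a side are at fine distance `≤ mL^k − 1`.
[cite: Balaban1982Higgs1, (1.3) p.604, (1.20) p.607] -/
theorem tdist_le_of_inBox {lo : Fin P.d → ℕ} {m : ℕ} {x y : HiggsLattice.Site P 0} (hx : InBox k lo m x) (hy : InBox k lo m y) :
    HiggsLattice.Site.tdist x y ≤ m * P.L ^ k - 1 := by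
  unfold HiggsLattice.Site.tdist
  refine Finset.sup_le fun μ _ => ?_
  obtain ⟨ha1, ha2⟩ := val_bounds_of_inBox hx μ
  obtain ⟨hb1, hb2⟩ := val_bounds_of_inBox hy μ
  by_cases hle : (y μ).val ≤ (x μ).val
  · calc min (x μ - y μ).val (y μ - x μ).val ≤ (x μ - y μ).val := min_le_left _ _
      _ = (x μ).val - (y μ).val := ZMod.val_sub hle
      _ ≤ m * P.L ^ k - 1 := by
          have : (lo μ + m) * P.L ^ k = lo μ * P.L ^ k + m * P.L ^ k := by ring
          omega
  · have hle' : (x μ).val ≤ (y μ).val := (not_le.mp hle).le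
    calc min (x μ - y μ).val (y μ - x μ).val ≤ (y μ - x μ).val := min_le_right _ _
      _ = (y μ).val - (x μ).val := ZMod.val_sub hle'
      _ ≤ m * P.L ^ k - 1 := by
          have : (lo μ + m) * P.L ^ k = lo μ * P.L ^ k + m * P.L ^ k := by ring
          omega

/-- The same in real form: `|x − y| ≤ mL^k − 1 ≤ mL^k`, i.e. `|x − y|/L^k ≤ m`. [cite: Balaban1982Higgs1, (1.3) p.604] -/
theorem tdist_div_le_of_inBox {lo : Fin P.d → ℕ} {m : ℕ} {x y : HiggsLattice.Site P 0} (hx : InBox k lo m x) (hy : InBox k lo m y) :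
    (HiggsLattice.Site.tdist x y : ℝ) / (P.L : ℝ) ^ k ≤ m := by
  have hT : (0 : ℝ) < (P.L : ℝ) ^ k := pow_pos (by exact_mod_cast P.hL) k
  rw [div_le_iff₀ hT]
  have h := tdist_le_of_inBox hx hy
  have h2 : HiggsLattice.Site.tdist x y ≤ m * P.L ^ k := h.trans (Nat.sub_le _ _)
  exact_mod_cast h2

/-- quotient squeeze: `loT ≤ v < (lo+m)T` gives `lo ≤ v/T < lo + m`. [folklore] -/
private theorem div_mem_of_mem {T lo m v : ℕ} (hT : 0 < T) (h1 : lo * T ≤ v) (h2 : v < (lo + m) * T) :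
    lo ≤ v / T ∧ v / T < lo + m :=
  ⟨(Nat.le_div_iff_mul_le hT).mpr h1, (Nat.div_lt_iff_lt_mul hT).mpr h2⟩

/-- **One leg inside a box**: if `x_μ` and `y_μ` lie in the coordinate range `[loL^k, (lo+m)L^k)` and the torus is at least twice as long
(`2mL^k ≤ |T_ε|_μ`, so the shorter arc is the direct segment), every point of p26's leg from `x` towards `y` in direction `μ` has its
`μ`-coordinate in that range and all other coordinates those of `x`. [cite: Balaban1982Higgs1, (1.3) p.604, (1.20) p.607] -/
theorem mem_leg_interval {μ : Fin P.d} {x y : HiggsLattice.Site P 0} {lo m : ℕ} (hn : 2 * (m * P.L ^ k) ≤ P.sitesPerDir 0 μ)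
    (hx : lo * P.L ^ k ≤ (x μ).val ∧ (x μ).val < (lo + m) * P.L ^ k)
    (hy : lo * P.L ^ k ≤ (y μ).val ∧ (y μ).val < (lo + m) * P.L ^ k) {z : HiggsLattice.Site P 0} (hz : z ∈ leg x y μ) :
    (lo * P.L ^ k ≤ (z μ).val ∧ (z μ).val < (lo + m) * P.L ^ k) ∧ ∀ ν, ν ≠ μ → z ν = x ν := by
  set n := P.sitesPerDir 0 μ with hn_def
  set a := (x μ).val with ha
  set b := (y μ).val with hb
  have han : a < n := ZMod.val_lt _
  have hbn : b < n := ZMod.val_lt _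
  have hab_lt : a - b < m * P.L ^ k ∧ b - a < m * P.L ^ k := by
    have : (lo + m) * P.L ^ k = lo * P.L ^ k + m * P.L ^ k := by ring
    omega
  -- the two arc lengths
  have hval_sub_xy : b ≤ a → (x μ - y μ).val = a - b := fun h => ZMod.val_sub h
  have hval_sub_yx : a ≤ b → (y μ - x μ).val = b - a := fun h => ZMod.val_sub h
  have hval_rev : ∀ {u w : ZMod n}, u ≠ w → (w - u).val = n - (u - w).val := fun {u w} h => by
    rw [← neg_sub, ZMod.neg_val, if_neg (sub_ne_zero.mpr h)]
  unfold leg at hz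
  split_ifs at hz with hcase
  · -- forward arc chosen: then `a ≤ b`
    have hab : a ≤ b := by
      by_contra hlt
      push Not at hlt
      have hne : x μ ≠ y μ := fun e => by rw [ha, hb, e] at hlt; exact lt_irrefl _ hlt
      have h1 : (x μ - y μ).val = a - b := hval_sub_xy hlt.le
      have h2 : (y μ - x μ).val = n - (a - b) := by rw [hval_rev hne, h1]
      rw [h1, h2] at hcase
      omega
    obtain ⟨t, ht1, htn, rfl⟩ := mem_stepsFwd hz
    rw [hval_sub_yx hab] at htn
    refine ⟨?_, fun ν hν => by rw [Function.update_of_ne hν]⟩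
    rw [Function.update_self]
    have htlt : t < n := by omega
    have hval : (x μ + (t : ZMod n)).val = a + t := by
      rw [ZMod.val_add_of_lt, ZMod.val_natCast, Nat.mod_eq_of_lt htlt]
      rw [ZMod.val_natCast, Nat.mod_eq_of_lt htlt]; omega
    rw [hval]
    omega
  · -- backward arc chosen: then `b ≤ a`
    have hba : b ≤ a := by
      by_contra hlt
      push Not at hlt
      have hne : y μ ≠ x μ := fun e => by rw [ha, hb, e] at hlt; exact lt_irrefl _ hlt
      have h1 : (y μ - x μ).val = b - a := hval_sub_yx hlt.le
      have h2 : (x μ - y μ).val = n - (b - a) := by rw [hval_rev hne, h1]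
      rw [h1, h2] at hcase
      omega
    obtain ⟨t, ht1, htn, rfl⟩ := mem_stepsBwd hz
    rw [hval_sub_xy hba] at htn
    refine ⟨?_, fun ν hν => by rw [Function.update_of_ne hν]⟩
    rw [Function.update_self]
    have htlt : t < n := by omega
    have htval : ((t : ℕ) : ZMod n).val = t := by rw [ZMod.val_natCast, Nat.mod_eq_of_lt htlt]
    have hval : (x μ - (t : ZMod n)).val = a - t := by
      rw [ZMod.val_sub (by rw [htval]; omega), htval]
    rw [hval]
    omega

/-- **The coordinatewise path between two points of a box stays in the box**: for `x, y` in the box and a start point `x′` whose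
coordinates are each `x`'s or `y`'s, every site of p26's `legs y x′ ms` lies in the box (`2mL^k ≤ |T_ε|_μ` in every direction).
[cite: Balaban1982Higgs1, (1.20) p.607] -/
theorem inBox_of_mem_legs {lo : Fin P.d → ℕ} {m : ℕ} (hn : ∀ μ, 2 * (m * P.L ^ k) ≤ P.sitesPerDir 0 μ) {x y : HiggsLattice.Site P 0}
    (hx : InBox k lo m x) (hy : InBox k lo m y) :
    ∀ (x' : HiggsLattice.Site P 0) (ms : List (Fin P.d)), (∀ ν, x' ν = x ν ∨ x' ν = y ν) →
      ∀ z ∈ legs y x' ms, InBox k lo m z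
  | x', [], _, z, hz => by simp [legs] at hz
  | x', μ :: ms, hx', z, hz => by
    rw [legs, List.mem_append] at hz
    have hT : 0 < P.L ^ k := pow_pos P.hL k
    -- the current start point is in the box
    have hx'v : ∀ ν, lo ν * P.L ^ k ≤ (x' ν).val ∧ (x' ν).val < (lo ν + m) * P.L ^ k := fun ν => by
      rcases hx' ν with h | h
      · rw [h]; exact val_bounds_of_inBox hx ν
      · rw [h]; exact val_bounds_of_inBox hy ν
    rcases hz with hz | hz
    · -- on the leg in direction `μ`
      obtain ⟨hμ, hν⟩ := mem_leg_interval (hn μ) (hx'v μ) (val_bounds_of_inBox hy μ) hz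
      intro ν
      by_cases h : ν = μ
      · subst h; exact div_mem_of_mem hT hμ.1 hμ.2
      · rw [hν ν h]; exact div_mem_of_mem hT (hx'v ν).1 (hx'v ν).2
    · -- on the later legs, from the corner `x′` with its `μ`-th coordinate set to `y_μ`
      refine inBox_of_mem_legs hn hx hy (Function.update x' μ (y μ)) ms (fun ν => ?_) z hz
      by_cases h : ν = μ
      · subst h; exact Or.inr (Function.update_self _ _ _)
      · rw [Function.update_of_ne h]; exact hx' ν

/-- **`Γ_{y₁,y₂}` between two points of a box stays in the box** (the contour `cpath` of (1.32)). [cite: Balaban1982Higgs1, (1.20) p.607] -/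
theorem inBox_of_mem_cpath {lo : Fin P.d → ℕ} {m : ℕ} (hn : ∀ μ, 2 * (m * P.L ^ k) ≤ P.sitesPerDir 0 μ) {y₁ y₂ : HiggsLattice.Site P 0}
    (h₁ : InBox k lo m y₁) (h₂ : InBox k lo m y₂) : ∀ z ∈ y₁ :: cpath y₁ y₂, InBox k lo m z := by
  intro z hz
  rcases List.mem_cons.mp hz with rfl | hz
  · exact h₁
  · exact inBox_of_mem_legs hn h₁ h₂ y₁ (List.finRange P.d) (fun ν => Or.inl rfl) z hz

/-- **Separation of two boxes from the cube distances**: if every unit cube of the first box is at cube distance `≥ D ≥ 1` from every unit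
cube of the second, then points of the two boxes are `≥ L^kD + 1` apart. [cite: Balaban1983Higgs3, (3.1) p.432] -/
theorem sep_of_boxes (hk : k ≤ P.K) {lo lo' : Fin P.d → ℕ} {m m' : ℕ} {D : ℝ} (h1 : 1 ≤ D)
    (hD : ∀ v v' : HiggsLattice.Site P k, (∀ μ, lo μ ≤ (v μ).val ∧ (v μ).val < lo μ + m) →
      (∀ μ, lo' μ ≤ (v' μ).val ∧ (v' μ).val < lo' μ + m') → D ≤ cubeDist k v v')
    {x x' : HiggsLattice.Site P 0} (hx : InBox k lo m x) (hx' : InBox k lo' m' x') :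
    (P.L : ℝ) ^ k * D + 1 ≤ (HiggsLattice.Site.tdist x x' : ℝ) := by
  have hT : (0 : ℝ) ≤ (P.L : ℝ) ^ k := by positivity
  have hDc : D ≤ cubeDist k (blockIter k x) (blockIter k x') :=
    hD _ _ ((inBox_iff_label x).1 hx) ((inBox_iff_label x').1 hx')
  have h := sep_of_cubes hk (x := x) (x' := x') rfl rfl (h1.trans hDc)
  nlinarith [mul_le_mul_of_nonneg_left hDc hT]

/-- No wrap-around for boxes of at most `K₀` cubes a side under the three-big-blocks hypothesis: `2mL^k ≤ 3L^kK₀ ≤ |T_ε|_μ` when `m ≤ K₀`.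
[cite: Balaban1982Higgs1, (1.2) p.604] -/
theorem two_mul_box_le {m K₀ : ℕ} (hm : m ≤ K₀) (h3 : ∀ μ, 3 * half P k K₀ ≤ P.sitesPerDir 0 μ) (μ : Fin P.d) :
    2 * (m * P.L ^ k) ≤ P.sitesPerDir 0 μ := by
  refine le_trans ?_ (h3 μ)
  unfold half
  nlinarith [Nat.zero_le (P.L ^ k), hm]

end Boxes

/-! ## §II The (1.32) data of `F = G_k(Ω,A;·,·)` on a pair of admissible domains `S × S′` -/

section Domains

variable {k K₀ : ℕ} {Ω : Finset (HiggsLattice.Site P 0)}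

/-- **An admissible pair of localization domains** `S, S′ ⊆ T_η` at scale `k`: separated (`L^kD + 1 ≤ |x − x′|`, `D ≥ 1`), made of interior
points of `Ω`, closed under the coordinatewise contours `cpath` between their points, and of diameter `≤ mL^k` — the properties of a pair of
boxes of interior unit cubes at cube distance `≥ D` (`domPair_of_boxes`), which are all the estimates of (3.1) use of the cubes.
[cite: Balaban1983Higgs3, (3.1) p.432] [cite: Balaban1982Higgs1, Prop. 2.1 p.610] -/
structure DomPair (k K₀ : ℕ) (Ω : Finset (HiggsLattice.Site P 0)) (m : ℕ) (D : ℝ) (S S' : Finset (HiggsLattice.Site P 0)) : Prop where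
  one_le : 1 ≤ D
  sep : ∀ x ∈ S, ∀ x' ∈ S', (P.L : ℝ) ^ k * D + 1 ≤ (HiggsLattice.Site.tdist x x' : ℝ)
  interior : ∀ x ∈ S, Interior k K₀ Ω x
  interior' : ∀ x ∈ S', Interior k K₀ Ω x
  path : ∀ y₁ ∈ S, ∀ y₂ ∈ S, ∀ z ∈ y₁ :: cpath y₁ y₂, z ∈ S
  path' : ∀ y₁ ∈ S', ∀ y₂ ∈ S', ∀ z ∈ y₁ :: cpath y₁ y₂, z ∈ S'
  diam : ∀ y₁ ∈ S, ∀ y₂ ∈ S, (HiggsLattice.Site.tdist y₁ y₂ : ℝ) / (P.L : ℝ) ^ k ≤ m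
  diam' : ∀ y₁ ∈ S', ∀ y₂ ∈ S', (HiggsLattice.Site.tdist y₁ y₂ : ℝ) / (P.L : ℝ) ^ k ≤ m

/-- The admissible-pair properties are symmetric in the two domains. [cite: Balaban1983Higgs3, (3.1) p.432] -/
theorem DomPair.symm {m : ℕ} {D : ℝ} {S S' : Finset (HiggsLattice.Site P 0)} (h : DomPair k K₀ Ω m D S S') :
    DomPair k K₀ Ω m D S' S where
  one_le := h.one_le
  sep := fun x hx x' hx' => by rw [tdist_comm]; exact h.sep x' hx' x hx
  interior := h.interior'
  interior' := h.interior
  path := h.path'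
  path' := h.path
  diam := h.diam'
  diam' := h.diam

/-- **Two boxes of interior unit cubes at cube distance `≥ D ≥ 1` form an admissible pair** (no wrap-around: `2mL^k ≤ |T_ε|_μ`).
[cite: Balaban1983Higgs3, (3.1) p.432] [cite: Balaban1982Higgs1, Prop. 2.1 p.610] -/
theorem domPair_of_boxes (hk : k ≤ P.K) {lo lo' : Fin P.d → ℕ} {m : ℕ} {D : ℝ} (hn : ∀ μ, 2 * (m * P.L ^ k) ≤ P.sitesPerDir 0 μ)
    (h1 : 1 ≤ D)
    (hD : ∀ v v' : HiggsLattice.Site P k, (∀ μ, lo μ ≤ (v μ).val ∧ (v μ).val < lo μ + m) →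
      (∀ μ, lo' μ ≤ (v' μ).val ∧ (v' μ).val < lo' μ + m) → D ≤ cubeDist k v v')
    (hS : ∀ x, InBox k lo m x → Interior k K₀ Ω x) (hS' : ∀ x, InBox k lo' m x → Interior k K₀ Ω x) :
    DomPair k K₀ Ω m D (boxSet k lo m) (boxSet k lo' m) where
  one_le := h1
  sep := fun _ hx _ hx' => sep_of_boxes hk h1 hD (mem_boxSet.1 hx) (mem_boxSet.1 hx')
  interior := fun x hx => hS x (mem_boxSet.1 hx)
  interior' := fun x hx => hS' x (mem_boxSet.1 hx)
  path := fun _ h₁ _ h₂ z hz => mem_boxSet.2 (inBox_of_mem_cpath hn (mem_boxSet.1 h₁) (mem_boxSet.1 h₂) z hz)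
  path' := fun _ h₁ _ h₂ z hz => mem_boxSet.2 (inBox_of_mem_cpath hn (mem_boxSet.1 h₁) (mem_boxSet.1 h₂) z hz)
  diam := fun _ h₁ _ h₂ => tdist_div_le_of_inBox (mem_boxSet.1 h₁) (mem_boxSet.1 h₂)
  diam' := fun _ h₁ _ h₂ => tdist_div_le_of_inBox (mem_boxSet.1 h₁) (mem_boxSet.1 h₂)

/-- The localization domain `S × S′` of the product lattice. [cite: Balaban1983Higgs3, (3.1) p.432] -/
def sitesS (S S' : Finset (HiggsLattice.Site P 0)) : Finset (PSite P) := S ×ˢ S'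

/-- The product bonds with BOTH ends in `S × S′`. [cite: Balaban1983Higgs3, (1.32) p.420] -/
def bondsS (S S' : Finset (HiggsLattice.Site P 0)) : Finset (PBd P) :=
  (Finset.univ.filter fun c : Fin P.d × PSite P => c.2 ∈ sitesS S S' ∧ c.2.1.shift c.1 ∈ S).disjSum
    (Finset.univ.filter fun c : Fin P.d × PSite P => c.2 ∈ sitesS S S' ∧ c.2.2.shift c.1 ∈ S')

/-- Membership in `S × S′`. [cite: Balaban1983Higgs3, (3.1) p.432] -/
theorem mem_sitesS {S S' : Finset (HiggsLattice.Site P 0)} {z : PSite P} : z ∈ sitesS S S' ↔ z.1 ∈ S ∧ z.2 ∈ S' :=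
  Finset.mem_product

/-- The domain of the differentiated variable of a product bond: `S` for row bonds, `S′` for column bonds. [cite: Balaban1983Higgs3, (1.32) p.420] -/
def domB (S S' : Finset (HiggsLattice.Site P 0)) : PBd P → Finset (HiggsLattice.Site P 0) := Sum.elim (fun _ => S) (fun _ => S')

/-- The domain of the other variable: `S′` for row bonds, `S` for column bonds. [cite: Balaban1983Higgs3, (1.32) p.420] -/
def domY (S S' : Finset (HiggsLattice.Site P 0)) : PBd P → Finset (HiggsLattice.Site P 0) := Sum.elim (fun _ => S') (fun _ => S)

/-- What a product bond of `S × S′` knows: its bond's two ends lie in its domain, its other site in the other domain, its base point in `S × S′`.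
[cite: Balaban1983Higgs3, (1.32) p.420] -/
theorem bondsS_spec {S S' : Finset (HiggsLattice.Site P 0)} {c : PBd P} (hc : c ∈ bondsS S S') :
    (hb c).1.src ∈ domB S S' c ∧ (hb c).1.tgt ∈ domB S S' c ∧ (hb c).2 ∈ domY S S' c ∧ baseOf c ∈ sitesS S S' := by
  rw [bondsS, Finset.mem_disjSum] at hc
  rcases hc with ⟨c, hc, rfl⟩ | ⟨c, hc, rfl⟩
  · simp only [Finset.mem_filter, Finset.mem_univ, true_and, mem_sitesS] at hc
    exact ⟨hc.1.1, hc.2, hc.1.2, mem_sitesS.2 hc.1⟩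
  · simp only [Finset.mem_filter, Finset.mem_univ, true_and, mem_sitesS] at hc
    exact ⟨hc.1.2, hc.2, hc.1.1, mem_sitesS.2 hc.1⟩

/-- The criterion for a ROW bond to lie in `bondsS`. [cite: Balaban1983Higgs3, (1.32) p.420] -/
theorem inl_mem_bondsS_iff {S S' : Finset (HiggsLattice.Site P 0)} {μ : Fin P.d} {x x' : HiggsLattice.Site P 0} :
    (Sum.inl (μ, (x, x')) : PBd P) ∈ bondsS S S' ↔ x ∈ S ∧ x' ∈ S' ∧ x.shift μ ∈ S := by
  simp [bondsS, Finset.mem_disjSum, mem_sitesS, and_assoc]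

/-- The criterion for a COLUMN bond to lie in `bondsS`. [cite: Balaban1983Higgs3, (1.32) p.420] -/
theorem inr_mem_bondsS_iff {S S' : Finset (HiggsLattice.Site P 0)} {ν : Fin P.d} {x x' : HiggsLattice.Site P 0} :
    (Sum.inr (ν, (x, x')) : PBd P) ∈ bondsS S S' ↔ x ∈ S ∧ x' ∈ S' ∧ x'.shift ν ∈ S' := by
  simp [bondsS, Finset.mem_disjSum, mem_sitesS, and_assoc]

/-- The admissible pair seen from a product bond: (domain of the bond, domain of the other site) is `(S, S′)` or `(S′, S)` — an admissible pair
either way. [cite: Balaban1983Higgs3, (3.1) p.432] -/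
theorem DomPair.ofBond {m : ℕ} {D : ℝ} {S S' : Finset (HiggsLattice.Site P 0)} (h : DomPair k K₀ Ω m D S S') (c : PBd P) :
    DomPair k K₀ Ω m D (domB S S' c) (domY S S' c) := by
  rcases c with c | c
  · exact h
  · exact h.symm

/-- Same-direction product bonds have the same domains, `T_ε`-bonds of the same direction, and the distance of their base points is
`max(|bond bases|, |other sites|)/L^k`. [cite: Balaban1983Higgs3, (1.32) p.420] -/
theorem sameDir_specS (S S' : Finset (HiggsLattice.Site P 0)) {c c' : PBd P} (h : dirOf c = dirOf c') :
    (hb c').1 = ⟨(hb c').1.src, (hb c).1.dir⟩ ∧ domB S S' c' = domB S S' c ∧ domY S S' c' = domY S S' c ∧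
      pdist k (baseOf c) (baseOf c')
        = max (HiggsLattice.Site.tdist (hb c).1.src (hb c').1.src : ℝ) (HiggsLattice.Site.tdist (hb c).2 (hb c').2 : ℝ)
            / (P.L : ℝ) ^ k := by
  rcases c with ⟨μ, z⟩ | ⟨μ, z⟩ <;> rcases c' with ⟨μ', z'⟩ | ⟨μ', z'⟩ <;>
    simp only [dirOf, Sum.elim_inl, Sum.elim_inr, Sum.inl.injEq, Sum.inr.injEq, reduceCtorEq] at h
  · subst h; exact ⟨rfl, rfl, rfl, rfl⟩
  · subst h; refine ⟨rfl, rfl, rfl, ?_⟩; simp only [pdist, baseOf, hb, Sum.elim_inr]; rw [max_comm]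

variable {C : ChargeData N} {A : HiggsLattice.VecField P 0} {msq a : ℝ} {m : ℕ} {D : ℝ} {S S' : Finset (HiggsLattice.Site P 0)}

/-- the separation of an admissible pair read as `1 ≤ D ≤ |x − x′|/L^k`. [cite: Balaban1983Higgs3, (3.1) p.432] -/
theorem DomPair.le_sepD (h : DomPair k K₀ Ω m D S S') {x x' : HiggsLattice.Site P 0} (hx : x ∈ S) (hx' : x' ∈ S') :
    D ≤ (HiggsLattice.Site.tdist x x' : ℝ) / (P.L : ℝ) ^ k := by
  have hT : (0 : ℝ) < (P.L : ℝ) ^ k := pow_pos (by exact_mod_cast P.hL) k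
  rw [le_div_iff₀ hT]
  have := h.sep x hx x' hx'
  nlinarith

/-- **Part 1 on a domain pair — the kernel**: `|G_k(Ω,A;x,x′)| ≤ C_V·Φ·e^{−(δL/2)D}` on `S × S′`, from the value clause of (2.10) at interior
points, summed over the pieces (2.6) at separated arguments. [cite: Balaban1983Higgs3, (3.1) p.432] [cite: Balaban1983Higgs3, (2.10) p.426] -/
theorem sup_part_leS (hdom : DomPair k K₀ Ω m D S S') (hL2 : 2 ≤ P.L) (hm : 0 < msq) (ha : 0 < a) (hk1 : 1 ≤ k) (hkK : k ≤ P.K)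
    {δ CV : ℝ} (hδ : 0 < δ) (hCV : 0 ≤ CV)
    (hV : ∀ (j : ℕ) (x x' : HiggsLattice.Site P 0), Interior k K₀ Ω x → Interior k K₀ Ω x' →
      (P.mesh 0 ^ P.d)⁻¹ * ∑ i' : Ix N, ‖pieceR C Ω A msq a k j (cb P N 0 (x', i')) x‖
        ≤ CV * (P.mesh j ^ 2 * (P.mesh j ^ P.d)⁻¹) * Real.exp (-(δ * ((HiggsLattice.Site.tdist x x' : ℝ) / (P.L : ℝ) ^ j))))
    {z : PSite P} (hz : z ∈ sitesS S S') :
    ‖kerFR C Ω A msq a k z‖ ≤ CV * phiSum P.L (P.d + 1) δ * Real.exp (-(δ * P.L / 2 * D)) := by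
  obtain ⟨hx, hx'⟩ := mem_sitesS.1 hz
  have hL1 : 1 < P.L := by omega
  have hDc : D ≤ (HiggsLattice.Site.tdist z.1 z.2 : ℝ) / (P.L : ℝ) ^ k := hdom.le_sepD hx hx'
  have hD1 : 1 ≤ (HiggsLattice.Site.tdist z.1 z.2 : ℝ) / (P.L : ℝ) ^ k := hdom.one_le.trans hDc
  have hU : 0 ≤ P.mesh k ^ P.d * (P.mesh k ^ 2)⁻¹ := by have := P.mesh_pos k; positivity
  have hker : ‖kerFR C Ω A msq a k z‖
      ≤ ∑ j ∈ Finset.range k, P.mesh k ^ P.d * (P.mesh k ^ 2)⁻¹ *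
          ((P.mesh 0 ^ P.d)⁻¹ * ∑ i' : Ix N, ‖pieceR C Ω A msq a k j (cb P N 0 (z.2, i')) z.1‖) := by
    rw [kerFR, norm_smul, Real.norm_eq_abs, abs_of_pos (unitV_pos P k)]
    calc unitV P k * ‖blockKR C Ω A msq a k z.1 z.2‖
        ≤ unitV P k * ∑ i' : Ix N, ∑ j ∈ Finset.range k, ‖pieceR C Ω A msq a k j (cb P N 0 (z.2, i')) z.1‖ :=
          mul_le_mul_of_nonneg_left ((norm_blockKR_le z.1 z.2).trans (Finset.sum_le_sum fun i' _ =>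
            B3Ineq31RegularRegion.norm_G_apply_le_sumR C Ω A msq a hm ha hL1 hk1 hkK _ z.1)) (unitV_pos P k).le
      _ = _ := by
          rw [Finset.sum_comm, unitV, Finset.mul_sum]
          exact Finset.sum_congr rfl fun j _ => mul_assoc _ _ _
  refine hker.trans ?_
  have hmain := sum_pieces_sep_le' (k := k) hL2 (p := P.d + 1) hCV zero_le_one hδ hD1 hDc
    (fun j => P.mesh k ^ P.d * (P.mesh k ^ 2)⁻¹ *
      ((P.mesh 0 ^ P.d)⁻¹ * ∑ i' : Ix N, ‖pieceR C Ω A msq a k j (cb P N 0 (z.2, i')) z.1‖))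
    (fun j => P.mesh k ^ P.d * (P.mesh k ^ 2)⁻¹ * (P.mesh j ^ 2 * (P.mesh j ^ P.d)⁻¹)) ?_ ?_
  · rw [mul_one] at hmain; exact hmain
  · intro j hj
    have h := mul_le_mul_of_nonneg_left (hV j z.1 z.2 (hdom.interior _ hx) (hdom.interior' _ hx')) hU
    rw [div_pow_eq_div_mul_sc (le_of_lt hj)] at h
    refine h.trans (le_of_eq ?_); ring
  · intro j hj; exact weightV_le (le_of_lt hj)

/-- **The raw derivative bound on a domain pair**: for a `T_ε`-bond with source in one domain and the other site in the other domain,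
`(L^kε)^{d−1}ε^{−d}‖(D G^ε_k(Ω,A))(b, y)‖ ≤ C_V·Φ·e^{−(δL/2)D}` (the target of `b` need not lie in the domain — only interior points are used).
[cite: Balaban1983Higgs3, (3.1) p.432] [cite: Balaban1983Higgs3, (2.10) p.426] -/
theorem deriv_raw_leS (hdom : DomPair k K₀ Ω m D S S') (hL2 : 2 ≤ P.L) (hm : 0 < msq) (ha : 0 < a) (hk1 : 1 ≤ k) (hkK : k ≤ P.K)
    {δ CV : ℝ} (hδ : 0 < δ) (hCV : 0 ≤ CV)
    (hDv : ∀ (j : ℕ) (μ : Fin P.d) (x x' : HiggsLattice.Site P 0), Interior k K₀ Ω x → Interior k K₀ Ω x' →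
      (P.mesh 0 ^ P.d)⁻¹ * ∑ i' : Ix N, ‖covDeriv C A (pieceR C Ω A msq a k j (cb P N 0 (x', i'))) ⟨x, μ⟩‖
        ≤ CV * (P.mesh j * (P.mesh j ^ P.d)⁻¹) * Real.exp (-(δ * ((HiggsLattice.Site.tdist x x' : ℝ) / (P.L : ℝ) ^ j))))
    {x y : HiggsLattice.Site P 0} (hx : x ∈ S) (hy : y ∈ S') (μ : Fin P.d) :
    unitD P k * ‖blockDKR C Ω A msq a k ⟨x, μ⟩ y‖ ≤ CV * phiSum P.L (P.d + 1) δ * Real.exp (-(δ * P.L / 2 * D)) := by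
  have hL1 : 1 < P.L := by omega
  have hDc : D ≤ (HiggsLattice.Site.tdist x y : ℝ) / (P.L : ℝ) ^ k := hdom.le_sepD hx hy
  have hD1 : 1 ≤ (HiggsLattice.Site.tdist x y : ℝ) / (P.L : ℝ) ^ k := hdom.one_le.trans hDc
  have hU : 0 ≤ P.mesh k ^ P.d * (P.mesh k)⁻¹ := by have := P.mesh_pos k; positivity
  have hker : unitD P k * ‖blockDKR C Ω A msq a k ⟨x, μ⟩ y‖
      ≤ ∑ j ∈ Finset.range k, P.mesh k ^ P.d * (P.mesh k)⁻¹ *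
          ((P.mesh 0 ^ P.d)⁻¹ * ∑ i' : Ix N, ‖covDeriv C A (pieceR C Ω A msq a k j (cb P N 0 (y, i'))) ⟨x, μ⟩‖) := by
    calc unitD P k * ‖blockDKR C Ω A msq a k ⟨x, μ⟩ y‖
        ≤ unitD P k * ∑ i' : Ix N, ∑ j ∈ Finset.range k, ‖covDeriv C A (pieceR C Ω A msq a k j (cb P N 0 (y, i'))) ⟨x, μ⟩‖ :=
          mul_le_mul_of_nonneg_left ((norm_blockDKR_le _ y).trans (Finset.sum_le_sum fun i' _ =>
            B3Ineq31RegularRegion.norm_covDeriv_G_apply_le_sumR C Ω A msq a hm ha hL1 hk1 hkK _ _)) (unitD_pos P k).le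
      _ = _ := by
          rw [Finset.sum_comm, unitD, Finset.mul_sum]
          exact Finset.sum_congr rfl fun j _ => mul_assoc _ _ _
  refine hker.trans ?_
  have hmain := sum_pieces_sep_le' (k := k) hL2 (p := P.d + 1) hCV zero_le_one hδ hD1 hDc
    (fun j => P.mesh k ^ P.d * (P.mesh k)⁻¹ *
      ((P.mesh 0 ^ P.d)⁻¹ * ∑ i' : Ix N, ‖covDeriv C A (pieceR C Ω A msq a k j (cb P N 0 (y, i'))) ⟨x, μ⟩‖))
    (fun j => P.mesh k ^ P.d * (P.mesh k)⁻¹ * (P.mesh j * (P.mesh j ^ P.d)⁻¹)) ?_ ?_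
  · rw [mul_one] at hmain; exact hmain
  · intro j hj
    have h := mul_le_mul_of_nonneg_left (hDv j μ x y (hdom.interior _ hx) (hdom.interior' _ hy)) hU
    rw [div_pow_eq_div_mul_sc (le_of_lt hj)] at h
    refine h.trans (le_of_eq ?_); ring
  · intro j hj; exact weightD_le (le_of_lt hj)

/-- **Part 2 on a domain pair — the covariant derivatives**: `‖D^ηF(c)‖ ≤ C_V·Φ·e^{−(δL/2)D}` for every product bond of `S × S′` (row and column
alike). [cite: Balaban1983Higgs3, (3.1) p.432] [cite: Balaban1983Higgs3, (2.10) p.426] -/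
theorem deriv_part_leS (hdom : DomPair k K₀ Ω m D S S') (hL2 : 2 ≤ P.L) (hm : 0 < msq) (ha : 0 < a) (hk1 : 1 ≤ k) (hkK : k ≤ P.K)
    {δ CV : ℝ} (hδ : 0 < δ) (hCV : 0 ≤ CV)
    (hDv : ∀ (j : ℕ) (μ : Fin P.d) (x x' : HiggsLattice.Site P 0), Interior k K₀ Ω x → Interior k K₀ Ω x' →
      (P.mesh 0 ^ P.d)⁻¹ * ∑ i' : Ix N, ‖covDeriv C A (pieceR C Ω A msq a k j (cb P N 0 (x', i'))) ⟨x, μ⟩‖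
        ≤ CV * (P.mesh j * (P.mesh j ^ P.d)⁻¹) * Real.exp (-(δ * ((HiggsLattice.Site.tdist x x' : ℝ) / (P.L : ℝ) ^ j))))
    {c : PBd P} (hc : c ∈ bondsS S S') :
    ‖derivFR C Ω A msq a k c‖ ≤ CV * phiSum P.L (P.d + 1) δ * Real.exp (-(δ * P.L / 2 * D)) := by
  obtain ⟨hbs, -, hy, -⟩ := bondsS_spec hc
  have hdom' := hdom.ofBond c
  unfold derivFR
  rw [norm_smul, Real.norm_eq_abs, abs_of_pos (unitD_pos P k)]
  generalize domB S S' c = Sb at hbs hdom'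
  generalize domY S S' c = Sy at hy hdom'
  generalize (hb c).1 = b at hbs ⊢
  generalize (hb c).2 = y at hy ⊢
  obtain ⟨x, μ⟩ := b
  exact deriv_raw_leS hdom' hL2 hm ha hk1 hkK hδ hCV hDv hbs hy μ

/-- **Part 3a on a domain pair — the column move**: for `b` with source in `S_b` and `y₁, y₂ ∈ S_y`,
`‖(DG^ε_k(Ω,A))(b,y₂)∘U(A(Γ_{y₁,y₂}))^* − (DG^ε_k(Ω,A))(b,y₁)‖ ≤ d|y₁−y₂|·M_×`, `M_× = ε^dε·C_M(L^kε)^{−d}Φe^{−(δL/2)D}` (the contour stays in `S_y`;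
the mixed clause of (2.10) at interior points). [cite: Balaban1983Higgs3, (1.32) p.420] [cite: Balaban1983Higgs3, (2.10) p.426] -/
theorem termA_leS {Sb Sy : Finset (HiggsLattice.Site P 0)} (hdom : DomPair k K₀ Ω m D Sb Sy) (hS : ∀ μ, 2 < P.sitesPerDir 0 μ)
    (hL2 : 2 ≤ P.L) (hm : 0 < msq) (ha : 0 < a) (hk1 : 1 ≤ k) (hkK : k ≤ P.K) {δ CM : ℝ} (hδ : 0 < δ) (hCM : 0 ≤ CM)
    (hM : ∀ (j : ℕ) (μ ν : Fin P.d) (x x' : HiggsLattice.Site P 0), Interior k K₀ Ω x → Interior k K₀ Ω x' →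
      mixedTermR C Ω A msq a k j μ ν x x'
        ≤ CM * (P.mesh j ^ P.d)⁻¹ * Real.exp (-(δ * ((HiggsLattice.Site.tdist x x' : ℝ) / (P.L : ℝ) ^ j))))
    {b : HiggsLattice.PBond P 0} (hbv : b.src ∈ Sb) {y₁ y₂ : HiggsLattice.Site P 0} (hy₁ : y₁ ∈ Sy) (hy₂ : y₂ ∈ Sy) :
    ‖(blockDKR C Ω A msq a k b y₂).comp (star (hol C A y₁ (cpath y₁ y₂))) - blockDKR C Ω A msq a k b y₁‖
      ≤ (P.d : ℝ) * (HiggsLattice.Site.tdist y₁ y₂ : ℝ) *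
          (P.mesh 0 ^ P.d * P.mesh 0 * (CM * (P.mesh k ^ P.d)⁻¹ * phiSum P.L (P.d + 1) δ * Real.exp (-(δ * P.L / 2 * D)))) := by
  classical
  obtain ⟨xb, ν⟩ := b
  replace hbv : xb ∈ Sb := hbv
  have hL1 : 1 < P.L := by omega
  have hε : 0 ≤ P.mesh 0 ^ P.d * P.mesh 0 := by have := P.mesh_pos 0; positivity
  obtain ⟨Mx, hMx⟩ : ∃ Mx : ℝ, Mx = P.mesh 0 ^ P.d * P.mesh 0 *
      (CM * (P.mesh k ^ P.d)⁻¹ * phiSum P.L (P.d + 1) δ * Real.exp (-(δ * P.L / 2 * D))) := ⟨_, rfl⟩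
  have hMx0 : 0 ≤ Mx := by
    rw [hMx]; have := P.mesh_pos k; have := phiSum_pos (L := P.L) (P.d + 1) hδ; positivity
  have hadm := isAdm_cpath y₁ y₂
  have hD : ∀ (c : HiggsLattice.PBond P 0) (w : E N), c.src ∈ Sy → c.tgt ∈ Sy →
      ‖covDeriv C A (propagatorK C Ω A msq a k (dip C A ⟨xb, ν⟩ w)) c‖ ≤ Mx * ‖w‖ := by
    intro c w hc _
    obtain ⟨xc, μ⟩ := c
    replace hc : xc ∈ Sy := hc
    have hDc : D ≤ (HiggsLattice.Site.tdist xc xb : ℝ) / (P.L : ℝ) ^ k := by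
      rw [tdist_comm]; exact hdom.le_sepD hbv hc
    have hD1 : 1 ≤ (HiggsLattice.Site.tdist xc xb : ℝ) / (P.L : ℝ) ^ k := hdom.one_le.trans hDc
    have hsum : ∑ i : Ix N, ‖covDeriv C A (propagatorK C Ω A msq a k (dip C A ⟨xb, ν⟩ (onb N i))) ⟨xc, μ⟩‖
        ≤ ∑ j ∈ Finset.range k, P.mesh 0 ^ P.d * P.mesh 0 * mixedTermR C Ω A msq a k j μ ν xc xb := by
      calc ∑ i : Ix N, ‖covDeriv C A (propagatorK C Ω A msq a k (dip C A ⟨xb, ν⟩ (onb N i))) ⟨xc, μ⟩‖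
          ≤ ∑ i : Ix N, ∑ j ∈ Finset.range k, ‖covDeriv C A (pieceR C Ω A msq a k j (dip C A ⟨xb, ν⟩ (onb N i))) ⟨xc, μ⟩‖ :=
            Finset.sum_le_sum fun i _ => B3Ineq31RegularRegion.norm_covDeriv_G_apply_le_sumR C Ω A msq a hm ha hL1 hk1 hkK _ _
        _ = _ := by
            rw [Finset.sum_comm]
            refine Finset.sum_congr rfl fun j _ => ?_
            have hε0 : P.mesh 0 ≠ 0 := (P.mesh_pos 0).ne'
            rw [mixedTermR]
            field_simp
    calc ‖covDeriv C A (propagatorK C Ω A msq a k (dip C A ⟨xb, ν⟩ w)) ⟨xc, μ⟩‖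
        ≤ ‖w‖ * ∑ i : Ix N, ‖covDeriv C A (propagatorK C Ω A msq a k (dip C A ⟨xb, ν⟩ (onb N i))) ⟨xc, μ⟩‖ :=
          norm_covDeriv_dip_le_sum (propagatorK C Ω A msq a k) _ _ w
      _ ≤ ‖w‖ * ∑ j ∈ Finset.range k, P.mesh 0 ^ P.d * P.mesh 0 * mixedTermR C Ω A msq a k j μ ν xc xb :=
          mul_le_mul_of_nonneg_left hsum (norm_nonneg _)
      _ ≤ ‖w‖ * Mx := by
          refine mul_le_mul_of_nonneg_left ?_ (norm_nonneg _)
          have hmain := sum_pieces_sep_le' (k := k) hL2 (p := P.d + 1) (mul_nonneg hε hCM)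
            (inv_nonneg.mpr (pow_nonneg (P.mesh_pos k).le P.d)) hδ hD1 hDc
            (fun j => P.mesh 0 ^ P.d * P.mesh 0 * mixedTermR C Ω A msq a k j μ ν xc xb)
            (fun j => (P.mesh j ^ P.d)⁻¹) ?_ ?_
          · refine hmain.trans (le_of_eq ?_); rw [hMx]; ring
          · intro j hj
            have h := mul_le_mul_of_nonneg_left (hM j μ ν xc xb (hdom.interior' _ hc) (hdom.interior _ hbv)) hε
            rw [div_pow_eq_div_mul_sc (le_of_lt hj)] at h
            refine h.trans (le_of_eq ?_); ring
          · intro j hj; exact weightM_le (le_of_lt hj)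
      _ = Mx * ‖w‖ := mul_comm _ _
  have h := norm_blockDKR_comp_star_sub_le (Ω := Ω) (msq := msq) (a := a) (k := k) hS ⟨xb, ν⟩ Sy hMx0 hD hadm.1
    (hdom.path' y₁ hy₁ y₂ hy₂)
  rw [pathEnd_cpath] at h
  rw [← hMx]
  exact h.trans (mul_le_mul_of_nonneg_right hadm.2.2 hMx0)

/-- **Part 3b on a domain pair — the row move**: `x₁, x₂ ∈ S_b`, `y ∈ S_y`: `(L^kε)^{d−1}ε^{−d}‖U(A(Γ_{x₁,x₂}))(DG^ε_k)(⟨x₂,μ⟩,y) − (DG^ε_k)(⟨x₁,μ⟩,y)‖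
≤ p^α·C_H·Φ·e^{−(δL/2)D}` for any `p ≥ |x₁−x₂|/L^k`, from (2.11) at interior points along `Γ_{x₁,x₂}`. [cite: Balaban1983Higgs3, (1.32) p.420]
[cite: Balaban1983Higgs3, (2.11) p.426] -/
theorem termB_leS {Sb Sy : Finset (HiggsLattice.Site P 0)} (hdom : DomPair k K₀ Ω m D Sb Sy) (hL2 : 2 ≤ P.L) (hm : 0 < msq)
    (ha : 0 < a) (hk1 : 1 ≤ k) (hkK : k ≤ P.K) {α δ CH : ℝ} (hα0 : 0 ≤ α) (hα1 : α ≤ 1) (hδ : 0 < δ) (hCH : 0 ≤ CH)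
    (hH : ∀ (j : ℕ) (μ : Fin P.d) (x₁ x₂ x : HiggsLattice.Site P 0) (Γ : List (HiggsLattice.Site P 0)),
      Interior k K₀ Ω x₁ → Interior k K₀ Ω x₂ → Interior k K₀ Ω x → x₁ ≠ x₂ → IsAdm x₁ x₂ Γ →
      holderTermR C Ω A msq a k j μ x₁ x₂ x Γ
        ≤ (P.mesh 0 * (HiggsLattice.Site.tdist x₁ x₂ : ℝ)) ^ α *
          (CH * (P.mesh j * (P.mesh j ^ P.d)⁻¹ * (P.mesh j ^ α)⁻¹) *
            Real.exp (-(δ * (min (HiggsLattice.Site.tdist x₁ x : ℝ) (HiggsLattice.Site.tdist x₂ x : ℝ) / (P.L : ℝ) ^ j)))))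
    {x₁ x₂ y : HiggsLattice.Site P 0} (μ : Fin P.d) (hx₁ : x₁ ∈ Sb) (hx₂ : x₂ ∈ Sb) (hy : y ∈ Sy) {pd : ℝ}
    (hpd : (HiggsLattice.Site.tdist x₁ x₂ : ℝ) / (P.L : ℝ) ^ k ≤ pd) :
    unitD P k * ‖(hol C A x₁ (cpath x₁ x₂)).comp (blockDKR C Ω A msq a k ⟨x₂, μ⟩ y) - blockDKR C Ω A msq a k ⟨x₁, μ⟩ y‖
      ≤ pd ^ α * (CH * phiSum P.L (P.d + 1) δ * Real.exp (-(δ * P.L / 2 * D))) := by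
  have hL1 : 1 < P.L := by omega
  have hL0 : (0 : ℝ) < P.L := by exact_mod_cast (by omega : 0 < P.L)
  have hLk : (0 : ℝ) < (P.L : ℝ) ^ k := pow_pos hL0 k
  have hpd0 : 0 ≤ pd := le_trans (by positivity) hpd
  have hΦ := phiSum_pos (L := P.L) (P.d + 1) hδ
  by_cases hx : x₁ = x₂
  · subst hx
    rw [cpath_self, hol_nil, ContinuousLinearMap.one_def, ContinuousLinearMap.id_comp, sub_self, norm_zero, mul_zero]
    positivity
  have hDc : D ≤ min (HiggsLattice.Site.tdist x₁ y : ℝ) (HiggsLattice.Site.tdist x₂ y : ℝ) / (P.L : ℝ) ^ k := by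
    rcases min_choice (HiggsLattice.Site.tdist x₁ y : ℝ) (HiggsLattice.Site.tdist x₂ y : ℝ) with h | h <;> rw [h]
    · exact hdom.le_sepD hx₁ hy
    · exact hdom.le_sepD hx₂ hy
  have hD1 : 1 ≤ min (HiggsLattice.Site.tdist x₁ y : ℝ) (HiggsLattice.Site.tdist x₂ y : ℝ) / (P.L : ℝ) ^ k := hdom.one_le.trans hDc
  have hU : 0 ≤ P.mesh k ^ P.d * (P.mesh k)⁻¹ := by have := P.mesh_pos k; positivity
  have hstep : unitD P k * ‖(hol C A x₁ (cpath x₁ x₂)).comp (blockDKR C Ω A msq a k ⟨x₂, μ⟩ y) - blockDKR C Ω A msq a k ⟨x₁, μ⟩ y‖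
      ≤ ∑ j ∈ Finset.range k, P.mesh k ^ P.d * (P.mesh k)⁻¹ * holderTermR C Ω A msq a k j μ x₁ x₂ y (cpath x₁ x₂) := by
    calc unitD P k * ‖(hol C A x₁ (cpath x₁ x₂)).comp (blockDKR C Ω A msq a k ⟨x₂, μ⟩ y) - blockDKR C Ω A msq a k ⟨x₁, μ⟩ y‖
        ≤ unitD P k * ∑ i' : Ix N, ∑ j ∈ Finset.range k,
            ‖hol C A x₁ (cpath x₁ x₂) (covDeriv C A (pieceR C Ω A msq a k j (cb P N 0 (y, i'))) ⟨x₂, μ⟩)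
              - covDeriv C A (pieceR C Ω A msq a k j (cb P N 0 (y, i'))) ⟨x₁, μ⟩‖ :=
          mul_le_mul_of_nonneg_left ((norm_hol_comp_blockDKR_sub_le x₁ x₂ y _ μ).trans (Finset.sum_le_sum fun i' _ =>
            B3Ineq31RegularRegion.norm_hol_covDeriv_G_sub_le_sumR C Ω A msq a hm ha hL1 hk1 hkK _ x₁ x₂ _ μ)) (unitD_pos P k).le
      _ = _ := by
          rw [Finset.sum_comm, unitD, Finset.mul_sum]
          refine Finset.sum_congr rfl fun j _ => ?_
          rw [holderTermR, mul_assoc]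
  refine hstep.trans ?_
  have hmain := sum_pieces_sep_le' (k := k) hL2 (p := P.d + 1) (mul_nonneg (Real.rpow_nonneg hpd0 α) hCH) zero_le_one hδ
    hD1 hDc (fun j => P.mesh k ^ P.d * (P.mesh k)⁻¹ * holderTermR C Ω A msq a k j μ x₁ x₂ y (cpath x₁ x₂))
    (fun j => ((P.L : ℝ) ^ (k - j)) ^ α * (P.mesh k ^ P.d * (P.mesh k)⁻¹ * (P.mesh j * (P.mesh j ^ P.d)⁻¹))) ?_ ?_
  · refine hmain.trans (le_of_eq ?_); ring
  · intro j hj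
    have hjk := le_of_lt hj
    have h := mul_le_mul_of_nonneg_left
      (hH j μ x₁ x₂ y _ (hdom.interior _ hx₁) (hdom.interior _ hx₂) (hdom.interior' _ hy) hx (isAdm_cpath x₁ x₂)) hU
    rw [div_pow_eq_div_mul_sc hjk] at h
    have hr0 : (0 : ℝ) ≤ (P.L : ℝ) ^ (k - j) := by positivity
    have hwt : (P.mesh 0 * (HiggsLattice.Site.tdist x₁ x₂ : ℝ)) ^ α * (P.mesh j ^ α)⁻¹
        ≤ pd ^ α * ((P.L : ℝ) ^ (k - j)) ^ α := by
      have hε := P.mesh_pos 0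
      have hmj := P.mesh_pos j
      rw [← Real.inv_rpow hmj.le, ← Real.mul_rpow (by positivity) (inv_nonneg.mpr hmj.le), ← Real.mul_rpow hpd0 hr0]
      refine Real.rpow_le_rpow (by positivity) ?_ hα0
      have e : P.mesh 0 * (HiggsLattice.Site.tdist x₁ x₂ : ℝ) * (P.mesh j)⁻¹
          = (HiggsLattice.Site.tdist x₁ x₂ : ℝ) / (P.L : ℝ) ^ k * (P.L : ℝ) ^ (k - j) := by
        rw [← div_pow_eq_div_mul_sc hjk, mesh_eq_pow_mul P j]
        have hε0 : P.mesh 0 ≠ 0 := hε.ne'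
        have hLj : (P.L : ℝ) ^ j ≠ 0 := (pow_pos hL0 j).ne'
        field_simp
      rw [e]
      exact mul_le_mul_of_nonneg_right hpd hr0
    have hrest : 0 ≤ CH * (P.mesh k ^ P.d * (P.mesh k)⁻¹ * (P.mesh j * (P.mesh j ^ P.d)⁻¹)) *
        Real.exp (-(δ * (min (HiggsLattice.Site.tdist x₁ y : ℝ) (HiggsLattice.Site.tdist x₂ y : ℝ) / (P.L : ℝ) ^ k *
          (P.L : ℝ) ^ (k - j)))) := by
      have := P.mesh_pos k; have := P.mesh_pos j; positivity
    calc P.mesh k ^ P.d * (P.mesh k)⁻¹ * holderTermR C Ω A msq a k j μ x₁ x₂ y (cpath x₁ x₂)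
        ≤ _ := h
      _ = (P.mesh 0 * (HiggsLattice.Site.tdist x₁ x₂ : ℝ)) ^ α * (P.mesh j ^ α)⁻¹ *
            (CH * (P.mesh k ^ P.d * (P.mesh k)⁻¹ * (P.mesh j * (P.mesh j ^ P.d)⁻¹)) *
              Real.exp (-(δ * (min (HiggsLattice.Site.tdist x₁ y : ℝ) (HiggsLattice.Site.tdist x₂ y : ℝ) / (P.L : ℝ) ^ k *
                (P.L : ℝ) ^ (k - j))))) := by ring
      _ ≤ pd ^ α * ((P.L : ℝ) ^ (k - j)) ^ α *
            (CH * (P.mesh k ^ P.d * (P.mesh k)⁻¹ * (P.mesh j * (P.mesh j ^ P.d)⁻¹)) *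
              Real.exp (-(δ * (min (HiggsLattice.Site.tdist x₁ y : ℝ) (HiggsLattice.Site.tdist x₂ y : ℝ) / (P.L : ℝ) ^ k *
                (P.L : ℝ) ^ (k - j))))) := mul_le_mul_of_nonneg_right hwt hrest
      _ = _ := by ring
  · intro j hj; exact weightH_le (le_of_lt hj) hα1

/-- inside a domain of diameter `≤ m`: `p ≤ m·p^α` for `0 < p ≤ m`, `0 ≤ α ≤ 1`, `m ≥ 1`. [folklore] -/
private theorem le_mul_rpow_of_le {p α : ℝ} {m : ℕ} (hp : 0 < p) (hpm : p ≤ m) (hα0 : 0 ≤ α) (hα1 : α ≤ 1) : p ≤ m * p ^ α := by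
  have hm1 : (1 : ℝ) ≤ m := by
    have : (0 : ℝ) < m := hp.trans_le hpm
    exact_mod_cast Nat.one_le_iff_ne_zero.mpr (by rintro rfl; simp at this)
  have e : p = p ^ α * p ^ (1 - α) := by
    rw [← Real.rpow_add hp, add_sub_cancel, Real.rpow_one]
  have h1 : p ^ (1 - α) ≤ (m : ℝ) ^ (1 - α) := Real.rpow_le_rpow hp.le hpm (by linarith)
  have h2 : (m : ℝ) ^ (1 - α) ≤ (m : ℝ) ^ (1 : ℝ) := Real.rpow_le_rpow_of_exponent_le hm1 (by linarith)
  rw [Real.rpow_one] at h2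
  calc p = p ^ α * p ^ (1 - α) := e
    _ ≤ p ^ α * m := mul_le_mul_of_nonneg_left (h1.trans h2) (Real.rpow_nonneg hp.le _)
    _ = m * p ^ α := mul_comm _ _

/-- **Part 3 on a domain pair, one same-direction pair in explicit variables**: bonds `⟨x₁,μ⟩, ⟨x₂,μ⟩` over `S_b`, other sites `y₁, y₂ ∈ S_y`:
`(L^kε)^{d−1}ε^{−d}‖U(A(Γ_{x₁,x₂}))(DG^ε_k)(⟨x₂,μ⟩,y₂)U(A(Γ_{y₁,y₂}))^* − (DG^ε_k)(⟨x₁,μ⟩,y₁)‖ ≤ (C_H + dmC_M)Φe^{−(δL/2)D}·p^α`,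
`p = max(|x₁−x₂|,|y₁−y₂|)/L^k` (column move + row move; `|y₁−y₂|/L^k ≤ p ≤ m·p^α` inside a domain of diameter `m`).
[cite: Balaban1983Higgs3, (3.1) p.432] -/
theorem holder_coreS {Sb Sy : Finset (HiggsLattice.Site P 0)} (hdom : DomPair k K₀ Ω m D Sb Sy) (hS : ∀ μ, 2 < P.sitesPerDir 0 μ)
    (hL2 : 2 ≤ P.L) (hm : 0 < msq) (ha : 0 < a) (hk1 : 1 ≤ k) (hkK : k ≤ P.K) {α δ CH CM : ℝ} (hα0 : 0 ≤ α) (hα1 : α ≤ 1)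
    (hδ : 0 < δ) (hCH : 0 ≤ CH) (hCM : 0 ≤ CM)
    (hH : ∀ (j : ℕ) (μ : Fin P.d) (x₁ x₂ x : HiggsLattice.Site P 0) (Γ : List (HiggsLattice.Site P 0)),
      Interior k K₀ Ω x₁ → Interior k K₀ Ω x₂ → Interior k K₀ Ω x → x₁ ≠ x₂ → IsAdm x₁ x₂ Γ →
      holderTermR C Ω A msq a k j μ x₁ x₂ x Γ
        ≤ (P.mesh 0 * (HiggsLattice.Site.tdist x₁ x₂ : ℝ)) ^ α *
          (CH * (P.mesh j * (P.mesh j ^ P.d)⁻¹ * (P.mesh j ^ α)⁻¹) *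
            Real.exp (-(δ * (min (HiggsLattice.Site.tdist x₁ x : ℝ) (HiggsLattice.Site.tdist x₂ x : ℝ) / (P.L : ℝ) ^ j)))))
    (hM : ∀ (j : ℕ) (μ ν : Fin P.d) (x x' : HiggsLattice.Site P 0), Interior k K₀ Ω x → Interior k K₀ Ω x' →
      mixedTermR C Ω A msq a k j μ ν x x'
        ≤ CM * (P.mesh j ^ P.d)⁻¹ * Real.exp (-(δ * ((HiggsLattice.Site.tdist x x' : ℝ) / (P.L : ℝ) ^ j))))
    {x₁ x₂ y₁ y₂ : HiggsLattice.Site P 0} (μ : Fin P.d) (hx₁ : x₁ ∈ Sb) (hx₂ : x₂ ∈ Sb) (hy₁ : y₁ ∈ Sy) (hy₂ : y₂ ∈ Sy)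
    (hpos : 0 < max (HiggsLattice.Site.tdist x₁ x₂ : ℝ) (HiggsLattice.Site.tdist y₁ y₂ : ℝ) / (P.L : ℝ) ^ k) :
    ‖(hol C A x₁ (cpath x₁ x₂)).comp
          ((unitD P k • blockDKR C Ω A msq a k ⟨x₂, μ⟩ y₂).comp (star (hol C A y₁ (cpath y₁ y₂))))
        - unitD P k • blockDKR C Ω A msq a k ⟨x₁, μ⟩ y₁‖
      ≤ (CH + P.d * m * CM) * phiSum P.L (P.d + 1) δ * Real.exp (-(δ * P.L / 2 * D)) *
          (max (HiggsLattice.Site.tdist x₁ x₂ : ℝ) (HiggsLattice.Site.tdist y₁ y₂ : ℝ) / (P.L : ℝ) ^ k) ^ α := by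
  have hL0 : (0 : ℝ) < P.L := by exact_mod_cast (by omega : 0 < P.L)
  have hLk : (0 : ℝ) < (P.L : ℝ) ^ k := pow_pos hL0 k
  have hΦ := phiSum_pos (L := P.L) (P.d + 1) hδ
  obtain ⟨pd, hpd⟩ : ∃ pd : ℝ,
      pd = max (HiggsLattice.Site.tdist x₁ x₂ : ℝ) (HiggsLattice.Site.tdist y₁ y₂ : ℝ) / (P.L : ℝ) ^ k := ⟨_, rfl⟩
  rw [← hpd] at hpos ⊢
  have htb : (HiggsLattice.Site.tdist x₁ x₂ : ℝ) / (P.L : ℝ) ^ k ≤ pd := by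
    rw [hpd]; exact div_le_div_of_nonneg_right (le_max_left _ _) hLk.le
  have hty : (HiggsLattice.Site.tdist y₁ y₂ : ℝ) / (P.L : ℝ) ^ k ≤ pd := by
    rw [hpd]; exact div_le_div_of_nonneg_right (le_max_right _ _) hLk.le
  have hpdm : pd ≤ m := by
    rw [hpd, ← max_div_div_right hLk.le]
    exact max_le (hdom.diam x₁ hx₁ x₂ hx₂) (hdom.diam' y₁ hy₁ y₂ hy₂)
  have hpdα : pd ≤ m * pd ^ α := le_mul_rpow_of_le hpos hpdm hα0 hα1
  have e : (hol C A x₁ (cpath x₁ x₂)).comp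
          ((unitD P k • blockDKR C Ω A msq a k ⟨x₂, μ⟩ y₂).comp (star (hol C A y₁ (cpath y₁ y₂))))
        - unitD P k • blockDKR C Ω A msq a k ⟨x₁, μ⟩ y₁
      = unitD P k • ((hol C A x₁ (cpath x₁ x₂)).comp
          ((blockDKR C Ω A msq a k ⟨x₂, μ⟩ y₂).comp (star (hol C A y₁ (cpath y₁ y₂))) - blockDKR C Ω A msq a k ⟨x₂, μ⟩ y₁) +
        ((hol C A x₁ (cpath x₁ x₂)).comp (blockDKR C Ω A msq a k ⟨x₂, μ⟩ y₁) - blockDKR C Ω A msq a k ⟨x₁, μ⟩ y₁)) := by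
    rw [ContinuousLinearMap.smul_comp, ContinuousLinearMap.comp_smul, ContinuousLinearMap.comp_sub, sub_add_sub_cancel,
      smul_sub]
  rw [e, norm_smul, Real.norm_eq_abs, abs_of_pos (unitD_pos P k)]
  have hA := termA_leS (C := C) (A := A) (msq := msq) (a := a) hdom hS hL2 hm ha hk1 hkK hδ hCM hM (b := ⟨x₂, μ⟩) hx₂ hy₁ hy₂
  have hB := termB_leS (C := C) (A := A) (msq := msq) (a := a) hdom hL2 hm ha hk1 hkK hα0 hα1 hδ hCH hH μ hx₁ hx₂ hy₁ htb
  have hu : unitD P k * (P.mesh 0 ^ P.d * P.mesh 0) * (P.mesh k ^ P.d)⁻¹ = ((P.L : ℝ) ^ k)⁻¹ := by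
    unfold unitD
    rw [mesh_eq_pow_mul P k]
    have hε0 : P.mesh 0 ≠ 0 := (P.mesh_pos 0).ne'
    have hLk0 : (P.L : ℝ) ^ k ≠ 0 := hLk.ne'
    field_simp
  obtain ⟨TA, hTA⟩ : ∃ T : E N →L[ℝ] E N,
      (blockDKR C Ω A msq a k ⟨x₂, μ⟩ y₂).comp (star (hol C A y₁ (cpath y₁ y₂))) - blockDKR C Ω A msq a k ⟨x₂, μ⟩ y₁ = T :=
    ⟨_, rfl⟩
  obtain ⟨TB, hTB⟩ : ∃ T : E N →L[ℝ] E N,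
      (hol C A x₁ (cpath x₁ x₂)).comp (blockDKR C Ω A msq a k ⟨x₂, μ⟩ y₁) - blockDKR C Ω A msq a k ⟨x₁, μ⟩ y₁ = T := ⟨_, rfl⟩
  rw [hTA] at hA ⊢
  rw [hTB] at hB ⊢
  have hu0 := (unitD_pos P k).le
  have hX : ‖(hol C A x₁ (cpath x₁ x₂)).comp TA‖ ≤ ‖TA‖ := norm_hol_comp_le _ _ _
  have hK0 : 0 ≤ CM * phiSum P.L (P.d + 1) δ * Real.exp (-(δ * P.L / 2 * D)) := by positivity
  calc unitD P k * ‖(hol C A x₁ (cpath x₁ x₂)).comp TA + TB‖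
      ≤ unitD P k * (‖TA‖ + ‖TB‖) := mul_le_mul_of_nonneg_left ((norm_add_le _ _).trans (add_le_add hX le_rfl)) hu0
    _ = unitD P k * ‖TA‖ + unitD P k * ‖TB‖ := mul_add _ _ _
    _ ≤ unitD P k * ((P.d : ℝ) * (HiggsLattice.Site.tdist y₁ y₂ : ℝ) * (P.mesh 0 ^ P.d * P.mesh 0 *
            (CM * (P.mesh k ^ P.d)⁻¹ * phiSum P.L (P.d + 1) δ * Real.exp (-(δ * P.L / 2 * D))))) +
          pd ^ α * (CH * phiSum P.L (P.d + 1) δ * Real.exp (-(δ * P.L / 2 * D))) :=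
        add_le_add (mul_le_mul_of_nonneg_left hA hu0) hB
    _ = (P.d : ℝ) * ((HiggsLattice.Site.tdist y₁ y₂ : ℝ) * (unitD P k * (P.mesh 0 ^ P.d * P.mesh 0) * (P.mesh k ^ P.d)⁻¹)) *
            (CM * phiSum P.L (P.d + 1) δ * Real.exp (-(δ * P.L / 2 * D))) +
          pd ^ α * (CH * phiSum P.L (P.d + 1) δ * Real.exp (-(δ * P.L / 2 * D))) := by ring
    _ = (P.d : ℝ) * ((HiggsLattice.Site.tdist y₁ y₂ : ℝ) / (P.L : ℝ) ^ k) *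
            (CM * phiSum P.L (P.d + 1) δ * Real.exp (-(δ * P.L / 2 * D))) +
          pd ^ α * (CH * phiSum P.L (P.d + 1) δ * Real.exp (-(δ * P.L / 2 * D))) := by
        rw [hu]; ring
    _ ≤ (P.d : ℝ) * (m * pd ^ α) * (CM * phiSum P.L (P.d + 1) δ * Real.exp (-(δ * P.L / 2 * D))) +
          pd ^ α * (CH * phiSum P.L (P.d + 1) δ * Real.exp (-(δ * P.L / 2 * D))) :=
        add_le_add (mul_le_mul_of_nonneg_right
          (mul_le_mul_of_nonneg_left (hty.trans hpdα) (Nat.cast_nonneg _)) hK0) le_rfl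
    _ = _ := by ring

/-- **Part 3 on a domain pair — the Hölder quotients of `D^ηF`**: for same-direction product bonds `c, c′` of `S × S′` at positive distance,
`‖τ_{c,c′}(D^ηF(c′)) − D^ηF(c)‖ ≤ (C_H + dmC_M)Φe^{−(δL/2)D}·|z(c) − z(c′)|^α`. [cite: Balaban1983Higgs3, (3.1) p.432] [cite: Balaban1983Higgs3, (1.32) p.420] -/
theorem holder_part_leS (hdom : DomPair k K₀ Ω m D S S') (hS : ∀ μ, 2 < P.sitesPerDir 0 μ) (hL2 : 2 ≤ P.L) (hm : 0 < msq) (ha : 0 < a)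
    (hk1 : 1 ≤ k) (hkK : k ≤ P.K) {α δ CH CM : ℝ} (hα0 : 0 ≤ α) (hα1 : α ≤ 1) (hδ : 0 < δ) (hCH : 0 ≤ CH) (hCM : 0 ≤ CM)
    (hH : ∀ (j : ℕ) (μ : Fin P.d) (x₁ x₂ x : HiggsLattice.Site P 0) (Γ : List (HiggsLattice.Site P 0)),
      Interior k K₀ Ω x₁ → Interior k K₀ Ω x₂ → Interior k K₀ Ω x → x₁ ≠ x₂ → IsAdm x₁ x₂ Γ →
      holderTermR C Ω A msq a k j μ x₁ x₂ x Γ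
        ≤ (P.mesh 0 * (HiggsLattice.Site.tdist x₁ x₂ : ℝ)) ^ α *
          (CH * (P.mesh j * (P.mesh j ^ P.d)⁻¹ * (P.mesh j ^ α)⁻¹) *
            Real.exp (-(δ * (min (HiggsLattice.Site.tdist x₁ x : ℝ) (HiggsLattice.Site.tdist x₂ x : ℝ) / (P.L : ℝ) ^ j)))))
    (hM : ∀ (j : ℕ) (μ ν : Fin P.d) (x x' : HiggsLattice.Site P 0), Interior k K₀ Ω x → Interior k K₀ Ω x' →
      mixedTermR C Ω A msq a k j μ ν x x'
        ≤ CM * (P.mesh j ^ P.d)⁻¹ * Real.exp (-(δ * ((HiggsLattice.Site.tdist x x' : ℝ) / (P.L : ℝ) ^ j))))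
    {c c' : PBd P} (hc : c ∈ bondsS S S') (hc' : c' ∈ bondsS S S') (hdir : dirOf c = dirOf c')
    (hpos : 0 < pdist k (baseOf c) (baseOf c')) :
    ‖transp C A c c' (derivFR C Ω A msq a k c') - derivFR C Ω A msq a k c‖
      ≤ (CH + P.d * m * CM) * phiSum P.L (P.d + 1) δ * Real.exp (-(δ * P.L / 2 * D)) * pdist k (baseOf c) (baseOf c') ^ α := by
  obtain ⟨hcx₁, -, hcy₁, -⟩ := bondsS_spec hc
  obtain ⟨hcx₂, -, hcy₂, -⟩ := bondsS_spec hc'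
  rcases c with ⟨μ, x₁, y₁⟩ | ⟨μ, y₁, x₁⟩ <;> rcases c' with ⟨μ', x₂, y₂⟩ | ⟨μ', y₂, x₂⟩ <;>
    simp only [dirOf, Sum.elim_inl, Sum.elim_inr, Sum.inl.injEq, Sum.inr.injEq, reduceCtorEq] at hdir <;> subst hdir
  · simp only [hb, domB, domY, Sum.elim_inl] at hcx₁ hcy₁ hcx₂ hcy₂
    exact holder_coreS hdom hS hL2 hm ha hk1 hkK hα0 hα1 hδ hCH hCM hH hM μ hcx₁ hcx₂ hcy₁ hcy₂ hpos
  · simp only [hb, domB, domY, Sum.elim_inr] at hcx₁ hcy₁ hcx₂ hcy₂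
    change 0 < max (HiggsLattice.Site.tdist y₁ y₂ : ℝ) (HiggsLattice.Site.tdist x₁ x₂ : ℝ) / (P.L : ℝ) ^ k at hpos
    rw [max_comm] at hpos
    have h := holder_coreS hdom.symm hS hL2 hm ha hk1 hkK hα0 hα1 hδ hCH hCM hH hM μ hcx₁ hcx₂ hcy₁ hcy₂ hpos
    change _ ≤ _ * (max (HiggsLattice.Site.tdist y₁ y₂ : ℝ) (HiggsLattice.Site.tdist x₁ x₂ : ℝ) / (P.L : ℝ) ^ k) ^ α
    rw [max_comm]
    exact h

/-! ### The value-Lipschitz clause: `F` at two base points of `S × S′`, transported -/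

/-- **The row move of VALUES**: for a chain `Γ` from `x₁` to `x₂` inside a set `S_b` on whose bonds `‖(DG^ε_k)(b, y)‖ ≤ M` for the fixed other
site `y`, `‖U(A(Γ))G^ε_k(x₂,y) − G^ε_k(x₁,y)‖ ≤ ε|Γ|M` (p35's path lemma on the column field `G^ε_k(Ω,A)δ_yv`).
[cite: Balaban1983Higgs3, (1.32) p.420] [cite: Balaban1983RegularityDecay, p.578] -/
theorem norm_hol_comp_blockKR_sub_le (hS : ∀ μ, 2 < P.sitesPerDir 0 μ) (y : HiggsLattice.Site P 0)
    (Sb : Finset (HiggsLattice.Site P 0)) {Mx : ℝ} (hMx : 0 ≤ Mx)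
    (hD : ∀ (b : HiggsLattice.PBond P 0), b.src ∈ Sb → b.tgt ∈ Sb → ‖blockDKR C Ω A msq a k b y‖ ≤ Mx)
    {x₁ : HiggsLattice.Site P 0} {Γ : List (HiggsLattice.Site P 0)} (hch : IsTChain x₁ Γ) (hΓ : ∀ z ∈ x₁ :: Γ, z ∈ Sb) :
    ‖(hol C A x₁ Γ).comp (blockKR C Ω A msq a k (pathEnd x₁ Γ) y) - blockKR C Ω A msq a k x₁ y‖ ≤ P.mesh 0 * Γ.length * Mx := by
  have hε : 0 < P.mesh 0 := P.mesh_pos 0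
  refine ContinuousLinearMap.opNorm_le_bound _ (by positivity) fun v => ?_
  set φ : ScalarField P 0 N := propagatorK C Ω A msq a k (Pi.single y v) with hφ
  rw [_root_.sub_apply, ContinuousLinearMap.comp_apply, blockKR_apply, blockKR_apply]
  have hpath := norm_hol_apply_sub_le hS C A φ Sb (G := Mx * ‖v‖)
    (fun z μ hz hzμ => by
      rw [hφ, ← blockDKR_apply]
      exact (ContinuousLinearMap.le_opNorm _ _).trans (mul_le_mul_of_nonneg_right (hD ⟨z, μ⟩ hz hzμ) (norm_nonneg _)))
    hch hΓ
  calc ‖hol C A x₁ Γ (φ (pathEnd x₁ Γ)) - φ x₁‖ ≤ P.mesh 0 * Γ.length * (Mx * ‖v‖) := hpath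
    _ = P.mesh 0 * Γ.length * Mx * ‖v‖ := by ring

/-- **The column move of VALUES**: for a chain `Γ′` from `y₁` to `y₂` inside a set `S_y` on whose bonds `‖(DG^ε_k)(b′, x)‖ ≤ M′` for the fixed
row site `x`, `‖G^ε_k(x,y₂)∘U(A(Γ′))^* − G^ε_k(x,y₁)‖ ≤ ε|Γ′|M′` — the symmetry `⟨w, G^ε_k(x,y)v⟩ = ⟨G^ε_k(y,x)w, v⟩` (p33) turns it into the row
move of the column field `G^ε_k(Ω,A)δ_xw`. [cite: Balaban1983Higgs3, (1.32) p.420] [cite: Balaban1982Higgs1, (2.20) p.610] -/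
theorem norm_blockKR_comp_star_sub_le (hS : ∀ μ, 2 < P.sitesPerDir 0 μ) (x : HiggsLattice.Site P 0)
    (Sy : Finset (HiggsLattice.Site P 0)) {Mx : ℝ} (hMx : 0 ≤ Mx)
    (hD : ∀ (b : HiggsLattice.PBond P 0), b.src ∈ Sy → b.tgt ∈ Sy → ‖blockDKR C Ω A msq a k b x‖ ≤ Mx)
    {y₁ : HiggsLattice.Site P 0} {Γ' : List (HiggsLattice.Site P 0)} (hch : IsTChain y₁ Γ') (hΓ : ∀ z ∈ y₁ :: Γ', z ∈ Sy) :
    ‖(blockKR C Ω A msq a k x (pathEnd y₁ Γ')).comp (star (hol C A y₁ Γ')) - blockKR C Ω A msq a k x y₁‖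
      ≤ P.mesh 0 * Γ'.length * Mx := by
  have hε : 0 < P.mesh 0 := P.mesh_pos 0
  refine ContinuousLinearMap.opNorm_le_bound _ (by positivity) fun v => ?_
  -- the norm through the inner product with an arbitrary `w`
  have key : ∀ w : E N, |⟪w, ((blockKR C Ω A msq a k x (pathEnd y₁ Γ')).comp (star (hol C A y₁ Γ'))
      - blockKR C Ω A msq a k x y₁) v⟫_ℝ| ≤ P.mesh 0 * Γ'.length * Mx * ‖v‖ * ‖w‖ := by
    intro w
    set ψ : ScalarField P 0 N := propagatorK C Ω A msq a k (Pi.single x w) with hψ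
    have hform : ⟪w, ((blockKR C Ω A msq a k x (pathEnd y₁ Γ')).comp (star (hol C A y₁ Γ'))
        - blockKR C Ω A msq a k x y₁) v⟫_ℝ = ⟪hol C A y₁ Γ' (ψ (pathEnd y₁ Γ')) - ψ y₁, v⟫_ℝ := by
      rw [_root_.sub_apply, ContinuousLinearMap.comp_apply, inner_sub_right, blockKR_apply, blockKR_apply,
        inner_propagatorK_single_comm_R, inner_propagatorK_single_comm_R, ContinuousLinearMap.star_eq_adjoint,
        ContinuousLinearMap.adjoint_inner_right, inner_sub_left]
    rw [hform]
    have hpath := norm_hol_apply_sub_le hS C A ψ Sy (G := Mx * ‖w‖)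
      (fun z μ hz hzμ => by
        rw [hψ, ← blockDKR_apply]
        exact (ContinuousLinearMap.le_opNorm _ _).trans (mul_le_mul_of_nonneg_right (hD ⟨z, μ⟩ hz hzμ) (norm_nonneg _)))
      hch hΓ
    calc |⟪hol C A y₁ Γ' (ψ (pathEnd y₁ Γ')) - ψ y₁, v⟫_ℝ|
        ≤ ‖hol C A y₁ Γ' (ψ (pathEnd y₁ Γ')) - ψ y₁‖ * ‖v‖ := abs_real_inner_le_norm _ _
      _ ≤ P.mesh 0 * Γ'.length * (Mx * ‖w‖) * ‖v‖ := mul_le_mul_of_nonneg_right hpath (norm_nonneg _)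
      _ = _ := by ring
  set X := ((blockKR C Ω A msq a k x (pathEnd y₁ Γ')).comp (star (hol C A y₁ Γ')) - blockKR C Ω A msq a k x y₁) v with hX
  have h1 := key X
  rw [real_inner_self_eq_norm_sq, abs_of_nonneg (sq_nonneg _)] at h1
  by_cases h0 : ‖X‖ = 0
  · rw [h0]; positivity
  · have hpos : 0 < ‖X‖ := lt_of_le_of_ne (norm_nonneg _) (Ne.symm h0)
    nlinarith

/-- **The value-Lipschitz clause on a domain pair, one same-direction pair in explicit variables**: `x₁, x₂ ∈ S_b`, `y₁, y₂ ∈ S_y`: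
`(L^kε)^{d−2}ε^{−d}‖U(A(Γ_{x₁,x₂}))G^ε_k(x₂,y₂)U(A(Γ_{y₁,y₂}))^* − G^ε_k(x₁,y₁)‖ ≤ d(|x₁−x₂| + |y₁−y₂|)/L^k · C_VΦe^{−(δL/2)D}` — column move inside
`S_y` plus row move inside `S_b`, each step one `η`-derivative of `F` (`unitV·ε = unitD/L^k`). [cite: Balaban1983Higgs3, (1.32) p.420] -/
theorem value_move_leS {Sb Sy : Finset (HiggsLattice.Site P 0)} (hdom : DomPair k K₀ Ω m D Sb Sy) (hS : ∀ μ, 2 < P.sitesPerDir 0 μ)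
    (hL2 : 2 ≤ P.L) (hm : 0 < msq) (ha : 0 < a) (hk1 : 1 ≤ k) (hkK : k ≤ P.K) {δ CV : ℝ} (hδ : 0 < δ) (hCV : 0 ≤ CV)
    (hDv : ∀ (j : ℕ) (μ : Fin P.d) (x x' : HiggsLattice.Site P 0), Interior k K₀ Ω x → Interior k K₀ Ω x' →
      (P.mesh 0 ^ P.d)⁻¹ * ∑ i' : Ix N, ‖covDeriv C A (pieceR C Ω A msq a k j (cb P N 0 (x', i'))) ⟨x, μ⟩‖
        ≤ CV * (P.mesh j * (P.mesh j ^ P.d)⁻¹) * Real.exp (-(δ * ((HiggsLattice.Site.tdist x x' : ℝ) / (P.L : ℝ) ^ j))))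
    {x₁ x₂ y₁ y₂ : HiggsLattice.Site P 0} (hx₁ : x₁ ∈ Sb) (hx₂ : x₂ ∈ Sb) (hy₁ : y₁ ∈ Sy) (hy₂ : y₂ ∈ Sy) :
    ‖(hol C A x₁ (cpath x₁ x₂)).comp
          ((unitV P k • blockKR C Ω A msq a k x₂ y₂).comp (star (hol C A y₁ (cpath y₁ y₂))))
        - unitV P k • blockKR C Ω A msq a k x₁ y₁‖
      ≤ (P.d : ℝ) * (((HiggsLattice.Site.tdist x₁ x₂ : ℝ) + (HiggsLattice.Site.tdist y₁ y₂ : ℝ)) / (P.L : ℝ) ^ k) *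
          (CV * phiSum P.L (P.d + 1) δ * Real.exp (-(δ * P.L / 2 * D))) := by
  have hL0 : (0 : ℝ) < P.L := by exact_mod_cast (by omega : 0 < P.L)
  have hLk : (0 : ℝ) < (P.L : ℝ) ^ k := pow_pos hL0 k
  have hΦ := phiSum_pos (L := P.L) (P.d + 1) hδ
  set B : ℝ := CV * phiSum P.L (P.d + 1) δ * Real.exp (-(δ * P.L / 2 * D)) with hB
  have hB0 : 0 ≤ B := by positivity
  -- the derivative bound on the bonds of the two domains, raw form `‖blockDKR‖ ≤ B/unitD`
  have hMx0 : 0 ≤ B / unitD P k := div_nonneg hB0 (unitD_pos P k).le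
  have hrow : ∀ (b : HiggsLattice.PBond P 0), b.src ∈ Sb → b.tgt ∈ Sb → ‖blockDKR C Ω A msq a k b y₁‖ ≤ B / unitD P k := by
    intro b hb _
    obtain ⟨x, μ⟩ := b
    rw [le_div_iff₀ (unitD_pos P k), mul_comm]
    exact deriv_raw_leS hdom hL2 hm ha hk1 hkK hδ hCV hDv hb hy₁ μ
  have hcol : ∀ (b : HiggsLattice.PBond P 0), b.src ∈ Sy → b.tgt ∈ Sy → ‖blockDKR C Ω A msq a k b x₂‖ ≤ B / unitD P k := by
    intro b hb _
    obtain ⟨y, μ⟩ := b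
    rw [le_div_iff₀ (unitD_pos P k), mul_comm]
    exact deriv_raw_leS hdom.symm hL2 hm ha hk1 hkK hδ hCV hDv hb hx₂ μ
  have hadmx := isAdm_cpath x₁ x₂
  have hadmy := isAdm_cpath y₁ y₂
  -- the two moves
  have hA := norm_blockKR_comp_star_sub_le (C := C) (Ω := Ω) (A := A) (msq := msq) (a := a) (k := k) hS x₂ Sy hMx0 hcol hadmy.1
    (hdom.path' y₁ hy₁ y₂ hy₂)
  have hBm := norm_hol_comp_blockKR_sub_le (C := C) (Ω := Ω) (A := A) (msq := msq) (a := a) (k := k) hS y₁ Sb hMx0 hrow hadmx.1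
    (hdom.path x₁ hx₁ x₂ hx₂)
  rw [pathEnd_cpath] at hA hBm
  -- the unit out, the triangle through `G(x₂,y₁)`
  have e : (hol C A x₁ (cpath x₁ x₂)).comp
          ((unitV P k • blockKR C Ω A msq a k x₂ y₂).comp (star (hol C A y₁ (cpath y₁ y₂))))
        - unitV P k • blockKR C Ω A msq a k x₁ y₁
      = unitV P k • ((hol C A x₁ (cpath x₁ x₂)).comp
          ((blockKR C Ω A msq a k x₂ y₂).comp (star (hol C A y₁ (cpath y₁ y₂))) - blockKR C Ω A msq a k x₂ y₁) +
        ((hol C A x₁ (cpath x₁ x₂)).comp (blockKR C Ω A msq a k x₂ y₁) - blockKR C Ω A msq a k x₁ y₁)) := by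
    rw [ContinuousLinearMap.smul_comp, ContinuousLinearMap.comp_smul, ContinuousLinearMap.comp_sub, sub_add_sub_cancel,
      smul_sub]
  rw [e, norm_smul, Real.norm_eq_abs, abs_of_pos (unitV_pos P k)]
  obtain ⟨TA, hTA⟩ : ∃ T : E N →L[ℝ] E N,
      (blockKR C Ω A msq a k x₂ y₂).comp (star (hol C A y₁ (cpath y₁ y₂))) - blockKR C Ω A msq a k x₂ y₁ = T := ⟨_, rfl⟩
  obtain ⟨TB, hTB⟩ : ∃ T : E N →L[ℝ] E N,
      (hol C A x₁ (cpath x₁ x₂)).comp (blockKR C Ω A msq a k x₂ y₁) - blockKR C Ω A msq a k x₁ y₁ = T := ⟨_, rfl⟩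
  rw [hTA] at hA ⊢
  rw [hTB] at hBm ⊢
  have hX : ‖(hol C A x₁ (cpath x₁ x₂)).comp TA‖ ≤ ‖TA‖ := norm_hol_comp_le _ _ _
  have hu : unitV P k * P.mesh 0 * (B / unitD P k) = ((P.L : ℝ) ^ k)⁻¹ * B := by
    rw [unitV_mul_mesh]
    have hD0 : unitD P k ≠ 0 := (unitD_pos P k).ne'
    field_simp
  have hlen : (Γ : List (HiggsLattice.Site P 0)) → ((Γ.length : ℕ) : ℝ) = (Γ.length : ℝ) := fun _ => rfl
  calc unitV P k * ‖(hol C A x₁ (cpath x₁ x₂)).comp TA + TB‖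
      ≤ unitV P k * (‖TA‖ + ‖TB‖) :=
        mul_le_mul_of_nonneg_left ((norm_add_le _ _).trans (add_le_add hX le_rfl)) (unitV_pos P k).le
    _ ≤ unitV P k * (P.mesh 0 * (cpath y₁ y₂).length * (B / unitD P k) + P.mesh 0 * (cpath x₁ x₂).length * (B / unitD P k)) :=
        mul_le_mul_of_nonneg_left (add_le_add hA hBm) (unitV_pos P k).le
    _ = unitV P k * P.mesh 0 * (B / unitD P k) * ((cpath y₁ y₂).length + (cpath x₁ x₂).length) := by ring
    _ = ((P.L : ℝ) ^ k)⁻¹ * B * ((cpath y₁ y₂).length + (cpath x₁ x₂).length) := by rw [hu]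
    _ ≤ ((P.L : ℝ) ^ k)⁻¹ * B *
          ((P.d : ℝ) * (HiggsLattice.Site.tdist y₁ y₂ : ℝ) + (P.d : ℝ) * (HiggsLattice.Site.tdist x₁ x₂ : ℝ)) :=
        mul_le_mul_of_nonneg_left (add_le_add hadmy.2.2 hadmx.2.2) (by positivity)
    _ = _ := by rw [hB]; field_simp; ring

/-- **The value-Lipschitz clause for same-direction product bonds of `S × S′`**: with `Y(c) = (L^kε)^{d−2}ε^{−d}G^ε_k((hb c)₁₋, (hb c)₂)` (the value
`F` carries at the base of the row bond / the transposed value `F^*` at the base of the column bond), `‖τ_{c,c′}Y(c′) − Y(c)‖ ≤ 2d·|z(c)−z(c′)|·C_VΦe^{−(δL/2)D}`.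
[cite: Balaban1983Higgs3, (1.32) p.420] -/
theorem value_part_leS (hdom : DomPair k K₀ Ω m D S S') (hS : ∀ μ, 2 < P.sitesPerDir 0 μ) (hL2 : 2 ≤ P.L) (hm : 0 < msq)
    (ha : 0 < a) (hk1 : 1 ≤ k) (hkK : k ≤ P.K) {δ CV : ℝ} (hδ : 0 < δ) (hCV : 0 ≤ CV)
    (hDv : ∀ (j : ℕ) (μ : Fin P.d) (x x' : HiggsLattice.Site P 0), Interior k K₀ Ω x → Interior k K₀ Ω x' →
      (P.mesh 0 ^ P.d)⁻¹ * ∑ i' : Ix N, ‖covDeriv C A (pieceR C Ω A msq a k j (cb P N 0 (x', i'))) ⟨x, μ⟩‖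
        ≤ CV * (P.mesh j * (P.mesh j ^ P.d)⁻¹) * Real.exp (-(δ * ((HiggsLattice.Site.tdist x x' : ℝ) / (P.L : ℝ) ^ j))))
    {c c' : PBd P} (hc : c ∈ bondsS S S') (hc' : c' ∈ bondsS S S') (hdir : dirOf c = dirOf c') :
    ‖transp C A c c' (unitV P k • blockKR C Ω A msq a k (hb c').1.src (hb c').2)
        - unitV P k • blockKR C Ω A msq a k (hb c).1.src (hb c).2‖
      ≤ 2 * (P.d : ℝ) * pdist k (baseOf c) (baseOf c') * (CV * phiSum P.L (P.d + 1) δ * Real.exp (-(δ * P.L / 2 * D))) := by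
  have hL0 : (0 : ℝ) < P.L := by exact_mod_cast (by omega : 0 < P.L)
  have hLk : (0 : ℝ) < (P.L : ℝ) ^ k := pow_pos hL0 k
  have hΦ := phiSum_pos (L := P.L) (P.d + 1) hδ
  obtain ⟨hcx₁, -, hcy₁, -⟩ := bondsS_spec hc
  obtain ⟨hcx₂, -, hcy₂, -⟩ := bondsS_spec hc'
  obtain ⟨-, hdb, hdy, hpd⟩ := sameDir_specS S S' hdir
  have hdom' : DomPair k K₀ Ω m D (domB S S' c) (domY S S' c) := hdom.ofBond c
  rw [hdb] at hcx₂
  rw [hdy] at hcy₂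
  unfold transp
  have h := value_move_leS (C := C) (A := A) (msq := msq) (a := a) hdom' hS hL2 hm ha hk1 hkK hδ hCV hDv hcx₁ hcx₂ hcy₁ hcy₂
  refine h.trans ?_
  rw [hpd]
  have hsum : ((HiggsLattice.Site.tdist (hb c).1.src (hb c').1.src : ℝ) + (HiggsLattice.Site.tdist (hb c).2 (hb c').2 : ℝ))
      / (P.L : ℝ) ^ k ≤ 2 * (max (HiggsLattice.Site.tdist (hb c).1.src (hb c').1.src : ℝ)
        (HiggsLattice.Site.tdist (hb c).2 (hb c').2 : ℝ) / (P.L : ℝ) ^ k) := by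
    rw [mul_div_assoc']
    refine div_le_div_of_nonneg_right ?_ hLk.le
    have h1 := le_max_left (HiggsLattice.Site.tdist (hb c).1.src (hb c').1.src : ℝ) (HiggsLattice.Site.tdist (hb c).2 (hb c').2 : ℝ)
    have h2 := le_max_right (HiggsLattice.Site.tdist (hb c).1.src (hb c').1.src : ℝ) (HiggsLattice.Site.tdist (hb c).2 (hb c').2 : ℝ)
    linarith
  have hB0 : 0 ≤ CV * phiSum P.L (P.d + 1) δ * Real.exp (-(δ * P.L / 2 * D)) := by positivity
  calc (P.d : ℝ) * (((HiggsLattice.Site.tdist (hb c).1.src (hb c').1.src : ℝ) + (HiggsLattice.Site.tdist (hb c).2 (hb c').2 : ℝ))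
        / (P.L : ℝ) ^ k) * (CV * phiSum P.L (P.d + 1) δ * Real.exp (-(δ * P.L / 2 * D)))
      ≤ (P.d : ℝ) * (2 * (max (HiggsLattice.Site.tdist (hb c).1.src (hb c').1.src : ℝ)
          (HiggsLattice.Site.tdist (hb c).2 (hb c').2 : ℝ) / (P.L : ℝ) ^ k)) *
          (CV * phiSum P.L (P.d + 1) δ * Real.exp (-(δ * P.L / 2 * D))) :=
        mul_le_mul_of_nonneg_right (mul_le_mul_of_nonneg_left hsum (Nat.cast_nonneg _)) hB0
    _ = _ := by ring

end Domains

/-! ## §III The multiplier `h ⊗ h′`: smooth localization functions on the lattice, the product rule, and the (1.32) norm of `hFh′` on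
the whole product lattice -/

section Multiplier

variable {k K₀ : ℕ} {Ω : Finset (HiggsLattice.Site P 0)} {C : ChargeData N} {A : HiggsLattice.VecField P 0} {msq a : ℝ}
  {m : ℕ} {D : ℝ}

/-- **The `η`-lattice derivative of a localization function** in the print's units for the step `k` (`η = L^{−k}` = one fine step):
`(∂^η_μ h)(x) = L^k(h(x + ηe_μ) − h(x))`, indexed by the bond `b = ⟨x, x + ηe_μ⟩`. [cite: Balaban1983Higgs3, (1.32) p.420] -/
def dEta (k : ℕ) (h : HiggsLattice.Site P 0 → ℝ) (b : HiggsLattice.PBond P 0) : ℝ := (P.L : ℝ) ^ k * (h b.tgt - h b.src)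

/-- **A smooth localization function `h` of the vertex localization of p. 420, supported in the domain `S`** — what the lattice sees of
*"a smooth function h such that h = 1 on □(v) and h = 0 outside some neighborhood of □(v)"* / of a member of *"a smooth partition of unity
… a support of each function is contained in a cube with sides of length 2"*: `|h| ≤ 1`, `|∂^ηh| ≤ c₁` on every bond, `∂^ηh` is
`α`-Hölder with constant `c₂` along every direction (`|∂^η_μh(x′) − ∂^η_μh(x)| ≤ c₂(|x − x′|/L^k)^α`), and the support of `h` together with
its lattice neighbours lies in `S` (so `h` and `∂^ηh` vanish on every bond not inside `S`).  The constants `c₁, c₂` are those of the fixed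
family of bumps (print fixes none). [cite: Balaban1983Higgs3, p.420] -/
structure IsSmoothLoc (k : ℕ) (c₁ c₂ α : ℝ) (S : Finset (HiggsLattice.Site P 0)) (h : HiggsLattice.Site P 0 → ℝ) : Prop where
  abs_le : ∀ x, |h x| ≤ 1
  dEta_le : ∀ b, |dEta k h b| ≤ c₁
  holder : ∀ (μ : Fin P.d) (x x' : HiggsLattice.Site P 0),
    |dEta k h ⟨x', μ⟩ - dEta k h ⟨x, μ⟩| ≤ c₂ * ((HiggsLattice.Site.tdist x x' : ℝ) / (P.L : ℝ) ^ k) ^ α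
  collar : ∀ x, h x ≠ 0 → x ∈ S ∧ ∀ μ, x.shift μ ∈ S ∧ x.unshift μ ∈ S

/-! ### Scalar lattice calculus of the localization functions -/

/-- one lattice step changes `h` by at most `c₁/L^k`. [cite: Balaban1983Higgs3, (1.32) p.420] -/
theorem abs_sub_shift_le {c₁ : ℝ} {h : HiggsLattice.Site P 0 → ℝ} (hd : ∀ b, |dEta k h b| ≤ c₁) (x : HiggsLattice.Site P 0)
    (μ : Fin P.d) : |h (x.shift μ) - h x| ≤ c₁ / (P.L : ℝ) ^ k := by
  have hT : (0 : ℝ) < (P.L : ℝ) ^ k := pow_pos (by exact_mod_cast P.hL) k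
  rw [le_div_iff₀ hT, mul_comm]
  have h1 := hd ⟨x, μ⟩
  rw [dEta, abs_mul, abs_of_pos hT] at h1
  exact h1

/-- **the path lemma for localization functions**: along a lattice chain `Γ` from `x`, `|h(end Γ) − h(x)| ≤ |Γ|·c₁/L^k`.
[cite: Balaban1983Higgs3, (1.32) p.420] [cite: Balaban1983RegularityDecay, p.578] -/
theorem abs_sub_le_of_isTChain {c₁ : ℝ} {h : HiggsLattice.Site P 0 → ℝ} (hd : ∀ b, |dEta k h b| ≤ c₁) :
    ∀ {x : HiggsLattice.Site P 0} {l : List (HiggsLattice.Site P 0)}, IsTChain x l →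
      |h (pathEnd x l) - h x| ≤ (l.length : ℝ) * (c₁ / (P.L : ℝ) ^ k)
  | x, [], _ => by simp [pathEnd]
  | x, y :: l, hl => by
    obtain ⟨⟨μ, hμ⟩, hl'⟩ := hl
    have ih := abs_sub_le_of_isTChain hd hl'
    have hstep : |h y - h x| ≤ c₁ / (P.L : ℝ) ^ k := by
      rcases hμ with rfl | rfl
      · exact abs_sub_shift_le hd x μ
      · rw [abs_sub_comm]; exact abs_sub_shift_le hd y μ
    have e : h (pathEnd x (y :: l)) - h x = (h (pathEnd y l) - h y) + (h y - h x) := by rw [pathEnd]; ring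
    rw [e, List.length_cons, Nat.cast_succ]
    calc |h (pathEnd y l) - h y + (h y - h x)| ≤ |h (pathEnd y l) - h y| + |h y - h x| := abs_add_le _ _
      _ ≤ (l.length : ℝ) * (c₁ / (P.L : ℝ) ^ k) + c₁ / (P.L : ℝ) ^ k := add_le_add ih hstep
      _ = _ := by ring

/-- **Lipschitz bound**: `|h(x′) − h(x)| ≤ d·c₁·|x − x′|/L^k` (along the coordinatewise contour `Γ_{x,x′}`, `|Γ| ≤ d|x − x′|`).
[cite: Balaban1983Higgs3, (1.32) p.420] [cite: Balaban1982Higgs1, Prop. 2.1 p.610] -/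
theorem abs_sub_le_lip {c₁ : ℝ} {h : HiggsLattice.Site P 0 → ℝ} (hd : ∀ b, |dEta k h b| ≤ c₁) (hc₁ : 0 ≤ c₁)
    (x x' : HiggsLattice.Site P 0) :
    |h x' - h x| ≤ (P.d : ℝ) * c₁ * ((HiggsLattice.Site.tdist x x' : ℝ) / (P.L : ℝ) ^ k) := by
  have hadm := isAdm_cpath x x'
  have h1 := abs_sub_le_of_isTChain hd hadm.1
  rw [pathEnd_cpath] at h1
  have hLk : (0 : ℝ) < (P.L : ℝ) ^ k := pow_pos (by exact_mod_cast P.hL) k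
  have h0 : 0 ≤ c₁ / (P.L : ℝ) ^ k := div_nonneg hc₁ hLk.le
  calc |h x' - h x| ≤ ((cpath x x').length : ℝ) * (c₁ / (P.L : ℝ) ^ k) := h1
    _ ≤ (P.d : ℝ) * (HiggsLattice.Site.tdist x x' : ℝ) * (c₁ / (P.L : ℝ) ^ k) := mul_le_mul_of_nonneg_right hadm.2.2 h0
    _ = _ := by rw [div_eq_mul_inv, div_eq_mul_inv]; ring

/-- the torus distance is invariant under a common lattice step: `|(x+e_μ) − (x′+e_μ)| = |x − x′|`. [cite: Balaban1982Higgs1, (1.3) p.604] -/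
theorem tdist_shift_shift (x x' : HiggsLattice.Site P 0) (μ : Fin P.d) :
    HiggsLattice.Site.tdist (x.shift μ) (x'.shift μ) = HiggsLattice.Site.tdist x x' := by
  have e : ∀ (y y' : HiggsLattice.Site P 0) (ν : Fin P.d), (y.shift μ) ν - (y'.shift μ) ν = y ν - y' ν := by
    intro y y' ν
    by_cases hν : ν = μ
    · subst hν; simp only [HiggsLattice.Site.shift, Function.update_self]; ring
    · simp [HiggsLattice.Site.shift, Function.update_of_ne hν]
  unfold HiggsLattice.Site.tdist
  exact Finset.sup_congr rfl fun ν _ => by rw [e, e]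

/-- the two-regime trick: a quantity bounded by `K₁p` AND by `K₂` is `≤ (K₁ + K₂)p^α` for `p > 0`, `0 ≤ α ≤ 1`
(`p ≤ 1`: `p ≤ p^α`; `p ≥ 1`: `1 ≤ p^α`). [folklore] -/
private theorem le_add_mul_rpow {t p α K₁ K₂ : ℝ} (hp : 0 < p) (hα0 : 0 ≤ α) (hα1 : α ≤ 1) (hK₁ : 0 ≤ K₁) (hK₂ : 0 ≤ K₂)
    (h₁ : t ≤ K₁ * p) (h₂ : t ≤ K₂) : t ≤ (K₁ + K₂) * p ^ α := by
  have hpα0 : 0 ≤ p ^ α := Real.rpow_nonneg hp.le α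
  rcases le_total p 1 with hp1 | hp1
  · have hpα : p ≤ p ^ α := by
      conv_lhs => rw [← Real.rpow_one p]
      exact Real.rpow_le_rpow_of_exponent_ge hp hp1 hα1
    calc t ≤ K₁ * p := h₁
      _ ≤ K₁ * p ^ α := mul_le_mul_of_nonneg_left hpα hK₁
      _ ≤ (K₁ + K₂) * p ^ α := by rw [add_mul]; linarith [mul_nonneg hK₂ hpα0]
  · have hpα : 1 ≤ p ^ α := Real.one_le_rpow hp1 hα0
    calc t ≤ K₂ * 1 := by rw [mul_one]; exact h₂
      _ ≤ K₂ * p ^ α := mul_le_mul_of_nonneg_left hpα hK₂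
      _ ≤ (K₁ + K₂) * p ^ α := by rw [add_mul]; linarith [mul_nonneg hK₁ hpα0]

/-! ### The two coefficients of the product rule and their moduli -/

section Coefficients

variable {Sb Sy : Finset (HiggsLattice.Site P 0)} {c₁ c₂ α : ℝ} {gB gY : HiggsLattice.Site P 0 → ℝ}

/-- `|h′(y)h(b₊)| ≤ 1`. [cite: Balaban1983Higgs3, p.420] -/
theorem abs_coefA_le (hgB : IsSmoothLoc k c₁ c₂ α Sb gB) (hgY : IsSmoothLoc k c₁ c₂ α Sy gY) (y u : HiggsLattice.Site P 0) :
    |gY y * gB u| ≤ 1 := by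
  rw [abs_mul]
  nlinarith [abs_nonneg (gY y), abs_nonneg (gB u), hgY.abs_le y, hgB.abs_le u]

/-- `|h′(y)(∂^ηh)(b)| ≤ c₁`. [cite: Balaban1983Higgs3, p.420] -/
theorem abs_coefB_le (hgB : IsSmoothLoc k c₁ c₂ α Sb gB) (hgY : IsSmoothLoc k c₁ c₂ α Sy gY) (y : HiggsLattice.Site P 0)
    (b : HiggsLattice.PBond P 0) : |gY y * dEta k gB b| ≤ c₁ := by
  rw [abs_mul]
  calc |gY y| * |dEta k gB b| ≤ 1 * c₁ := mul_le_mul (hgY.abs_le y) (hgB.dEta_le b) (abs_nonneg _) zero_le_one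
    _ = c₁ := one_mul _

/-- **the coefficients vanish off the domain**: if the bond `⟨x, x+e_μ⟩` is not inside `S_b` with `y ∈ S_y`, then `h′(y)h(x+e_μ) = 0` and
`h′(y)(∂^η_μh)(x) = 0` (the collar of the supports). [cite: Balaban1983Higgs3, p.420] -/
theorem coef_eq_zero (hgB : IsSmoothLoc k c₁ c₂ α Sb gB) (hgY : IsSmoothLoc k c₁ c₂ α Sy gY) {x y : HiggsLattice.Site P 0}
    {μ : Fin P.d} (hc : ¬(x ∈ Sb ∧ y ∈ Sy ∧ x.shift μ ∈ Sb)) :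
    gY y * gB (x.shift μ) = 0 ∧ gY y * dEta k gB ⟨x, μ⟩ = 0 := by
  by_cases hy : gY y = 0
  · rw [hy, zero_mul, zero_mul]; exact ⟨rfl, rfl⟩
  have hyS : y ∈ Sy := (hgY.collar y hy).1
  by_cases hu : gB (x.shift μ) = 0
  · refine ⟨by rw [hu, mul_zero], ?_⟩
    by_cases hx : gB x = 0
    · rw [dEta]
      change gY y * ((P.L : ℝ) ^ k * (gB (x.shift μ) - gB x)) = 0
      rw [hu, hx, sub_zero, mul_zero, mul_zero]
    · exact absurd ⟨(hgB.collar x hx).1, hyS, ((hgB.collar x hx).2 μ).1⟩ hc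
  · have h1 := hgB.collar _ hu
    have h2 : x ∈ Sb := by have := (h1.2 μ).2; rwa [HiggsCovariancePos.unshift_shift] at this
    exact absurd ⟨h2, hyS, h1.1⟩ hc

/-- **Lipschitz modulus of the first coefficient**: `|h′(y₂)h(x₂+e_μ) − h′(y₁)h(x₁+e_μ)| ≤ (2dc₁ + 2)·p^α`, `p = max(|x₁−x₂|,|y₁−y₂|)/L^k > 0`
(it is `≤ 2dc₁p` by the Lipschitz bounds and `≤ 2` outright). [cite: Balaban1983Higgs3, p.420] -/
theorem abs_coefA_sub_le (hgB : IsSmoothLoc k c₁ c₂ α Sb gB) (hgY : IsSmoothLoc k c₁ c₂ α Sy gY) (hc₁ : 0 ≤ c₁) (hα0 : 0 ≤ α)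
    (hα1 : α ≤ 1) {x₁ x₂ y₁ y₂ : HiggsLattice.Site P 0} (μ : Fin P.d)
    (hpos : 0 < max (HiggsLattice.Site.tdist x₁ x₂ : ℝ) (HiggsLattice.Site.tdist y₁ y₂ : ℝ) / (P.L : ℝ) ^ k) :
    |gY y₂ * gB (x₂.shift μ) - gY y₁ * gB (x₁.shift μ)|
      ≤ (2 * P.d * c₁ + 2) * (max (HiggsLattice.Site.tdist x₁ x₂ : ℝ) (HiggsLattice.Site.tdist y₁ y₂ : ℝ) / (P.L : ℝ) ^ k) ^ α := by
  have hLk : (0 : ℝ) < (P.L : ℝ) ^ k := pow_pos (by exact_mod_cast P.hL) k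
  have hx : (HiggsLattice.Site.tdist (x₁.shift μ) (x₂.shift μ) : ℝ) / (P.L : ℝ) ^ k
      ≤ max (HiggsLattice.Site.tdist x₁ x₂ : ℝ) (HiggsLattice.Site.tdist y₁ y₂ : ℝ) / (P.L : ℝ) ^ k := by
    rw [tdist_shift_shift]; exact div_le_div_of_nonneg_right (le_max_left _ _) hLk.le
  have hy : (HiggsLattice.Site.tdist y₁ y₂ : ℝ) / (P.L : ℝ) ^ k
      ≤ max (HiggsLattice.Site.tdist x₁ x₂ : ℝ) (HiggsLattice.Site.tdist y₁ y₂ : ℝ) / (P.L : ℝ) ^ k :=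
    div_le_div_of_nonneg_right (le_max_right _ _) hLk.le
  have e : gY y₂ * gB (x₂.shift μ) - gY y₁ * gB (x₁.shift μ)
      = gY y₂ * (gB (x₂.shift μ) - gB (x₁.shift μ)) + (gY y₂ - gY y₁) * gB (x₁.shift μ) := by ring
  refine le_add_mul_rpow hpos hα0 hα1 (by positivity) (by norm_num) ?_ ?_
  · rw [e]
    have h1 := abs_sub_le_lip hgB.dEta_le hc₁ (x₁.shift μ) (x₂.shift μ)
    have h2 := abs_sub_le_lip hgY.dEta_le hc₁ y₁ y₂
    have hdc : 0 ≤ (P.d : ℝ) * c₁ := by positivity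
    calc |gY y₂ * (gB (x₂.shift μ) - gB (x₁.shift μ)) + (gY y₂ - gY y₁) * gB (x₁.shift μ)|
        ≤ |gY y₂| * |gB (x₂.shift μ) - gB (x₁.shift μ)| + |gY y₂ - gY y₁| * |gB (x₁.shift μ)| := by
          rw [← abs_mul, ← abs_mul]; exact abs_add_le _ _
      _ ≤ 1 * ((P.d : ℝ) * c₁ * (max (HiggsLattice.Site.tdist x₁ x₂ : ℝ) (HiggsLattice.Site.tdist y₁ y₂ : ℝ) / (P.L : ℝ) ^ k)) +
            (P.d : ℝ) * c₁ * (max (HiggsLattice.Site.tdist x₁ x₂ : ℝ) (HiggsLattice.Site.tdist y₁ y₂ : ℝ) / (P.L : ℝ) ^ k) * 1 :=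
          add_le_add (mul_le_mul (hgY.abs_le y₂) (h1.trans (mul_le_mul_of_nonneg_left hx hdc)) (abs_nonneg _) zero_le_one)
            (mul_le_mul (h2.trans (mul_le_mul_of_nonneg_left hy hdc)) (hgB.abs_le _) (abs_nonneg _) (by positivity))
      _ = _ := by ring
  · calc |gY y₂ * gB (x₂.shift μ) - gY y₁ * gB (x₁.shift μ)| ≤ |gY y₂ * gB (x₂.shift μ)| + |gY y₁ * gB (x₁.shift μ)| :=
          abs_sub _ _
      _ ≤ 1 + 1 := add_le_add (abs_coefA_le hgB hgY y₂ _) (abs_coefA_le hgB hgY y₁ _)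
      _ = 2 := by norm_num

/-- **modulus of the second coefficient**: `|h′(y₂)(∂^η_μh)(x₂) − h′(y₁)(∂^η_μh)(x₁)| ≤ (c₂ + dc₁² + 2c₁)·p^α` (the Hölder modulus of `∂^ηh`
for the first difference; `≤ dc₁²p` and `≤ 2c₁` for the second). [cite: Balaban1983Higgs3, p.420] -/
theorem abs_coefB_sub_le (hgB : IsSmoothLoc k c₁ c₂ α Sb gB) (hgY : IsSmoothLoc k c₁ c₂ α Sy gY) (hc₁ : 0 ≤ c₁) (hc₂ : 0 ≤ c₂)
    (hα0 : 0 ≤ α) (hα1 : α ≤ 1) {x₁ x₂ y₁ y₂ : HiggsLattice.Site P 0} (μ : Fin P.d)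
    (hpos : 0 < max (HiggsLattice.Site.tdist x₁ x₂ : ℝ) (HiggsLattice.Site.tdist y₁ y₂ : ℝ) / (P.L : ℝ) ^ k) :
    |gY y₂ * dEta k gB ⟨x₂, μ⟩ - gY y₁ * dEta k gB ⟨x₁, μ⟩|
      ≤ (c₂ + P.d * c₁ * c₁ + 2 * c₁) *
          (max (HiggsLattice.Site.tdist x₁ x₂ : ℝ) (HiggsLattice.Site.tdist y₁ y₂ : ℝ) / (P.L : ℝ) ^ k) ^ α := by
  have hLk : (0 : ℝ) < (P.L : ℝ) ^ k := pow_pos (by exact_mod_cast P.hL) k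
  set pd := max (HiggsLattice.Site.tdist x₁ x₂ : ℝ) (HiggsLattice.Site.tdist y₁ y₂ : ℝ) / (P.L : ℝ) ^ k with hpd
  have hx : (HiggsLattice.Site.tdist x₁ x₂ : ℝ) / (P.L : ℝ) ^ k ≤ pd := div_le_div_of_nonneg_right (le_max_left _ _) hLk.le
  have hy : (HiggsLattice.Site.tdist y₁ y₂ : ℝ) / (P.L : ℝ) ^ k ≤ pd := div_le_div_of_nonneg_right (le_max_right _ _) hLk.le
  have hpdα : 0 ≤ pd ^ α := Real.rpow_nonneg hpos.le α
  -- first difference: the Hölder modulus of `∂^ηh`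
  have hfirst : |gY y₂ * (dEta k gB ⟨x₂, μ⟩ - dEta k gB ⟨x₁, μ⟩)| ≤ c₂ * pd ^ α := by
    rw [abs_mul]
    have hη := hgB.holder μ x₁ x₂
    have hmono : ((HiggsLattice.Site.tdist x₁ x₂ : ℝ) / (P.L : ℝ) ^ k) ^ α ≤ pd ^ α :=
      Real.rpow_le_rpow (by positivity) hx hα0
    calc |gY y₂| * |dEta k gB ⟨x₂, μ⟩ - dEta k gB ⟨x₁, μ⟩| ≤ 1 * (c₂ * pd ^ α) :=
          mul_le_mul (hgY.abs_le y₂) (hη.trans (mul_le_mul_of_nonneg_left hmono hc₂)) (abs_nonneg _) zero_le_one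
      _ = c₂ * pd ^ α := one_mul _
  -- second difference: two regimes
  have hsecond : |(gY y₂ - gY y₁) * dEta k gB ⟨x₁, μ⟩| ≤ (P.d * c₁ * c₁ + 2 * c₁) * pd ^ α := by
    refine le_add_mul_rpow hpos hα0 hα1 (by positivity) (by positivity) ?_ ?_
    · rw [abs_mul]
      have h2 := abs_sub_le_lip hgY.dEta_le hc₁ y₁ y₂
      calc |gY y₂ - gY y₁| * |dEta k gB ⟨x₁, μ⟩| ≤ (P.d : ℝ) * c₁ * pd * c₁ :=
            mul_le_mul (h2.trans (mul_le_mul_of_nonneg_left hy (by positivity))) (hgB.dEta_le _) (abs_nonneg _) (by positivity)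
        _ = P.d * c₁ * c₁ * pd := by ring
    · rw [abs_mul]
      calc |gY y₂ - gY y₁| * |dEta k gB ⟨x₁, μ⟩| ≤ (1 + 1) * c₁ :=
            mul_le_mul ((abs_sub _ _).trans (add_le_add (hgY.abs_le y₂) (hgY.abs_le y₁))) (hgB.dEta_le _) (abs_nonneg _)
              (by norm_num)
        _ = 2 * c₁ := by norm_num
  have e : gY y₂ * dEta k gB ⟨x₂, μ⟩ - gY y₁ * dEta k gB ⟨x₁, μ⟩
      = gY y₂ * (dEta k gB ⟨x₂, μ⟩ - dEta k gB ⟨x₁, μ⟩) + (gY y₂ - gY y₁) * dEta k gB ⟨x₁, μ⟩ := by ring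
  rw [e]
  calc |gY y₂ * (dEta k gB ⟨x₂, μ⟩ - dEta k gB ⟨x₁, μ⟩) + (gY y₂ - gY y₁) * dEta k gB ⟨x₁, μ⟩|
      ≤ c₂ * pd ^ α + (P.d * c₁ * c₁ + 2 * c₁) * pd ^ α := (abs_add_le _ _).trans (add_le_add hfirst hsecond)
    _ = _ := by ring

end Coefficients

/-! ### The four-term expansion of the transported difference of `D^η(hFh′)` -/

/-- `‖U(A(Γ))∘M∘U(A(Γ′))^*‖ ≤ ‖M‖` (the transports are unitary). [cite: Balaban1983Higgs3, (1.32) p.420] -/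
theorem norm_sandwich_le (x₁ : HiggsLattice.Site P 0) (Γ : List (HiggsLattice.Site P 0)) (y₁ : HiggsLattice.Site P 0)
    (Γ' : List (HiggsLattice.Site P 0)) (M : E N →L[ℝ] E N) :
    ‖(hol C A x₁ Γ).comp (M.comp (star (hol C A y₁ Γ')))‖ ≤ ‖M‖ := by
  refine (norm_hol_comp_le _ _ _).trans ((ContinuousLinearMap.opNorm_comp_le _ _).trans ?_)
  have h1 : ‖star (hol C A y₁ Γ')‖ ≤ 1 := by
    rw [ContinuousLinearMap.star_eq_adjoint, LinearIsometryEquiv.norm_map]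
    exact norm_hol_le_one _ _
  calc ‖M‖ * ‖star (hol C A y₁ Γ')‖ ≤ ‖M‖ * 1 := mul_le_mul_of_nonneg_left h1 (norm_nonneg _)
    _ = ‖M‖ := mul_one _

/-- the four-term identity `a′X̃′ + b′Ỹ′ − (aX + bY) = a′(X̃′ − X) + (a′ − a)X + b′(Ỹ′ − Y) + (b′ − b)Y`. [folklore] -/
private theorem four_term {M : Type*} [AddCommGroup M] [Module ℝ M] (r r' s s' : ℝ) (X Y TX TY : M) :
    r' • TX + s' • TY - (r • X + s • Y) = r' • (TX - X) + (r' - r) • X + s' • (TY - Y) + (s' - s) • Y := by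
  simp only [smul_sub, sub_smul]; abel

/-- the mirrored identity `a′X̃′ + b′Ỹ′ − (aX + bY) = (a′ − a)X̃′ + a(X̃′ − X) + (b′ − b)Ỹ′ + b(Ỹ′ − Y)`. [folklore] -/
private theorem four_term' {M : Type*} [AddCommGroup M] [Module ℝ M] (r r' s s' : ℝ) (X Y TX TY : M) :
    r' • TX + s' • TY - (r • X + s • Y) = (r' - r) • TX + r • (TX - X) + (s' - s) • TY + s • (TY - Y) := by
  simp only [smul_sub, sub_smul]; abel

/-- `‖aX + bY + cZ + dW‖ ≤ |a|‖X‖ + |b|‖Y‖ + |c|‖Z‖ + |d|‖W‖`. [folklore] -/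
private theorem norm_four_le (r s t u : ℝ) (X Y Z W : E N →L[ℝ] E N) :
    ‖r • X + s • Y + t • Z + u • W‖ ≤ |r| * ‖X‖ + |s| * ‖Y‖ + |t| * ‖Z‖ + |u| * ‖W‖ := by
  have h := norm_add_le (r • X + s • Y + t • Z) (u • W)
  have h' := norm_add_le (r • X + s • Y) (t • Z)
  have h'' := norm_add_le (r • X) (s • Y)
  simp only [norm_smul, Real.norm_eq_abs] at h h' h''
  linarith
set_option maxHeartbeats 400000 in
/-- **The core Hölder estimate for the multiplier, one same-direction pair in explicit variables.**  On an admissible pair `(S_b, S_y)`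
carrying smooth localization functions `g_b` (on the differentiated variable) and `g_y` (on the other), given the four bounds of the
UNLOCALIZED field on the pair — values `‖F‖ ≤ B`, derivatives `‖D^ηF‖ ≤ B`, Hölder quotients `≤ B_H·p^α`, value moves `≤ d(|Δx| + |Δy|)/L^k·B` —
the transported difference of `D^η(g_b F g_y) = a·D^ηF + b·F` (`a = g_y(y)g_b(x+e_μ)`, `b = g_y(y)∂^η_μg_b(x)`) between the bonds over `(x₁,y₁)`
and `(x₂,y₂)` is at most `(B_H + (4 + 2dc₁ + 2dmc₁ + dc₁² + 2c₁ + c₂)·B)·p^α`, `p = max(|x₁−x₂|,|y₁−y₂|)/L^k > 0`, WHETHER OR NOT the bonds lie in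
the domains: by the four-term expansion when both do (inside, `|Δy|/L^k ≤ p ≤ mp^α`), by the vanishing of the far coefficients and the
moduli of `a, b` when only one does, trivially when none does. [cite: Balaban1983Higgs3, (3.1) p.432] [cite: Balaban1983Higgs3, (1.32) p.420] -/
theorem holder_core_mul {Sb Sy : Finset (HiggsLattice.Site P 0)} (hdom : DomPair k K₀ Ω m D Sb Sy) {c₁ c₂ α : ℝ} (hc₁ : 0 ≤ c₁)
    (hc₂ : 0 ≤ c₂) (hα0 : 0 ≤ α) (hα1 : α ≤ 1) {gB gY : HiggsLattice.Site P 0 → ℝ} (hgB : IsSmoothLoc k c₁ c₂ α Sb gB)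
    (hgY : IsSmoothLoc k c₁ c₂ α Sy gY) {BV BH : ℝ} (hBV : 0 ≤ BV) (hBH : 0 ≤ BH)
    (bY : ∀ x ∈ Sb, ∀ y ∈ Sy, ‖unitV P k • blockKR C Ω A msq a k x y‖ ≤ BV)
    (bX : ∀ x ∈ Sb, ∀ y ∈ Sy, ∀ μ : Fin P.d, ‖unitD P k • blockDKR C Ω A msq a k ⟨x, μ⟩ y‖ ≤ BV)
    (bH : ∀ (μ : Fin P.d) (x₁ x₂ y₁ y₂ : HiggsLattice.Site P 0), x₁ ∈ Sb → x₂ ∈ Sb → y₁ ∈ Sy → y₂ ∈ Sy →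
      0 < max (HiggsLattice.Site.tdist x₁ x₂ : ℝ) (HiggsLattice.Site.tdist y₁ y₂ : ℝ) / (P.L : ℝ) ^ k →
      ‖(hol C A x₁ (cpath x₁ x₂)).comp
            ((unitD P k • blockDKR C Ω A msq a k ⟨x₂, μ⟩ y₂).comp (star (hol C A y₁ (cpath y₁ y₂))))
          - unitD P k • blockDKR C Ω A msq a k ⟨x₁, μ⟩ y₁‖
        ≤ BH * (max (HiggsLattice.Site.tdist x₁ x₂ : ℝ) (HiggsLattice.Site.tdist y₁ y₂ : ℝ) / (P.L : ℝ) ^ k) ^ α)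
    (bM : ∀ (x₁ x₂ y₁ y₂ : HiggsLattice.Site P 0), x₁ ∈ Sb → x₂ ∈ Sb → y₁ ∈ Sy → y₂ ∈ Sy →
      ‖(hol C A x₁ (cpath x₁ x₂)).comp
            ((unitV P k • blockKR C Ω A msq a k x₂ y₂).comp (star (hol C A y₁ (cpath y₁ y₂))))
          - unitV P k • blockKR C Ω A msq a k x₁ y₁‖
        ≤ (P.d : ℝ) * (((HiggsLattice.Site.tdist x₁ x₂ : ℝ) + (HiggsLattice.Site.tdist y₁ y₂ : ℝ)) / (P.L : ℝ) ^ k) * BV)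
    {x₁ x₂ y₁ y₂ : HiggsLattice.Site P 0} (μ : Fin P.d)
    (hpos : 0 < max (HiggsLattice.Site.tdist x₁ x₂ : ℝ) (HiggsLattice.Site.tdist y₁ y₂ : ℝ) / (P.L : ℝ) ^ k) :
    ‖(hol C A x₁ (cpath x₁ x₂)).comp
          (((gY y₂ * gB (x₂.shift μ)) • (unitD P k • blockDKR C Ω A msq a k ⟨x₂, μ⟩ y₂)
              + (gY y₂ * dEta k gB ⟨x₂, μ⟩) • (unitV P k • blockKR C Ω A msq a k x₂ y₂)).comp
            (star (hol C A y₁ (cpath y₁ y₂))))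
        - ((gY y₁ * gB (x₁.shift μ)) • (unitD P k • blockDKR C Ω A msq a k ⟨x₁, μ⟩ y₁)
            + (gY y₁ * dEta k gB ⟨x₁, μ⟩) • (unitV P k • blockKR C Ω A msq a k x₁ y₁))‖
      ≤ (BH + ((2 * P.d * c₁ + 2) + 2 * P.d * m * c₁ + (c₂ + P.d * c₁ * c₁ + 2 * c₁)) * BV) *
          (max (HiggsLattice.Site.tdist x₁ x₂ : ℝ) (HiggsLattice.Site.tdist y₁ y₂ : ℝ) / (P.L : ℝ) ^ k) ^ α := by
  have hLk : (0 : ℝ) < (P.L : ℝ) ^ k := pow_pos (by exact_mod_cast P.hL) k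
  -- the coefficient facts (before renaming)
  have ha' : |gY y₂ * gB (x₂.shift μ)| ≤ 1 := abs_coefA_le hgB hgY y₂ _
  have ha : |gY y₁ * gB (x₁.shift μ)| ≤ 1 := abs_coefA_le hgB hgY y₁ _
  have hb' : |gY y₂ * dEta k gB ⟨x₂, μ⟩| ≤ c₁ := abs_coefB_le hgB hgY y₂ _
  have hb : |gY y₁ * dEta k gB ⟨x₁, μ⟩| ≤ c₁ := abs_coefB_le hgB hgY y₁ _
  have hda := abs_coefA_sub_le hgB hgY hc₁ hα0 hα1 μ hpos (x₁ := x₁) (x₂ := x₂) (y₁ := y₁) (y₂ := y₂)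
  have hdb := abs_coefB_sub_le hgB hgY hc₁ hc₂ hα0 hα1 μ hpos (x₁ := x₁) (x₂ := x₂) (y₁ := y₁) (y₂ := y₂)
  have hza' := fun hc => (coef_eq_zero hgB hgY (x := x₂) (y := y₂) (μ := μ) hc).1
  have hzb' := fun hc => (coef_eq_zero hgB hgY (x := x₂) (y := y₂) (μ := μ) hc).2
  have hza := fun hc => (coef_eq_zero hgB hgY (x := x₁) (y := y₁) (μ := μ) hc).1
  have hzb := fun hc => (coef_eq_zero hgB hgY (x := x₁) (y := y₁) (μ := μ) hc).2
  -- names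
  set pd := max (HiggsLattice.Site.tdist x₁ x₂ : ℝ) (HiggsLattice.Site.tdist y₁ y₂ : ℝ) / (P.L : ℝ) ^ k with hpd
  have hpdα : 0 ≤ pd ^ α := Real.rpow_nonneg hpos.le α
  generalize ea' : gY y₂ * gB (x₂.shift μ) = a₂ at ha' hda hza'
  generalize ea : gY y₁ * gB (x₁.shift μ) = a₁ at ha hda hza
  generalize eb' : gY y₂ * dEta k gB ⟨x₂, μ⟩ = b₂ at hb' hdb hzb'
  generalize eb : gY y₁ * dEta k gB ⟨x₁, μ⟩ = b₁ at hb hdb hzb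
  generalize eX' : unitD P k • blockDKR C Ω A msq a k ⟨x₂, μ⟩ y₂ = X'
  generalize eX : unitD P k • blockDKR C Ω A msq a k ⟨x₁, μ⟩ y₁ = X
  generalize eY' : unitV P k • blockKR C Ω A msq a k x₂ y₂ = Y'
  generalize eY : unitV P k • blockKR C Ω A msq a k x₁ y₁ = Y
  -- the transported atoms, and the transports distributed over the linear combination
  obtain ⟨TX, eTX⟩ : ∃ T : E N →L[ℝ] E N,
      (hol C A x₁ (cpath x₁ x₂)).comp (X'.comp (star (hol C A y₁ (cpath y₁ y₂)))) = T := ⟨_, rfl⟩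
  obtain ⟨TY, eTY⟩ : ∃ T : E N →L[ℝ] E N,
      (hol C A x₁ (cpath x₁ x₂)).comp (Y'.comp (star (hol C A y₁ (cpath y₁ y₂)))) = T := ⟨_, rfl⟩
  have hTX : ‖TX‖ ≤ ‖X'‖ := by rw [← eTX]; exact norm_sandwich_le _ _ _ _ _
  have hTY : ‖TY‖ ≤ ‖Y'‖ := by rw [← eTY]; exact norm_sandwich_le _ _ _ _ _
  have edist : (hol C A x₁ (cpath x₁ x₂)).comp ((a₂ • X' + b₂ • Y').comp (star (hol C A y₁ (cpath y₁ y₂)))) = a₂ • TX + b₂ • TY := by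
    rw [← eTX, ← eTY]
    simp only [ContinuousLinearMap.add_comp, ContinuousLinearMap.smul_comp, ContinuousLinearMap.comp_add,
      ContinuousLinearMap.comp_smul]
  rw [edist]
  -- the total constant dominates the partial ones
  have hK : 0 ≤ BH + ((2 * P.d * c₁ + 2) + 2 * P.d * m * c₁ + (c₂ + P.d * c₁ * c₁ + 2 * c₁)) * BV := by positivity
  have hpart : ((2 * P.d * c₁ + 2) + (c₂ + P.d * c₁ * c₁ + 2 * c₁)) * BV * pd ^ α
      ≤ (BH + ((2 * P.d * c₁ + 2) + 2 * P.d * m * c₁ + (c₂ + P.d * c₁ * c₁ + 2 * c₁)) * BV) * pd ^ α := by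
    refine mul_le_mul_of_nonneg_right ?_ hpdα
    nlinarith [mul_nonneg (mul_nonneg (mul_nonneg (mul_nonneg (by norm_num : (0 : ℝ) ≤ 2) (Nat.cast_nonneg P.d))
      (Nat.cast_nonneg m)) hc₁) hBV]
  by_cases hc : x₁ ∈ Sb ∧ y₁ ∈ Sy ∧ x₁.shift μ ∈ Sb <;> by_cases hc' : x₂ ∈ Sb ∧ y₂ ∈ Sy ∧ x₂.shift μ ∈ Sb
  · -- both bonds inside: the four-term expansion
    obtain ⟨hx₁, hy₁, -⟩ := hc
    obtain ⟨hx₂, hy₂, -⟩ := hc'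
    have h1 : ‖TX - X‖ ≤ BH * pd ^ α := by rw [← eTX, ← eX, ← eX']; exact bH μ x₁ x₂ y₁ y₂ hx₁ hx₂ hy₁ hy₂ hpos
    have h2 : ‖X‖ ≤ BV := by rw [← eX]; exact bX x₁ hx₁ y₁ hy₁ μ
    have h4 : ‖Y‖ ≤ BV := by rw [← eY]; exact bY x₁ hx₁ y₁ hy₁
    have hpdm : pd ≤ m := by
      rw [hpd, ← max_div_div_right hLk.le]
      exact max_le (hdom.diam x₁ hx₁ x₂ hx₂) (hdom.diam' y₁ hy₁ y₂ hy₂)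
    have hpdmα : pd ≤ m * pd ^ α := le_mul_rpow_of_le hpos hpdm hα0 hα1
    have h3 : ‖TY - Y‖ ≤ 2 * P.d * m * BV * pd ^ α := by
      rw [← eTY, ← eY, ← eY']
      refine (bM x₁ x₂ y₁ y₂ hx₁ hx₂ hy₁ hy₂).trans ?_
      have hsum : ((HiggsLattice.Site.tdist x₁ x₂ : ℝ) + (HiggsLattice.Site.tdist y₁ y₂ : ℝ)) / (P.L : ℝ) ^ k ≤ 2 * pd := by
        rw [add_div]
        have e1 : (HiggsLattice.Site.tdist x₁ x₂ : ℝ) / (P.L : ℝ) ^ k ≤ pd := div_le_div_of_nonneg_right (le_max_left _ _) hLk.le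
        have e2 : (HiggsLattice.Site.tdist y₁ y₂ : ℝ) / (P.L : ℝ) ^ k ≤ pd := div_le_div_of_nonneg_right (le_max_right _ _) hLk.le
        linarith
      calc (P.d : ℝ) * (((HiggsLattice.Site.tdist x₁ x₂ : ℝ) + (HiggsLattice.Site.tdist y₁ y₂ : ℝ)) / (P.L : ℝ) ^ k) * BV
          ≤ (P.d : ℝ) * (2 * (m * pd ^ α)) * BV :=
            mul_le_mul_of_nonneg_right (mul_le_mul_of_nonneg_left (hsum.trans (by linarith)) (Nat.cast_nonneg _)) hBV
        _ = _ := by ring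
    have e4 : a₂ • TX + b₂ • TY - (a₁ • X + b₁ • Y) = a₂ • (TX - X) + (a₂ - a₁) • X + b₂ • (TY - Y) + (b₂ - b₁) • Y :=
      four_term _ _ _ _ _ _ _ _
    rw [e4]
    refine (norm_four_le _ _ _ _ _ _ _ _).trans ?_
    calc |a₂| * ‖TX - X‖ + |a₂ - a₁| * ‖X‖ + |b₂| * ‖TY - Y‖ + |b₂ - b₁| * ‖Y‖
        ≤ 1 * (BH * pd ^ α) + (2 * P.d * c₁ + 2) * pd ^ α * BV + c₁ * (2 * P.d * m * BV * pd ^ α)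
            + (c₂ + P.d * c₁ * c₁ + 2 * c₁) * pd ^ α * BV := by
          refine add_le_add (add_le_add (add_le_add ?_ ?_) ?_) ?_
          · exact mul_le_mul ha' h1 (norm_nonneg _) zero_le_one
          · exact mul_le_mul hda h2 (norm_nonneg _) (by positivity)
          · exact mul_le_mul hb' h3 (norm_nonneg _) hc₁
          · exact mul_le_mul hdb h4 (norm_nonneg _) (by positivity)
      _ = _ := by ring
  · -- `c` inside, `c′` outside: `a′ = b′ = 0`, and `|a| = |a′ − a|`, `|b| = |b′ − b|`
    obtain ⟨hx₁, hy₁, -⟩ := hc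
    have h2 : ‖X‖ ≤ BV := by rw [← eX]; exact bX x₁ hx₁ y₁ hy₁ μ
    have h4 : ‖Y‖ ≤ BV := by rw [← eY]; exact bY x₁ hx₁ y₁ hy₁
    have ea0 : a₂ = 0 := hza' hc'
    have eb0 : b₂ = 0 := hzb' hc'
    subst ea0 eb0
    rw [zero_smul ℝ TX, zero_smul ℝ TY, zero_add, zero_sub, norm_neg]
    rw [zero_sub, abs_neg] at hda hdb
    calc ‖a₁ • X + b₁ • Y‖ ≤ |a₁| * ‖X‖ + |b₁| * ‖Y‖ := by
          refine (norm_add_le _ _).trans ?_; rw [norm_smul, norm_smul, Real.norm_eq_abs, Real.norm_eq_abs]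
      _ ≤ (2 * P.d * c₁ + 2) * pd ^ α * BV + (c₂ + P.d * c₁ * c₁ + 2 * c₁) * pd ^ α * BV :=
          add_le_add (mul_le_mul hda h2 (norm_nonneg _) (by positivity)) (mul_le_mul hdb h4 (norm_nonneg _) (by positivity))
      _ = ((2 * P.d * c₁ + 2) + (c₂ + P.d * c₁ * c₁ + 2 * c₁)) * BV * pd ^ α := by ring
      _ ≤ _ := hpart
  · -- `c` outside, `c′` inside: `a = b = 0`
    obtain ⟨hx₂, hy₂, -⟩ := hc'
    have h2 : ‖TX‖ ≤ BV := hTX.trans (by rw [← eX']; exact bX x₂ hx₂ y₂ hy₂ μ)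
    have h4 : ‖TY‖ ≤ BV := hTY.trans (by rw [← eY']; exact bY x₂ hx₂ y₂ hy₂)
    have ea0 : a₁ = 0 := hza hc
    have eb0 : b₁ = 0 := hzb hc
    subst ea0 eb0
    rw [zero_smul ℝ X, zero_smul ℝ Y, add_zero, sub_zero]
    rw [sub_zero] at hda hdb
    calc ‖a₂ • TX + b₂ • TY‖ ≤ |a₂| * ‖TX‖ + |b₂| * ‖TY‖ := by
          refine (norm_add_le _ _).trans ?_; rw [norm_smul, norm_smul, Real.norm_eq_abs, Real.norm_eq_abs]
      _ ≤ (2 * P.d * c₁ + 2) * pd ^ α * BV + (c₂ + P.d * c₁ * c₁ + 2 * c₁) * pd ^ α * BV :=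
          add_le_add (mul_le_mul hda h2 (norm_nonneg _) (by positivity)) (mul_le_mul hdb h4 (norm_nonneg _) (by positivity))
      _ = ((2 * P.d * c₁ + 2) + (c₂ + P.d * c₁ * c₁ + 2 * c₁)) * BV * pd ^ α := by ring
      _ ≤ _ := hpart
  · -- both outside: everything vanishes
    have ea0 : a₁ = 0 := hza hc
    have eb0 : b₁ = 0 := hzb hc
    have ea0' : a₂ = 0 := hza' hc'
    have eb0' : b₂ = 0 := hzb' hc'
    subst ea0 eb0 ea0' eb0'
    rw [zero_smul ℝ TX, zero_smul ℝ TY, zero_smul ℝ X, zero_smul ℝ Y, add_zero, sub_self, norm_zero]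
    positivity

end Multiplier

/-! ## §III′ The localized two-variable field `G = (h ⊗ h′)F`, its covariant `η`-derivatives by the product rule, and its (1.32) norm on
the whole product lattice -/

section Product

variable (C : ChargeData N) (Ω : Finset (HiggsLattice.Site P 0)) (A : HiggsLattice.VecField P 0) (msq a : ℝ) (k : ℕ)

/-- **The localized two-variable field of (3.1)**: `G(x,x′) = h(x)h′(x′)·G_k(Ω,A;x,x′)` in the print's units (`kerFR` times the two
localization functions), on the whole product lattice. [cite: Balaban1983Higgs3, (3.1) p.432] [cite: Balaban1983Higgs3, p.420] -/
def kerG (h h' : HiggsLattice.Site P 0 → ℝ) (z : PSite P) : E N →L[ℝ] E N := (h z.1 * h' z.2) • kerFR C Ω A msq a k z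

/-- **The value `F` carries at the base of a product bond, seen from the differentiated variable**: `G^ε_k(Ω,A;x,x′)` (in units) for the
row bond over `(x,x′)`, the transposed value `G^ε_k(Ω,A;x′,x) = G^ε_k(Ω,A;x,x′)^*` for the column bond (`star_kerFR`).
[cite: Balaban1983Higgs3, (1.32) p.420] [cite: Balaban1982Higgs1, (2.20) p.610] -/
def valY (c : PBd P) : E N →L[ℝ] E N := unitV P k • blockKR C Ω A msq a k (hb c).1.src (hb c).2

variable {C Ω A msq a k}

/-- the localization function of the DIFFERENTIATED variable of a product bond: `h` on row bonds, `h′` on column bonds.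
[cite: Balaban1983Higgs3, (1.32) p.420] -/
def fd (h h' : HiggsLattice.Site P 0 → ℝ) : PBd P → (HiggsLattice.Site P 0 → ℝ) := Sum.elim (fun _ => h) (fun _ => h')

/-- the localization function of the OTHER variable: `h′` on row bonds, `h` on column bonds. [cite: Balaban1983Higgs3, (1.32) p.420] -/
def fo (h h' : HiggsLattice.Site P 0 → ℝ) : PBd P → (HiggsLattice.Site P 0 → ℝ) := Sum.elim (fun _ => h') (fun _ => h)

/-- **the first coefficient of the product rule** `a(c) = h′(x′)h(b₊)` (row bond `b` over `(x,x′)`; roles swapped on columns).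
[cite: Balaban1983Higgs3, (1.32) p.420] -/
def coefA (h h' : HiggsLattice.Site P 0 → ℝ) (c : PBd P) : ℝ := fo h h' c (hb c).2 * fd h h' c (hb c).1.tgt

/-- **the second coefficient of the product rule** `b(c) = h′(x′)(∂^ηh)(b)`. [cite: Balaban1983Higgs3, (1.32) p.420] -/
def coefB (k : ℕ) (h h' : HiggsLattice.Site P 0 → ℝ) (c : PBd P) : ℝ := fo h h' c (hb c).2 * dEta k (fd h h' c) (hb c).1

variable (C Ω A msq a k)

/-- **The covariant `η`-derivatives of `G = (h ⊗ h′)F` along the product bonds, BY THE PRODUCT RULE**: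
`D^η(hF)(b) = h(b₊)·(D^η_AF)(b) + (∂^ηh)(b)·F(b₋)` in the differentiated variable, times the localization function of the other variable —
`a(c)·D^ηF(c) + b(c)·Y(c)`; PROVED equal to the covariant difference quotient of `G` (`derivG_inl`, `derivG_inr`).
[cite: Balaban1983Higgs3, (1.32) p.420] [cite: Balaban1982Higgs1, (1.7) p.605] -/
def derivG (h h' : HiggsLattice.Site P 0 → ℝ) (c : PBd P) : E N →L[ℝ] E N :=
  coefA h h' c • derivFR C Ω A msq a k c + coefB k h h' c • valY C Ω A msq a k c

/-- **The printed (1.32) norm of `hG_k(Ω,A)h′` on THE WHOLE PRODUCT LATTICE** (`G` is globally defined and vanishes off the supports):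
`norm132` over all sites, all product bonds, same-direction pairs at the sup-distance `pdist`, transports `U(A(Γ))∘·∘U(A(Γ′))^*`.
[cite: Balaban1983Higgs3, (3.1) p.432] [cite: Balaban1983Higgs3, (1.32) p.420] -/
def normHGHS (α : ℝ) (h h' : HiggsLattice.Site P 0 → ℝ) : ℝ :=
  norm132 α (fun c c' : PBd P => dirOf c = dirOf c') (fun c c' => pdist k (baseOf c) (baseOf c')) (transp C A)
    Finset.univ Finset.univ (kerG C Ω A msq a k h h') (derivG C Ω A msq a k h h')

variable {C Ω A msq a k}

/-- `normHGHS` unfolds to the printed sum form. [cite: Balaban1983Higgs3, (1.32) p.420] -/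
theorem normHGHS_eq (α : ℝ) (h h' : HiggsLattice.Site P 0 → ℝ) :
    normHGHS C Ω A msq a k α h h'
      = norm132 α (fun c c' : PBd P => dirOf c = dirOf c') (fun c c' => pdist k (baseOf c) (baseOf c')) (transp C A)
          Finset.univ Finset.univ (kerG C Ω A msq a k h h') (derivG C Ω A msq a k h h') :=
  rfl

variable {K₀ m : ℕ} {D : ℝ}

/-- **The region kernel's blocks are transposes of each other**: `G^ε_k(Ω,A;x,y)^* = G^ε_k(Ω,A;y,x)` (p33's symmetry
`inner_propagatorK_single_comm_R` of the self-adjoint positive `G_k(Ω,A)`). [cite: Balaban1982Higgs1, (2.20) p.610] -/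
theorem star_blockKR (x y : HiggsLattice.Site P 0) : star (blockKR C Ω A msq a k x y) = blockKR C Ω A msq a k y x := by
  rw [ContinuousLinearMap.star_eq_adjoint]
  refine ContinuousLinearMap.ext fun v => ?_
  refine ext_inner_right ℝ fun w => ?_
  rw [ContinuousLinearMap.adjoint_inner_left, blockKR_apply, blockKR_apply]
  exact inner_propagatorK_single_comm_R (C := C) (Ω := Ω) (A := A) (msq := msq) (a := a) k x y w v

/-- Hence `F(x,y)^* = F(y,x)` for the two-variable field. [cite: Balaban1982Higgs1, (2.20) p.610] -/
theorem star_kerFR (x y : HiggsLattice.Site P 0) : star (kerFR C Ω A msq a k (x, y)) = kerFR C Ω A msq a k (y, x) := by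
  unfold kerFR
  rw [star_smul, star_trivial, star_blockKR]

/-- and `G(x,y)^* = h(x)h′(y)·F(y,x)`. [cite: Balaban1982Higgs1, (2.20) p.610] -/
theorem star_kerG (h h' : HiggsLattice.Site P 0 → ℝ) (x y : HiggsLattice.Site P 0) :
    star (kerG C Ω A msq a k h h' (x, y)) = (h x * h' y) • kerFR C Ω A msq a k (y, x) := by
  unfold kerG
  rw [star_smul, star_trivial, star_kerFR]

/-- the derivative block in the print's units is `L^k` times the covariant difference of the value blocks: `unitD·ε^{−1} = L^k·unitV`.
[cite: Balaban1982Higgs1, (1.7) p.605] -/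
theorem derivFR_eq (c : PBd P) :
    derivFR C Ω A msq a k c
      = ((P.L : ℝ) ^ k) • ((C.U (P.mesh 0) (A (hb c).1)).comp (unitV P k • blockKR C Ω A msq a k (hb c).1.tgt (hb c).2)
          - unitV P k • blockKR C Ω A msq a k (hb c).1.src (hb c).2) := by
  rw [derivFR, blockDKR, smul_smul, unitD_mul_inv_mesh, ← smul_smul, smul_sub, ContinuousLinearMap.comp_smul]

/-- **The product rule IS the covariant difference quotient, ROW bonds**: for `c` the row bond `μ` over `(x,x′)`,
`derivG(c) = L^k·(U(εA_{⟨x,μ⟩})G(x+e_μ,x′) − G(x,x′))` (the `η`-covariant derivative `D^η_{A,μ}` of `x ↦ G(x,x′)`, `η`-units).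
[cite: Balaban1983Higgs3, (1.32) p.420] [cite: Balaban1982Higgs1, (1.7) p.605] -/
theorem derivG_inl (h h' : HiggsLattice.Site P 0 → ℝ) (μ : Fin P.d) (x x' : HiggsLattice.Site P 0) :
    derivG C Ω A msq a k h h' (Sum.inl (μ, (x, x')))
      = ((P.L : ℝ) ^ k) • ((C.U (P.mesh 0) (A ⟨x, μ⟩)).comp (kerG C Ω A msq a k h h' (x.shift μ, x'))
          - kerG C Ω A msq a k h h' (x, x')) := by
  rw [derivG, derivFR_eq, coefA, coefB, valY]
  simp only [fd, fo, hb, Sum.elim_inl, kerG, kerFR, dEta, HiggsLattice.PBond.tgt]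
  simp only [ContinuousLinearMap.comp_smul]
  module

/-- **The product rule IS the covariant difference quotient, COLUMN bonds**: for `c` the column bond `ν` over `(x,x′)`,
`derivG(c) = L^k·(U(εA_{⟨x′,ν⟩})G(x,x′+e_ν)^* − G(x,x′)^*)` — the `η`-covariant derivative `D^η_{A,ν}` of the column slice `x′ ↦ G(x,x′)^*`
(the convention of the torus twin, made an equation by `star_kerG`). [cite: Balaban1983Higgs3, (1.32) p.420] [cite: Balaban1982Higgs1, (2.20) p.610] -/
theorem derivG_inr (h h' : HiggsLattice.Site P 0 → ℝ) (ν : Fin P.d) (x x' : HiggsLattice.Site P 0) :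
    derivG C Ω A msq a k h h' (Sum.inr (ν, (x, x')))
      = ((P.L : ℝ) ^ k) • ((C.U (P.mesh 0) (A ⟨x', ν⟩)).comp (star (kerG C Ω A msq a k h h' (x, x'.shift ν)))
          - star (kerG C Ω A msq a k h h' (x, x'))) := by
  rw [star_kerG, star_kerG, derivG, derivFR_eq, coefA, coefB, valY]
  simp only [fd, fo, hb, Sum.elim_inr, kerFR, dEta, HiggsLattice.PBond.tgt]
  simp only [ContinuousLinearMap.comp_smul]
  module

/-- `G` vanishes unless both arguments lie in the supports, and then `‖G(x,x′)‖ ≤ ‖F(x,x′)‖ ≤ B` (`|hh′| ≤ 1`).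
[cite: Balaban1983Higgs3, (3.1) p.432] -/
theorem norm_kerG_le {S S' : Finset (HiggsLattice.Site P 0)} {c₁ c₂ α : ℝ} {h h' : HiggsLattice.Site P 0 → ℝ}
    (hh : IsSmoothLoc k c₁ c₂ α S h) (hh' : IsSmoothLoc k c₁ c₂ α S' h') {BV : ℝ} (hBV : 0 ≤ BV)
    (bY : ∀ x ∈ S, ∀ y ∈ S', ‖unitV P k • blockKR C Ω A msq a k x y‖ ≤ BV) (z : PSite P) :
    ‖kerG C Ω A msq a k h h' z‖ ≤ BV := by
  rw [kerG, norm_smul, Real.norm_eq_abs]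
  by_cases h1 : h z.1 = 0
  · rw [h1, zero_mul, abs_zero, zero_mul]; exact hBV
  by_cases h2 : h' z.2 = 0
  · rw [h2, mul_zero, abs_zero, zero_mul]; exact hBV
  have hprod : |h z.1 * h' z.2| ≤ 1 := by
    rw [abs_mul]; nlinarith [abs_nonneg (h z.1), abs_nonneg (h' z.2), hh.abs_le z.1, hh'.abs_le z.2]
  have hF : ‖kerFR C Ω A msq a k z‖ ≤ BV := bY z.1 (hh.collar _ h1).1 z.2 (hh'.collar _ h2).1
  calc |h z.1 * h' z.2| * ‖kerFR C Ω A msq a k z‖ ≤ 1 * BV := mul_le_mul hprod hF (norm_nonneg _) zero_le_one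
    _ = BV := one_mul _

/-- the derivative bound in explicit variables: `‖a·D^ηF + b·Y‖ ≤ (1 + c₁)B` on bonds inside, `0` outside. [cite: Balaban1983Higgs3, (3.1) p.432] -/
theorem norm_derivG_core {Sb Sy : Finset (HiggsLattice.Site P 0)} {c₁ c₂ α : ℝ} (hc₁ : 0 ≤ c₁) {gB gY : HiggsLattice.Site P 0 → ℝ}
    (hgB : IsSmoothLoc k c₁ c₂ α Sb gB) (hgY : IsSmoothLoc k c₁ c₂ α Sy gY) {BV : ℝ} (hBV : 0 ≤ BV)
    (bY : ∀ x ∈ Sb, ∀ y ∈ Sy, ‖unitV P k • blockKR C Ω A msq a k x y‖ ≤ BV)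
    (bX : ∀ x ∈ Sb, ∀ y ∈ Sy, ∀ μ : Fin P.d, ‖unitD P k • blockDKR C Ω A msq a k ⟨x, μ⟩ y‖ ≤ BV)
    (x y : HiggsLattice.Site P 0) (μ : Fin P.d) :
    ‖(gY y * gB (x.shift μ)) • (unitD P k • blockDKR C Ω A msq a k ⟨x, μ⟩ y)
        + (gY y * dEta k gB ⟨x, μ⟩) • (unitV P k • blockKR C Ω A msq a k x y)‖ ≤ (1 + c₁) * BV := by
  obtain ⟨X, eX⟩ : ∃ T : E N →L[ℝ] E N, unitD P k • blockDKR C Ω A msq a k ⟨x, μ⟩ y = T := ⟨_, rfl⟩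
  obtain ⟨Y, eY⟩ : ∃ T : E N →L[ℝ] E N, unitV P k • blockKR C Ω A msq a k x y = T := ⟨_, rfl⟩
  rw [eX, eY]
  by_cases hc : x ∈ Sb ∧ y ∈ Sy ∧ x.shift μ ∈ Sb
  · obtain ⟨hx, hy, -⟩ := hc
    have h2 : ‖X‖ ≤ BV := by rw [← eX]; exact bX x hx y hy μ
    have h4 : ‖Y‖ ≤ BV := by rw [← eY]; exact bY x hx y hy
    calc ‖(gY y * gB (x.shift μ)) • X + (gY y * dEta k gB ⟨x, μ⟩) • Y‖
        ≤ |gY y * gB (x.shift μ)| * ‖X‖ + |gY y * dEta k gB ⟨x, μ⟩| * ‖Y‖ := by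
          refine (norm_add_le _ _).trans ?_; rw [norm_smul, norm_smul, Real.norm_eq_abs, Real.norm_eq_abs]
      _ ≤ 1 * BV + c₁ * BV :=
          add_le_add (mul_le_mul (abs_coefA_le hgB hgY y _) h2 (norm_nonneg _) zero_le_one)
            (mul_le_mul (abs_coefB_le hgB hgY y _) h4 (norm_nonneg _) hc₁)
      _ = (1 + c₁) * BV := by ring
  · obtain ⟨h0, h0'⟩ := coef_eq_zero hgB hgY hc
    rw [h0, h0', zero_smul ℝ X, zero_smul ℝ Y, add_zero, norm_zero]
    positivity

/-- **`‖D^ηG(c)‖ ≤ (1 + c₁)·B` on every product bond** (row and column). [cite: Balaban1983Higgs3, (3.1) p.432] -/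
theorem norm_derivG_le {S S' : Finset (HiggsLattice.Site P 0)} {c₁ c₂ α : ℝ} (hc₁ : 0 ≤ c₁) {h h' : HiggsLattice.Site P 0 → ℝ}
    (hh : IsSmoothLoc k c₁ c₂ α S h) (hh' : IsSmoothLoc k c₁ c₂ α S' h') {BV : ℝ} (hBV : 0 ≤ BV)
    (bY : ∀ x ∈ S, ∀ y ∈ S', ‖unitV P k • blockKR C Ω A msq a k x y‖ ≤ BV)
    (bX : ∀ x ∈ S, ∀ y ∈ S', ∀ μ : Fin P.d, ‖unitD P k • blockDKR C Ω A msq a k ⟨x, μ⟩ y‖ ≤ BV)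
    (bY' : ∀ x ∈ S', ∀ y ∈ S, ‖unitV P k • blockKR C Ω A msq a k x y‖ ≤ BV)
    (bX' : ∀ x ∈ S', ∀ y ∈ S, ∀ μ : Fin P.d, ‖unitD P k • blockDKR C Ω A msq a k ⟨x, μ⟩ y‖ ≤ BV) (c : PBd P) :
    ‖derivG C Ω A msq a k h h' c‖ ≤ (1 + c₁) * BV := by
  rcases c with ⟨μ, x, x'⟩ | ⟨ν, x, x'⟩
  · simp only [derivG, coefA, coefB, valY, derivFR, fd, fo, hb, Sum.elim_inl, HiggsLattice.PBond.tgt]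
    exact norm_derivG_core hc₁ hh hh' hBV bY bX x x' μ
  · simp only [derivG, coefA, coefB, valY, derivFR, fd, fo, hb, Sum.elim_inr, HiggsLattice.PBond.tgt]
    exact norm_derivG_core hc₁ hh' hh hBV bY' bX' x' x ν

/-- **The multiplier constant** `K(c₁,c₂,d,m) = 2 + c₁ + (2dc₁ + 2) + 2dmc₁ + (c₂ + dc₁² + 2c₁)` (sup parts `1 + (1 + c₁)`, Hölder part: the
moduli of `a`, the value moves, the moduli of `b`). [cite: Balaban1983Higgs3, (3.1) p.432] -/
def smoothConst (d m : ℕ) (c₁ c₂ : ℝ) : ℝ :=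
  2 + c₁ + ((2 * (d : ℝ) * c₁ + 2) + 2 * (d : ℝ) * (m : ℝ) * c₁ + (c₂ + (d : ℝ) * c₁ * c₁ + 2 * c₁))

/-- `K(c₁,c₂,d,m) > 0`. [cite: Balaban1983Higgs3, (3.1) p.432] -/
theorem smoothConst_pos (d m : ℕ) {c₁ c₂ : ℝ} (hc₁ : 0 ≤ c₁) (hc₂ : 0 ≤ c₂) : 0 < smoothConst d m c₁ c₂ := by
  unfold smoothConst; positivity

/-- **The Hölder quotients of `D^ηG` over same-direction product bonds at positive distance**, from the core estimate on the admissible pair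
seen from the bond (`(S, S′)` for row pairs, `(S′, S)` for column pairs). [cite: Balaban1983Higgs3, (3.1) p.432] [cite: Balaban1983Higgs3, (1.32) p.420] -/
theorem holder_mul_le {S S' : Finset (HiggsLattice.Site P 0)} (hdom : DomPair k K₀ Ω m D S S') {c₁ c₂ α : ℝ} (hc₁ : 0 ≤ c₁)
    (hc₂ : 0 ≤ c₂) (hα0 : 0 ≤ α) (hα1 : α ≤ 1) {h h' : HiggsLattice.Site P 0 → ℝ} (hh : IsSmoothLoc k c₁ c₂ α S h)
    (hh' : IsSmoothLoc k c₁ c₂ α S' h') {BV BH : ℝ} (hBV : 0 ≤ BV) (hBH : 0 ≤ BH)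
    (bY : ∀ x ∈ S, ∀ y ∈ S', ‖unitV P k • blockKR C Ω A msq a k x y‖ ≤ BV)
    (bX : ∀ x ∈ S, ∀ y ∈ S', ∀ μ : Fin P.d, ‖unitD P k • blockDKR C Ω A msq a k ⟨x, μ⟩ y‖ ≤ BV)
    (bH : ∀ (μ : Fin P.d) (x₁ x₂ y₁ y₂ : HiggsLattice.Site P 0), x₁ ∈ S → x₂ ∈ S → y₁ ∈ S' → y₂ ∈ S' →
      0 < max (HiggsLattice.Site.tdist x₁ x₂ : ℝ) (HiggsLattice.Site.tdist y₁ y₂ : ℝ) / (P.L : ℝ) ^ k →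
      ‖(hol C A x₁ (cpath x₁ x₂)).comp
            ((unitD P k • blockDKR C Ω A msq a k ⟨x₂, μ⟩ y₂).comp (star (hol C A y₁ (cpath y₁ y₂))))
          - unitD P k • blockDKR C Ω A msq a k ⟨x₁, μ⟩ y₁‖
        ≤ BH * (max (HiggsLattice.Site.tdist x₁ x₂ : ℝ) (HiggsLattice.Site.tdist y₁ y₂ : ℝ) / (P.L : ℝ) ^ k) ^ α)
    (bM : ∀ (x₁ x₂ y₁ y₂ : HiggsLattice.Site P 0), x₁ ∈ S → x₂ ∈ S → y₁ ∈ S' → y₂ ∈ S' →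
      ‖(hol C A x₁ (cpath x₁ x₂)).comp
            ((unitV P k • blockKR C Ω A msq a k x₂ y₂).comp (star (hol C A y₁ (cpath y₁ y₂))))
          - unitV P k • blockKR C Ω A msq a k x₁ y₁‖
        ≤ (P.d : ℝ) * (((HiggsLattice.Site.tdist x₁ x₂ : ℝ) + (HiggsLattice.Site.tdist y₁ y₂ : ℝ)) / (P.L : ℝ) ^ k) * BV)
    (bY' : ∀ x ∈ S', ∀ y ∈ S, ‖unitV P k • blockKR C Ω A msq a k x y‖ ≤ BV)
    (bX' : ∀ x ∈ S', ∀ y ∈ S, ∀ μ : Fin P.d, ‖unitD P k • blockDKR C Ω A msq a k ⟨x, μ⟩ y‖ ≤ BV)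
    (bH' : ∀ (μ : Fin P.d) (x₁ x₂ y₁ y₂ : HiggsLattice.Site P 0), x₁ ∈ S' → x₂ ∈ S' → y₁ ∈ S → y₂ ∈ S →
      0 < max (HiggsLattice.Site.tdist x₁ x₂ : ℝ) (HiggsLattice.Site.tdist y₁ y₂ : ℝ) / (P.L : ℝ) ^ k →
      ‖(hol C A x₁ (cpath x₁ x₂)).comp
            ((unitD P k • blockDKR C Ω A msq a k ⟨x₂, μ⟩ y₂).comp (star (hol C A y₁ (cpath y₁ y₂))))
          - unitD P k • blockDKR C Ω A msq a k ⟨x₁, μ⟩ y₁‖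
        ≤ BH * (max (HiggsLattice.Site.tdist x₁ x₂ : ℝ) (HiggsLattice.Site.tdist y₁ y₂ : ℝ) / (P.L : ℝ) ^ k) ^ α)
    (bM' : ∀ (x₁ x₂ y₁ y₂ : HiggsLattice.Site P 0), x₁ ∈ S' → x₂ ∈ S' → y₁ ∈ S → y₂ ∈ S →
      ‖(hol C A x₁ (cpath x₁ x₂)).comp
            ((unitV P k • blockKR C Ω A msq a k x₂ y₂).comp (star (hol C A y₁ (cpath y₁ y₂))))
          - unitV P k • blockKR C Ω A msq a k x₁ y₁‖
        ≤ (P.d : ℝ) * (((HiggsLattice.Site.tdist x₁ x₂ : ℝ) + (HiggsLattice.Site.tdist y₁ y₂ : ℝ)) / (P.L : ℝ) ^ k) * BV)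
    {c c' : PBd P} (hdir : dirOf c = dirOf c') (hpos : 0 < pdist k (baseOf c) (baseOf c')) :
    ‖transp C A c c' (derivG C Ω A msq a k h h' c') - derivG C Ω A msq a k h h' c‖
      ≤ (BH + ((2 * P.d * c₁ + 2) + 2 * P.d * m * c₁ + (c₂ + P.d * c₁ * c₁ + 2 * c₁)) * BV)
          * pdist k (baseOf c) (baseOf c') ^ α := by
  rcases c with ⟨μ, x₁, y₁⟩ | ⟨μ, y₁, x₁⟩ <;> rcases c' with ⟨μ', x₂, y₂⟩ | ⟨μ', y₂, x₂⟩ <;>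
    simp only [dirOf, Sum.elim_inl, Sum.elim_inr, Sum.inl.injEq, Sum.inr.injEq, reduceCtorEq] at hdir <;> subst hdir
  · simp only [transp, derivG, coefA, coefB, valY, derivFR, fd, fo, hb, Sum.elim_inl, HiggsLattice.PBond.tgt, pdist, baseOf]
    exact holder_core_mul hdom hc₁ hc₂ hα0 hα1 hh hh' hBV hBH bY bX bH bM μ hpos
  · simp only [transp, derivG, coefA, coefB, valY, derivFR, fd, fo, hb, Sum.elim_inr, HiggsLattice.PBond.tgt, pdist, baseOf]
    change 0 < max (HiggsLattice.Site.tdist y₁ y₂ : ℝ) (HiggsLattice.Site.tdist x₁ x₂ : ℝ) / (P.L : ℝ) ^ k at hpos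
    rw [max_comm] at hpos
    have hres := holder_core_mul hdom.symm hc₁ hc₂ hα0 hα1 hh' hh hBV hBH bY' bX' bH' bM' μ hpos
    rw [max_comm]
    exact hres

/-- **The four bounds of `F` on an admissible pair, packed** (Parts 1, 2, 3 of §II and the value-Lipschitz clause) with `B = C_VΦe^{−(δL/2)D}`,
`B_H = (C_H + dmC_M)Φe^{−(δL/2)D}`. [cite: Balaban1983Higgs3, (3.1) p.432] -/
theorem bounds_packS {Sb Sy : Finset (HiggsLattice.Site P 0)} (hdom : DomPair k K₀ Ω m D Sb Sy) (hS : ∀ μ, 2 < P.sitesPerDir 0 μ)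
    (hL2 : 2 ≤ P.L) (hm : 0 < msq) (ha : 0 < a) (hk1 : 1 ≤ k) (hkK : k ≤ P.K) {α δ CV CH CM : ℝ} (hα0 : 0 ≤ α) (hα1 : α ≤ 1)
    (hδ : 0 < δ) (hCV : 0 ≤ CV) (hCH : 0 ≤ CH) (hCM : 0 ≤ CM)
    (hV : ∀ (j : ℕ) (x x' : HiggsLattice.Site P 0), Interior k K₀ Ω x → Interior k K₀ Ω x' →
      (P.mesh 0 ^ P.d)⁻¹ * ∑ i' : Ix N, ‖pieceR C Ω A msq a k j (cb P N 0 (x', i')) x‖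
        ≤ CV * (P.mesh j ^ 2 * (P.mesh j ^ P.d)⁻¹) * Real.exp (-(δ * ((HiggsLattice.Site.tdist x x' : ℝ) / (P.L : ℝ) ^ j))))
    (hDv : ∀ (j : ℕ) (μ : Fin P.d) (x x' : HiggsLattice.Site P 0), Interior k K₀ Ω x → Interior k K₀ Ω x' →
      (P.mesh 0 ^ P.d)⁻¹ * ∑ i' : Ix N, ‖covDeriv C A (pieceR C Ω A msq a k j (cb P N 0 (x', i'))) ⟨x, μ⟩‖
        ≤ CV * (P.mesh j * (P.mesh j ^ P.d)⁻¹) * Real.exp (-(δ * ((HiggsLattice.Site.tdist x x' : ℝ) / (P.L : ℝ) ^ j))))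
    (hH : ∀ (j : ℕ) (μ : Fin P.d) (x₁ x₂ x : HiggsLattice.Site P 0) (Γ : List (HiggsLattice.Site P 0)),
      Interior k K₀ Ω x₁ → Interior k K₀ Ω x₂ → Interior k K₀ Ω x → x₁ ≠ x₂ → IsAdm x₁ x₂ Γ →
      holderTermR C Ω A msq a k j μ x₁ x₂ x Γ
        ≤ (P.mesh 0 * (HiggsLattice.Site.tdist x₁ x₂ : ℝ)) ^ α *
          (CH * (P.mesh j * (P.mesh j ^ P.d)⁻¹ * (P.mesh j ^ α)⁻¹) *
            Real.exp (-(δ * (min (HiggsLattice.Site.tdist x₁ x : ℝ) (HiggsLattice.Site.tdist x₂ x : ℝ) / (P.L : ℝ) ^ j)))))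
    (hM : ∀ (j : ℕ) (μ ν : Fin P.d) (x x' : HiggsLattice.Site P 0), Interior k K₀ Ω x → Interior k K₀ Ω x' →
      mixedTermR C Ω A msq a k j μ ν x x'
        ≤ CM * (P.mesh j ^ P.d)⁻¹ * Real.exp (-(δ * ((HiggsLattice.Site.tdist x x' : ℝ) / (P.L : ℝ) ^ j)))) :
    (∀ x ∈ Sb, ∀ y ∈ Sy, ‖unitV P k • blockKR C Ω A msq a k x y‖ ≤ CV * phiSum P.L (P.d + 1) δ * Real.exp (-(δ * P.L / 2 * D))) ∧
    (∀ x ∈ Sb, ∀ y ∈ Sy, ∀ μ : Fin P.d,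
      ‖unitD P k • blockDKR C Ω A msq a k ⟨x, μ⟩ y‖ ≤ CV * phiSum P.L (P.d + 1) δ * Real.exp (-(δ * P.L / 2 * D))) ∧
    (∀ (μ : Fin P.d) (x₁ x₂ y₁ y₂ : HiggsLattice.Site P 0), x₁ ∈ Sb → x₂ ∈ Sb → y₁ ∈ Sy → y₂ ∈ Sy →
      0 < max (HiggsLattice.Site.tdist x₁ x₂ : ℝ) (HiggsLattice.Site.tdist y₁ y₂ : ℝ) / (P.L : ℝ) ^ k →
      ‖(hol C A x₁ (cpath x₁ x₂)).comp
            ((unitD P k • blockDKR C Ω A msq a k ⟨x₂, μ⟩ y₂).comp (star (hol C A y₁ (cpath y₁ y₂))))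
          - unitD P k • blockDKR C Ω A msq a k ⟨x₁, μ⟩ y₁‖
        ≤ (CH + P.d * m * CM) * phiSum P.L (P.d + 1) δ * Real.exp (-(δ * P.L / 2 * D)) *
            (max (HiggsLattice.Site.tdist x₁ x₂ : ℝ) (HiggsLattice.Site.tdist y₁ y₂ : ℝ) / (P.L : ℝ) ^ k) ^ α) ∧
    (∀ (x₁ x₂ y₁ y₂ : HiggsLattice.Site P 0), x₁ ∈ Sb → x₂ ∈ Sb → y₁ ∈ Sy → y₂ ∈ Sy →
      ‖(hol C A x₁ (cpath x₁ x₂)).comp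
            ((unitV P k • blockKR C Ω A msq a k x₂ y₂).comp (star (hol C A y₁ (cpath y₁ y₂))))
          - unitV P k • blockKR C Ω A msq a k x₁ y₁‖
        ≤ (P.d : ℝ) * (((HiggsLattice.Site.tdist x₁ x₂ : ℝ) + (HiggsLattice.Site.tdist y₁ y₂ : ℝ)) / (P.L : ℝ) ^ k) *
            (CV * phiSum P.L (P.d + 1) δ * Real.exp (-(δ * P.L / 2 * D)))) := by
  refine ⟨fun x hx y hy => ?_, fun x hx y hy μ => ?_, fun μ x₁ x₂ y₁ y₂ hx₁ hx₂ hy₁ hy₂ hpos => ?_,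
    fun x₁ x₂ y₁ y₂ hx₁ hx₂ hy₁ hy₂ => ?_⟩
  · exact sup_part_leS hdom hL2 hm ha hk1 hkK hδ hCV hV (z := (x, y)) (mem_sitesS.2 ⟨hx, hy⟩)
  · rw [norm_smul, Real.norm_eq_abs, abs_of_pos (unitD_pos P k)]
    exact deriv_raw_leS hdom hL2 hm ha hk1 hkK hδ hCV hDv hx hy μ
  · exact holder_coreS hdom hS hL2 hm ha hk1 hkK hα0 hα1 hδ hCH hCM hH hM μ hx₁ hx₂ hy₁ hy₂ hpos
  · exact value_move_leS hdom hS hL2 hm ha hk1 hkK hδ hCV hDv hx₁ hx₂ hy₁ hy₂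

/-- **`‖hG_k(Ω,A)h′‖_{1,α} ≤ (K(c₁,c₂,d,m)·C_V + C_H + dmC_M)·Φ·e^{−(δL/2)D}` ON THE WHOLE PRODUCT LATTICE for smooth localization functions
`h, h′` supported in an admissible pair of domains, given the four model-form inputs at interior points (value, derivative, Hölder,
mixed) with a common rate `δ`.** [cite: Balaban1983Higgs3, (3.1) p.432] [cite: Balaban1983Higgs3, (1.32) p.420] -/
theorem normHGHS_le {S S' : Finset (HiggsLattice.Site P 0)} (hdom : DomPair k K₀ Ω m D S S') (hS : ∀ μ, 2 < P.sitesPerDir 0 μ)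
    (hL2 : 2 ≤ P.L) (hm : 0 < msq) (ha : 0 < a) (hk1 : 1 ≤ k) (hkK : k ≤ P.K) {α δ CV CH CM c₁ c₂ : ℝ} (hα0 : 0 ≤ α)
    (hα1 : α ≤ 1) (hδ : 0 < δ) (hCV : 0 ≤ CV) (hCH : 0 ≤ CH) (hCM : 0 ≤ CM) (hc₁ : 0 ≤ c₁) (hc₂ : 0 ≤ c₂)
    (hV : ∀ (j : ℕ) (x x' : HiggsLattice.Site P 0), Interior k K₀ Ω x → Interior k K₀ Ω x' →
      (P.mesh 0 ^ P.d)⁻¹ * ∑ i' : Ix N, ‖pieceR C Ω A msq a k j (cb P N 0 (x', i')) x‖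
        ≤ CV * (P.mesh j ^ 2 * (P.mesh j ^ P.d)⁻¹) * Real.exp (-(δ * ((HiggsLattice.Site.tdist x x' : ℝ) / (P.L : ℝ) ^ j))))
    (hDv : ∀ (j : ℕ) (μ : Fin P.d) (x x' : HiggsLattice.Site P 0), Interior k K₀ Ω x → Interior k K₀ Ω x' →
      (P.mesh 0 ^ P.d)⁻¹ * ∑ i' : Ix N, ‖covDeriv C A (pieceR C Ω A msq a k j (cb P N 0 (x', i'))) ⟨x, μ⟩‖
        ≤ CV * (P.mesh j * (P.mesh j ^ P.d)⁻¹) * Real.exp (-(δ * ((HiggsLattice.Site.tdist x x' : ℝ) / (P.L : ℝ) ^ j))))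
    (hH : ∀ (j : ℕ) (μ : Fin P.d) (x₁ x₂ x : HiggsLattice.Site P 0) (Γ : List (HiggsLattice.Site P 0)),
      Interior k K₀ Ω x₁ → Interior k K₀ Ω x₂ → Interior k K₀ Ω x → x₁ ≠ x₂ → IsAdm x₁ x₂ Γ →
      holderTermR C Ω A msq a k j μ x₁ x₂ x Γ
        ≤ (P.mesh 0 * (HiggsLattice.Site.tdist x₁ x₂ : ℝ)) ^ α *
          (CH * (P.mesh j * (P.mesh j ^ P.d)⁻¹ * (P.mesh j ^ α)⁻¹) *
            Real.exp (-(δ * (min (HiggsLattice.Site.tdist x₁ x : ℝ) (HiggsLattice.Site.tdist x₂ x : ℝ) / (P.L : ℝ) ^ j)))))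
    (hM : ∀ (j : ℕ) (μ ν : Fin P.d) (x x' : HiggsLattice.Site P 0), Interior k K₀ Ω x → Interior k K₀ Ω x' →
      mixedTermR C Ω A msq a k j μ ν x x'
        ≤ CM * (P.mesh j ^ P.d)⁻¹ * Real.exp (-(δ * ((HiggsLattice.Site.tdist x x' : ℝ) / (P.L : ℝ) ^ j))))
    {h h' : HiggsLattice.Site P 0 → ℝ} (hh : IsSmoothLoc k c₁ c₂ α S h) (hh' : IsSmoothLoc k c₁ c₂ α S' h') :
    normHGHS C Ω A msq a k α h h'
      ≤ (smoothConst P.d m c₁ c₂ * CV + CH + P.d * m * CM) * phiSum P.L (P.d + 1) δ * Real.exp (-(δ * P.L / 2 * D)) := by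
  obtain ⟨bY, bX, bH, bM⟩ := bounds_packS hdom hS hL2 hm ha hk1 hkK hα0 hα1 hδ hCV hCH hCM hV hDv hH hM
  obtain ⟨bY', bX', bH', bM'⟩ := bounds_packS hdom.symm hS hL2 hm ha hk1 hkK hα0 hα1 hδ hCV hCH hCM hV hDv hH hM
  have hΦ := phiSum_pos (L := P.L) (P.d + 1) hδ
  have hBV : 0 ≤ CV * phiSum P.L (P.d + 1) δ * Real.exp (-(δ * P.L / 2 * D)) := by positivity
  have hBH : 0 ≤ (CH + P.d * m * CM) * phiSum P.L (P.d + 1) δ * Real.exp (-(δ * P.L / 2 * D)) := by positivity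
  have h1 : LatticeNorms.supNorm Finset.univ (kerG C Ω A msq a k h h') ≤ CV * phiSum P.L (P.d + 1) δ * Real.exp (-(δ * P.L / 2 * D)) :=
    supNorm_le hBV fun z _ => norm_kerG_le hh hh' hBV bY z
  have h2 : LatticeNorms.supNorm Finset.univ (derivG C Ω A msq a k h h')
      ≤ (1 + c₁) * (CV * phiSum P.L (P.d + 1) δ * Real.exp (-(δ * P.L / 2 * D))) :=
    supNorm_le (by positivity) fun c _ => norm_derivG_le hc₁ hh hh' hBV bY bX bY' bX' c
  have h3 : LatticeNorms.holderSeminorm α (fun c c' : PBd P => dirOf c = dirOf c') (fun c c' => pdist k (baseOf c) (baseOf c'))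
      (transp C A) Finset.univ (derivG C Ω A msq a k h h')
      ≤ (CH + P.d * m * CM) * phiSum P.L (P.d + 1) δ * Real.exp (-(δ * P.L / 2 * D))
          + ((2 * P.d * c₁ + 2) + 2 * P.d * m * c₁ + (c₂ + P.d * c₁ * c₁ + 2 * c₁))
              * (CV * phiSum P.L (P.d + 1) δ * Real.exp (-(δ * P.L / 2 * D))) :=
    holderSeminorm_le (by positivity) fun c _ c' _ hdir hpos =>
      holder_mul_le hdom hc₁ hc₂ hα0 hα1 hh hh' hBV hBH bY bX bH bM bY' bX' bH' bM' hdir hpos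
  rw [normHGHS, norm132]
  calc _ ≤ CV * phiSum P.L (P.d + 1) δ * Real.exp (-(δ * P.L / 2 * D))
        + (1 + c₁) * (CV * phiSum P.L (P.d + 1) δ * Real.exp (-(δ * P.L / 2 * D)))
        + ((CH + P.d * m * CM) * phiSum P.L (P.d + 1) δ * Real.exp (-(δ * P.L / 2 * D))
            + ((2 * P.d * c₁ + 2) + 2 * P.d * m * c₁ + (c₂ + P.d * c₁ * c₁ + 2 * c₁))
                * (CV * phiSum P.L (P.d + 1) δ * Real.exp (-(δ * P.L / 2 * D)))) := add_le_add (add_le_add h1 h2) h3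
    _ = _ := by unfold smoothConst; ring

end Product

/-! ## §IV [B3] (3.1) with smooth localization functions: regions at a regular non-constant background, boxes of interior cubes,
and the vector-field propagator on the torus -/

section Final

/-- a smaller rate gives a larger exponential factor. [folklore] -/
private theorem exp_rate_mono {δ δ' t : ℝ} (h : δ ≤ δ') (ht : 0 ≤ t) : Real.exp (-(δ' * t)) ≤ Real.exp (-(δ * t)) := by
  rw [Real.exp_le_exp]; nlinarith

/-- **[B3] (3.1) p. 432 WITH PRINT'S SMOOTH LOCALIZATION FUNCTIONS, on a big-block-union region `Ω ⊆ T_η` at a regular non-constant background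
`B̃ = A`, PROVED.**  For `d ≥ 1`, `L ≥ 2`, `m² > 0`, `a > 0`, charge data `C`, a box size `m` and bump constants `c₁, c₂ ≥ 0`: there is a
threshold `K₀min ≥ m` such that for every `0 ≤ α < 1` and every cube size `K₀ ≥ K₀min` there are `t, δ₀, O(1) > 0` (depending on `α`, `K₀`,
`m`, `c₁`, `c₂`; GAPS G-B3-11: print's constants are uniform) with: for every volume `P` of [B1] (1.2) with these `d, L` and `K₀ ∣ M`, every step
`1 ≤ k ≤ K` with `L^kε ≤ 1` and `3L^kK₀ ≤ |T_ε|_μ`, every region `Ω` that is a union of big blocks, every background `A` that is `δ_A`-regular on `Ω`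
((I.2.23)) with `L^k·δ_A·|e| ≤ t` (the hypotheses of r14's `ineq210_regularRegion_small`), every admissible pair of localization domains `(S, S′)` at
scale `k` with parameters `m` and `D ≥ 1` (`DomPair`: separated by `L^kD + 1`, interior, contour-closed, diameter `≤ mL^k` — e.g. two boxes of
`m^d` interior unit cubes at cube distance `≥ D`, `domPair_of_boxes`), and all localization functions `h, h′` smooth with constants `c₁, c₂, α`
and supported (with collar) in `S`, `S′` (`IsSmoothLoc`):
`‖hG_k(Ω,A)h′‖_{1,α} ≤ O(1)·e^{−δ₀D}`, the norm being the printed (1.32) sum form of `G = (h ⊗ h′)G_k(Ω,A;·,·)` over the WHOLE product lattice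
with covariant `η`-derivatives in all `2d` directions and the transports `U(A(Γ))∘·∘U(A(Γ′))^*` (`normHGHS`).  Assembled (`normHGHS_le`) from
r14's (2.10) on regions, p35's (2.11) on regions and p33's mixed clause on regions through the pieces (2.6), with `δ₀ = δL/2`, `δ = min` of the
three input rates, `O(1) = (K(c₁,c₂,d,m)C_V + C_H + dmC_M)Φ_{d+1}(δ, L)`.
[cite: Balaban1983Higgs3, (3.1) p.432] [cite: Balaban1983Higgs3, p.420] [cite: Balaban1983Higgs3, (2.10)–(2.11) p.426]
[cite: Balaban1982Higgs1, Prop. 2.1 (2.23) p.610] -/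
theorem ineq31_smooth_regularRegion (d L : ℕ) (hd : 1 ≤ d) (hL : 2 ≤ L) {a : ℝ} (ha : 0 < a) {msq : ℝ} (hmsq : 0 < msq)
    (N : ℕ) (C : ChargeData N) (m : ℕ) {c₁ c₂ : ℝ} (hc₁ : 0 ≤ c₁) (hc₂ : 0 ≤ c₂) :
    ∃ K₀min : ℕ, m ≤ K₀min ∧ ∀ {α : ℝ}, 0 ≤ α → α < 1 → ∀ K₀ : ℕ, K₀min ≤ K₀ → ∃ t δ₀ Cst : ℝ, 0 < t ∧ 0 < δ₀ ∧ 0 < Cst ∧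
      ∀ (P : HiggsLattice.Params), P.d = d → P.L = L → K₀ ∣ P.M →
      ∀ {k : ℕ}, 1 ≤ k → k ≤ P.K → (∀ μ, 3 * half P k K₀ ≤ P.sitesPerDir 0 μ) → P.mesh k ≤ 1 →
      ∀ (Ω : Finset (HiggsLattice.Site P 0)), IsBigBlockUnion k K₀ Ω →
      ∀ (A : HiggsLattice.VecField P 0) {δA : ℝ}, 0 ≤ δA →
        (∀ z ∈ Ω, ∀ μ ν : Fin P.d, |A ⟨z.shift ν, μ⟩ - A ⟨z, μ⟩| ≤ δA) →
        (P.L : ℝ) ^ k * δA * |C.e| ≤ t →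
        ∀ {D : ℝ} {S S' : Finset (HiggsLattice.Site P 0)}, DomPair k K₀ Ω m D S S' →
        ∀ {h h' : HiggsLattice.Site P 0 → ℝ}, IsSmoothLoc k c₁ c₂ α S h → IsSmoothLoc k c₁ c₂ α S' h' →
          normHGHS C Ω A msq a k α h h' ≤ Cst * Real.exp (-(δ₀ * D)) := by
  have hLpos : (0 : ℝ) < L := by exact_mod_cast (by omega : 0 < L)
  obtain ⟨K₁, h210⟩ := ineq210_regularRegion_explicit_small d L hd hL ha hmsq N C
  obtain ⟨K₂, h211⟩ := ineq211At_regularRegion_small_explicit d L hd hL ha hmsq N C (a := a)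
  obtain ⟨K₃, hmix⟩ := ineq210_mixed_regularRegion d L hd hL ha hmsq N C
  refine ⟨max m (max K₁ (max K₂ K₃)), le_max_left _ _, fun {α} hα0 hα1 K₀ hK₀ => ?_⟩
  have hK' : max K₁ (max K₂ K₃) ≤ K₀ := (le_max_right _ _).trans hK₀
  obtain ⟨t₁, δ₁, C₁, ht₁, hδ₁, hC₁, h210⟩ := h210 K₀ ((le_max_left _ _).trans hK')
  obtain ⟨t₂, δ₂, C₂, ht₂, hδ₂, hC₂, h211⟩ := h211 hα0 hα1 K₀ (((le_max_left _ _).trans (le_max_right _ _)).trans hK')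
  obtain ⟨t₃, δ₃, C₃, ht₃, hδ₃, hC₃, hmix⟩ := hmix K₀ (((le_max_right _ _).trans (le_max_right _ _)).trans hK')
  obtain ⟨δ, hδdef⟩ : ∃ δ : ℝ, δ = min δ₁ (min δ₂ δ₃) := ⟨_, rfl⟩
  have hδ : 0 < δ := by rw [hδdef]; exact lt_min hδ₁ (lt_min hδ₂ hδ₃)
  have hle₁ : δ ≤ δ₁ := by rw [hδdef]; exact min_le_left _ _
  have hle₂ : δ ≤ δ₂ := by rw [hδdef]; exact (min_le_right _ _).trans (min_le_left _ _)
  have hle₃ : δ ≤ δ₃ := by rw [hδdef]; exact (min_le_right _ _).trans (min_le_right _ _)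
  have hKc := smoothConst_pos d m hc₁ hc₂
  refine ⟨min t₁ (min t₂ t₃), δ * L / 2, (smoothConst d m c₁ c₂ * C₁ + C₂ + d * m * C₃) * phiSum L (d + 1) δ,
    lt_min ht₁ (lt_min ht₂ ht₃), by positivity, ?_, ?_⟩
  · have hΦ := phiSum_pos (L := L) (d + 1) hδ
    positivity
  intro P hPd hPL hK₀M k hk1 hkK h3 hmesh Ω hΩ A δA hδA hreg ht D S S' hdom h h' hh hh'
  have hP1 : 1 < P.L := by omega
  have hL2 : 2 ≤ P.L := by omega
  have hI := h210 P hP1 hPd hPL hK₀M hk1 hkK h3 hmesh Ω hΩ A hδA hreg (ht.trans (min_le_left _ _))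
  have hHo := h211 P hP1 hPd hPL hK₀M hk1 hkK h3 hmesh Ω hΩ A hδA hreg (ht.trans ((min_le_right _ _).trans (min_le_left _ _)))
  have hMi := hmix P hPd hPL hK₀M hk1 hkK h3 hmesh Ω hΩ A hδA hreg (ht.trans ((min_le_right _ _).trans (min_le_right _ _)))
  subst hPd hPL
  have hS : ∀ μ, 2 < P.sitesPerDir 0 μ := two_lt_sitesPerDir (hk1.trans hkK) hL2
  -- the three located inputs in model form, weakened to the common rate `δ`
  have hV : ∀ (j : ℕ) (x x' : HiggsLattice.Site P 0), Interior k K₀ Ω x → Interior k K₀ Ω x' →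
      (P.mesh 0 ^ P.d)⁻¹ * ∑ i' : Ix N, ‖pieceR C Ω A msq a k j (cb P N 0 (x', i')) x‖
        ≤ C₁ * (P.mesh j ^ 2 * (P.mesh j ^ P.d)⁻¹) * Real.exp (-(δ * ((HiggsLattice.Site.tdist x x' : ℝ) / (P.L : ℝ) ^ j))) := by
    intro j x x' hx hx'
    have := P.mesh_pos j
    exact (bounds_of_ineq210R (hI j x x' hx hx')).1.trans
      (mul_le_mul_of_nonneg_left (exp_rate_mono hle₁ (by positivity)) (by positivity))
  have hDv : ∀ (j : ℕ) (μ : Fin P.d) (x x' : HiggsLattice.Site P 0), Interior k K₀ Ω x → Interior k K₀ Ω x' →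
      (P.mesh 0 ^ P.d)⁻¹ * ∑ i' : Ix N, ‖covDeriv C A (pieceR C Ω A msq a k j (cb P N 0 (x', i'))) ⟨x, μ⟩‖
        ≤ C₁ * (P.mesh j * (P.mesh j ^ P.d)⁻¹) * Real.exp (-(δ * ((HiggsLattice.Site.tdist x x' : ℝ) / (P.L : ℝ) ^ j))) := by
    intro j μ x x' hx hx'
    have := P.mesh_pos j
    exact ((bounds_of_ineq210R (hI j x x' hx hx')).2 μ).trans
      (mul_le_mul_of_nonneg_left (exp_rate_mono hle₁ (by positivity)) (by positivity))
  have hH : ∀ (j : ℕ) (μ : Fin P.d) (x₁ x₂ x : HiggsLattice.Site P 0) (Γ : List (HiggsLattice.Site P 0)),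
      Interior k K₀ Ω x₁ → Interior k K₀ Ω x₂ → Interior k K₀ Ω x → x₁ ≠ x₂ → IsAdm x₁ x₂ Γ →
      holderTermR C Ω A msq a k j μ x₁ x₂ x Γ
        ≤ (P.mesh 0 * (HiggsLattice.Site.tdist x₁ x₂ : ℝ)) ^ α *
          (C₂ * (P.mesh j * (P.mesh j ^ P.d)⁻¹ * (P.mesh j ^ α)⁻¹) *
            Real.exp (-(δ * (min (HiggsLattice.Site.tdist x₁ x : ℝ) (HiggsLattice.Site.tdist x₂ x : ℝ) / (P.L : ℝ) ^ j)))) := by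
    intro j μ x₁ x₂ x Γ hx₁ hx₂ hx hne hΓ
    have := P.mesh_pos j
    have := P.mesh_pos 0
    refine (bound_of_ineq211AtR hne (hHo j μ x₁ x₂ x hx₁ hx₂ hx hne Γ hΓ)).trans (mul_le_mul_of_nonneg_left
      (mul_le_mul_of_nonneg_left (exp_rate_mono hle₂ (by positivity)) (by positivity)) (by positivity))
  have hM : ∀ (j : ℕ) (μ ν : Fin P.d) (x x' : HiggsLattice.Site P 0), Interior k K₀ Ω x → Interior k K₀ Ω x' →
      mixedTermR C Ω A msq a k j μ ν x x'
        ≤ C₃ * (P.mesh j ^ P.d)⁻¹ * Real.exp (-(δ * ((HiggsLattice.Site.tdist x x' : ℝ) / (P.L : ℝ) ^ j))) := by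
    intro j μ ν x x' hx hx'
    have := P.mesh_pos j
    exact (hMi j μ ν x x' hx hx').trans (mul_le_mul_of_nonneg_left (exp_rate_mono hle₃ (by positivity)) (by positivity))
  exact normHGHS_le hdom hS hL2 hmsq ha hk1 hkK hα0 hα1.le hδ hC₁.le hC₂.le hC₃.le hc₁ hc₂ hV hDv hH hM hh hh'

/-- **[B3] (3.1) with smooth localization functions, FOR TWO BOXES OF INTERIOR UNIT CUBES** — the printed situation: `h` a smooth bump with
`h = 1` on `□(v)` and `h = 0` off a neighbourhood inside a box of `m` unit cubes a side around it (`m = 2`: the cubes «with sides of length 2»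
of the vector-leg partitions of unity), `h′` likewise, the two boxes made of interior cubes of `Ω` and every cube of the one at cube distance
`≥ D ≥ 1` from every cube of the other: `‖hG_k(Ω,A)h′‖_{1,α} ≤ O(1)·e^{−δ₀D}` under the hypotheses of `ineq31_smooth_regularRegion` (whose
threshold `K₀min ≥ m` makes the boxes fit, `2mL^k ≤ 3L^kK₀ ≤ |T_ε|_μ`). [cite: Balaban1983Higgs3, (3.1) p.432] [cite: Balaban1983Higgs3, p.420] -/
theorem ineq31_smooth_boxes (d L : ℕ) (hd : 1 ≤ d) (hL : 2 ≤ L) {a : ℝ} (ha : 0 < a) {msq : ℝ} (hmsq : 0 < msq)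
    (N : ℕ) (C : ChargeData N) (m : ℕ) {c₁ c₂ : ℝ} (hc₁ : 0 ≤ c₁) (hc₂ : 0 ≤ c₂) :
    ∃ K₀min : ℕ, ∀ {α : ℝ}, 0 ≤ α → α < 1 → ∀ K₀ : ℕ, K₀min ≤ K₀ → ∃ t δ₀ Cst : ℝ, 0 < t ∧ 0 < δ₀ ∧ 0 < Cst ∧
      ∀ (P : HiggsLattice.Params), P.d = d → P.L = L → K₀ ∣ P.M →
      ∀ {k : ℕ}, 1 ≤ k → k ≤ P.K → (∀ μ, 3 * half P k K₀ ≤ P.sitesPerDir 0 μ) → P.mesh k ≤ 1 →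
      ∀ (Ω : Finset (HiggsLattice.Site P 0)), IsBigBlockUnion k K₀ Ω →
      ∀ (A : HiggsLattice.VecField P 0) {δA : ℝ}, 0 ≤ δA →
        (∀ z ∈ Ω, ∀ μ ν : Fin P.d, |A ⟨z.shift ν, μ⟩ - A ⟨z, μ⟩| ≤ δA) →
        (P.L : ℝ) ^ k * δA * |C.e| ≤ t →
        ∀ {D : ℝ}, 1 ≤ D → ∀ (lo lo' : Fin P.d → ℕ),
          (∀ v v' : HiggsLattice.Site P k, (∀ μ, lo μ ≤ (v μ).val ∧ (v μ).val < lo μ + m) →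
            (∀ μ, lo' μ ≤ (v' μ).val ∧ (v' μ).val < lo' μ + m) → D ≤ cubeDist k v v') →
          (∀ x, InBox k lo m x → Interior k K₀ Ω x) → (∀ x, InBox k lo' m x → Interior k K₀ Ω x) →
        ∀ {h h' : HiggsLattice.Site P 0 → ℝ}, IsSmoothLoc k c₁ c₂ α (boxSet k lo m) h → IsSmoothLoc k c₁ c₂ α (boxSet k lo' m) h' →
          normHGHS C Ω A msq a k α h h' ≤ Cst * Real.exp (-(δ₀ * D)) := by
  obtain ⟨K₀min, hm, hmain⟩ := ineq31_smooth_regularRegion d L hd hL ha hmsq N C m hc₁ hc₂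
  refine ⟨K₀min, fun {α} hα0 hα1 K₀ hK₀ => ?_⟩
  obtain ⟨t, δ₀, Cst, ht, hδ₀, hCst, hmain⟩ := hmain hα0 hα1 K₀ hK₀
  refine ⟨t, δ₀, Cst, ht, hδ₀, hCst, ?_⟩
  intro P hPd hPL hK₀M k hk1 hkK h3 hmesh Ω hΩ A δA hδA hreg ht' D h1 lo lo' hD hS hS' h h' hh hh'
  have hn : ∀ μ, 2 * (m * P.L ^ k) ≤ P.sitesPerDir 0 μ := two_mul_box_le (hm.trans hK₀) h3
  exact hmain P hPd hPL hK₀M hk1 hkK h3 hmesh Ω hΩ A hδA hreg ht' (domPair_of_boxes hkK hn h1 hD hS hS') hh hh'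

/-- **«For external vector fields we have the same definition, but with B̃ = 0» (p. 420)**: for the trivial coupling the transports of (1.32) are
identities, so the norm of the vector instance is the plain Hölder norm. [cite: Balaban1983Higgs3, (1.32) p.420] [cite: Balaban1982Higgs1, p.608] -/
theorem transp_zeroCharge_eq (P : HiggsLattice.Params) (A : HiggsLattice.VecField P 0) :
    transp (zeroCharge P.d) A = fun (_ _ : PBd P) (M : E P.d →L[ℝ] E P.d) => M := by
  funext c c' M
  exact B3Ineq31RegularRegion.transp_zeroCharge A c c' M

/-- **[B3] (3.1) p. 432, the clause «and similarly for the vector field propagator», WITH THE SMOOTH LOCALIZATION FUNCTIONS OF p. 420, PROVED on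
print's torus for EVERY `L ≥ 2`.**  The vector-field propagator `G_k` of p. 414 is the `N = d` propagator on the whole torus at zero background with
a positive mass (`C = zeroCharge d`, `Ω = T_ε`, `A = 0`; [B1] p. 608), the localization functions are smooth bumps supported in boxes of `m` unit
cubes a side (`m = 2` in print: *"a smooth partition of unity satisfying the condition that a support of each function is contained in a cube with
sides of length 2"*), and the norm (1.32) is taken *"with B̃ = 0"* (identity transports, `transp_zeroCharge_eq`).  For `d ≥ 1`, `L ≥ 2`, `m² > 0`,
`a > 0`, `m`, `c₁, c₂ ≥ 0`: a threshold `K₀min` and, for every `0 ≤ α < 1` and `K₀ ≥ K₀min`, constants `δ₀, O(1) > 0` with: for every volume `P` with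
these `d, L` and `K₀ ∣ M`, every `1 ≤ k ≤ K` with `L^kε ≤ 1` and `3L^kK₀ ≤ |T_ε|_μ`, every two boxes of `m` unit cubes a side of `T_1^{(k)}` whose
cubes are pairwise at cube distance `≥ D ≥ 1`, and all `h, h′` smooth (constants `c₁, c₂, α`) supported with collar in the two boxes:
`‖hG_kh′‖_{1,α} ≤ O(1)e^{−δ₀D}` (full product lattice, identity transports). [cite: Balaban1983Higgs3, (3.1) p.432] [cite: Balaban1983Higgs3, p.420]
[cite: Balaban1983Higgs3, p.414] [cite: Balaban1982Higgs1, p.608] -/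
theorem ineq31_smooth_vectorTorus (d L : ℕ) (hd : 1 ≤ d) (hL : 2 ≤ L) {a : ℝ} (ha : 0 < a) {msq : ℝ} (hmsq : 0 < msq) (m : ℕ)
    {c₁ c₂ : ℝ} (hc₁ : 0 ≤ c₁) (hc₂ : 0 ≤ c₂) :
    ∃ K₀min : ℕ, ∀ {α : ℝ}, 0 ≤ α → α < 1 → ∀ K₀ : ℕ, K₀min ≤ K₀ → ∃ δ₀ Cst : ℝ, 0 < δ₀ ∧ 0 < Cst ∧
      ∀ (P : HiggsLattice.Params), P.d = d → P.L = L → K₀ ∣ P.M →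
      ∀ {k : ℕ}, 1 ≤ k → k ≤ P.K → (∀ μ, 3 * half P k K₀ ≤ P.sitesPerDir 0 μ) → P.mesh k ≤ 1 →
        ∀ {D : ℝ}, 1 ≤ D → ∀ (lo lo' : Fin P.d → ℕ),
          (∀ v v' : HiggsLattice.Site P k, (∀ μ, lo μ ≤ (v μ).val ∧ (v μ).val < lo μ + m) →
            (∀ μ, lo' μ ≤ (v' μ).val ∧ (v' μ).val < lo' μ + m) → D ≤ cubeDist k v v') →
        ∀ {h h' : HiggsLattice.Site P 0 → ℝ}, IsSmoothLoc k c₁ c₂ α (boxSet k lo m) h → IsSmoothLoc k c₁ c₂ α (boxSet k lo' m) h' →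
          norm132 α (fun c c' : PBd P => dirOf c = dirOf c') (fun c c' => pdist k (baseOf c) (baseOf c'))
              (fun (_ _ : PBd P) (M : E P.d →L[ℝ] E P.d) => M) Finset.univ Finset.univ
              (kerG (zeroCharge P.d) Finset.univ (0 : HiggsLattice.VecField P 0) msq a k h h')
              (derivG (zeroCharge P.d) Finset.univ (0 : HiggsLattice.VecField P 0) msq a k h h')
            ≤ Cst * Real.exp (-(δ₀ * D)) := by
  obtain ⟨K₀min, hmain⟩ := ineq31_smooth_boxes d L hd hL ha hmsq d (zeroCharge d) m hc₁ hc₂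
  refine ⟨K₀min, fun {α} hα0 hα1 K₀ hK₀ => ?_⟩
  obtain ⟨t, δ₀, Cst, ht, hδ₀, hCst, hmain⟩ := hmain hα0 hα1 K₀ hK₀
  refine ⟨δ₀, Cst, hδ₀, hCst, ?_⟩
  intro P hPd hPL hK₀M k hk1 hkK h3 hmesh D h1 lo lo' hD h h' hh hh'
  subst hPd
  have hreg : ∀ z ∈ (Finset.univ : Finset (HiggsLattice.Site P 0)), ∀ μ ν : Fin P.d,
      |(0 : HiggsLattice.VecField P 0) ⟨z.shift ν, μ⟩ - (0 : HiggsLattice.VecField P 0) ⟨z, μ⟩| ≤ 0 := by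
    intro z _ μ ν; simp
  have ht' : (P.L : ℝ) ^ k * (0 : ℝ) * |(zeroCharge P.d).e| ≤ t := by rw [mul_zero, zero_mul]; exact ht.le
  have hres := hmain P rfl hPL hK₀M hk1 hkK h3 hmesh Finset.univ isBigBlockUnion_univ 0 le_rfl hreg ht' h1 lo lo' hD
    (fun x _ => interior_univ x) (fun x _ => interior_univ x) hh hh'
  rw [normHGHS, transp_zeroCharge_eq] at hres
  exact hres

end Final




end Literature.MathematicalPhysics.QuantumFieldTheory.Balaban1983to89.B3Ineq31SmoothLocalization

end
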